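import Mathlib.Analysis.InnerProductSpace.Calculus
import Mathlib.Analysis.InnerProductSpace.Dual
import Mathlib.Analysis.Calculus.Deriv.Inv
import Mathlib.Analysis.Calculus.Gradient.Basic
import Mathlib.Topology.Algebra.Module.PerfectPairing
import Literature.Geometry.Riemannian.TwoConvexSchoenflies
import Literature.Geometry.Riemannian.KuiperProofs
import Literature.Topology.FourManifolds.DehnSurgeryTubularNbhdProofs
import Literature.Topology.FourManifolds.ImmersionCriterion
import Literature.Geometry.Riemannian.PConvexDomainHomotopyType
import Literature.Geometry.Riemannian.KConvexLevelSet
import Literature.Analysis.PDE.HopfLemmas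
import Mathlib.RingTheory.MvPolynomial.Symmetric.Defs
import Mathlib.Analysis.Convex.GaugeRescale
import Mathlib.Analysis.SpecialFunctions.Complex.Circle
import Literature.AlgebraicTopology.FundamentalGroup.CircleValuedLift
import Literature.Analysis.InnerProduct.KyFanTwoSmallest
import Literature.Topology.FourManifolds.HeightDictionary
import Literature.Topology.FourManifolds.OneHandlebodyBoundaryFundamentalGroup
import Literature.Topology.FourManifolds.MorseExistence
import Literature.Topology.FourManifolds.CorkDecomposition
import Literature.Topology.FourManifolds.TrisectionFunctorGKGenusZero
import HarnessLib

/-!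
# Huisken–Sinestrari, Cor. 1.3 — the discharge (Morse theory of the bounded region) and the
# proved steps of the printed proof

Sorry-free companion of `TwoConvexSchoenflies.lean`, whose named fact
`Literature.Geometry.Riemannian.HuiskenSinestrari2009_twoConvex_simplyConnected` is the first clause
of Huisken–Sinestrari, *Mean curvature flow with surgeries of two-convex hypersurfaces*, Invent.
Math. 175 (2009) 137–221, **Cor. 1.3** (p. 139): a smooth closed simply connected two-convex
embedded hypersurface `Mⁿ ⊂ ℝⁿ⁺¹`, `n ≥ 3`, is diffeomorphic to `Sⁿ`.

**Status of the fact.** DISCHARGED here: `HuiskenSinestrari2009_twoConvex_simplyConnected_holds`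
(§ "Discharge", last section), by the Morse theory of the compact region `Ω = {F ≤ 0}` bounded by
the hypersurface — the "different approaches" the paper points to for Cor. 1.2 (p. 139,
refs. [9, 23, 27, 30]: height / distance functions on `p`-convex domains, Sha 1986, Wu 1987),
carried out with the tree's PROVED Morse library `Literature/Topology/FourManifolds`: for almost
every direction `v` the height `⟪v, e ·⟫` is Morse (`ae_isMorse_height`,
`HeightDictionary.isMorse_inner_comp_iff`); weak two-convexity then leaves at most one negative
principal curvature at each upward-normal point (`exists_posSubspace_of_twoConvex`, § "Positive
hyperplane"); so the exp-height function `e^{t⟪v,·⟫} F` presents `Ω` as a handlebody of index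
`≤ 1` (`ExpHeight.exists_regularSublevel_isHandlebodyOfIndexLE_one`); after cancelling surplus
`0`-handles (Milnor 1965, Thm. 8.1) `π₁(Ω) ≅ F_m` is the image of `π₁(∂Ω) = π₁(M) = 1`
(`IsMorseAdapted.isFreeOfRank_fundamentalGroup`,
`IsMorseAdapted.surjective_and_injective_inclHom_boundary`), hence `m = 0`, `Ω ≅ 𝔻ⁿ⁺¹` by the
Morse disc lemma (`IsMorseAdapted.nonempty_diffeomorph_closedBall`) and `M ≅ ∂Ω ≅ 𝕊ⁿ`
(`BoundaryData.restrictDiffeomorph`).  The PRINTED proof (pp. 218–219) is Theorem 1.1 —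
existence of a *mean curvature flow with surgeries* that terminates after finitely many steps
(§§2–8: short-time existence Thm. 2.2, invariance of the class `C(R, α)` Prop. 2.6, necks and
standard surgery §3, convexity / cylindrical / gradient estimates Thms. 1.4–1.6, neck detection
§7, neck continuation Thm. 8.2) — followed by the topological bookkeeping of Prop. 3.23 and
Thm. 3.26 (surgeries reverse to connected sums; simply connected ⇒ no `Sⁿ⁻¹ × S¹` summand). None
of this analytic theory (second fundamental form of an immersed hypersurface, existence for the
quasilinear parabolic system, tensor maximum principles) exists in Mathlib or in the tree.

**What is proved** (the steps of the printed proof that identify a surface with the *standard*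
sphere, which is where the flow with surgeries *ends*: a component "recognised as convex", Thm.
7.14 / Cor. 7.15, or the boundary of a convex region, pp. 218–219):

* `exists_diffeomorph_sphere_of_normalize` — engine: for a `C^∞` immersion `e : M → ℝⁿ⁺¹` of a
  compact connected boundaryless `n`-manifold, `n ≥ 2`, and a smooth field `Ψ` nowhere zero on
  `e(M)` whose differential is nondegenerate modulo `ℝΨ` along `de`, the map `Ψ(e ·)/|Ψ(e ·)|` is
  a diffeomorphism `M ≅ Sⁿ` (injective differential ⇒ local diffeomorphism by the inverse
  function theorem `Literature.Topology.FourManifolds.isLocalDiffeomorphAt_of_mfderiv`; a local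
  diffeomorphism from a compact connected manifold onto the simply connected `Sⁿ` is a
  diffeomorphism, `Literature.Geometry.Riemannian.diffeomorphOfIsLocalDiffeomorph` with
  `Literature.AlgebraicTopology.FundamentalGroup.simplyConnectedSpace_euclideanSphere`) — the
  "well known results" of the last lines of the proof of Thm. 7.14 (p. 203);
* `exists_diffeomorph_sphere_gaussMap` — **Hadamard's theorem** in the level-set idiom of the
  fact: `λ₁ > 0` (`D²F > 0` on `ker dF`) ⇒ the Gauss map `∇F(e ·)/|∇F(e ·)|` is a diffeomorphism
  onto `Sⁿ` (Thm. 7.14, p. 203: "Since `λ₁ > 0` on `M`, the Gauss map is also a local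
  diffeomorphism. Then, since `Sⁿ` is simply connected for `n > 1`, well known results imply that
  the map is a global diffeomorphism");
* `exists_diffeomorph_sphere_radial` — the radial projection from `p` is a diffeomorphism onto
  `Sⁿ` as soon as `dF(x)(x - p) ≠ 0` on `e(M)`;
* `fderiv_apply_sub_pos_of_convex_sublevel` — for a convex sublevel set `{F ≤ 0}` and `F p < 0`,
  `dF(x)(x - p) > 0` at every regular zero `x` (first-order condition at a constrained maximum);
* `HuiskenSinestrari2009_twoConvex_simplyConnected_of_strictlyConvex`,
  `HuiskenSinestrari2009_twoConvex_simplyConnected_of_convex_sublevel` — the fact, verbatim in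
  its binders, with the two-convexity clause strengthened to `λ₁ > 0`, resp. replaced by
  convexity of `{F ≤ 0}` (both are two-convex situations: `λᵢ ≥ 0 ⇒ λ₁ + λ₂ ≥ 0`);
* `HuiskenSinestrari2009_twoConvex_hypotheses_roundSphere` — sign / non-vacuity check: the round
  `Sⁿ ⊂ ℝⁿ⁺¹` with `F = ‖x‖² - 1` satisfies every hypothesis of the fact (the inclusion is a
  `Manifold.IsSmoothEmbedding` by the tree's immersion criterion
  `Literature.Topology.FourManifolds.isSmoothEmbedding_of_injective_of_injective_mfderiv`).
* `HuiskenSinestrari2009_twoConvex_simplyConnected.of_homotopyEquiv_sphere` — the fact implies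
  the statement of the SPC4 route item `CvxTwoConvexStandard` (its case `n = 4`): a homotopy
  `n`-sphere, `n ≥ 3`, smoothly embedded as a compact strictly two-convex regular level set is
  diffeomorphic to `Sⁿ` (homotopy invariance of simple connectivity; compactness of `M` from the
  embedding).
* The **level-set dictionary** behind the fact's encoding of two-convexity (§ "The level-set
  dictionary" below): `exists_hasFDerivAt_gradient` (the gradient field is differentiable, its
  derivative is the Hessian through the inner product), `range_mvfderiv_eq_ker_fderiv` (the
  tangent space `de(T_m M)` of a regular level set is `ker dF(e m)`),
  `inner_mvfderiv_unitNormal_mvfderiv` (Weingarten equation: for the outer unit normal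
  `ν = ∇F/|∇F| ∘ e`, `⟨dν v, de w⟩ = D²F(de v, de w)/|∇F|`) and `twoConvexClause_iff_weingarten`
  (the fact's clause ⇔ `h(v₁, v₁) + h(v₂, v₂) ≥ 0` for all pairs orthonormal in the induced
  metric, the Ky Fan form of `λ₁ + λ₂ ≥ 0` of Huisken–Sinestrari, p. 143).

* **The clause is `λ₁ + λ₂ ≥ 0` (Ky Fan)** (§ "Ky Fan" below): the Hessian restricted to
  `ker dF(x)` is represented by a symmetric operator `T` (`exists_tangentialHessian`), and the
  fact's clause at `x` (with any constant `c`) holds iff the two smallest eigenvalues of `T` sum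
  to `≥ c` (`twoConvexClause_iff_eigenvalues`, from the tree's
  `Literature.Analysis.InnerProduct.kyFan_two_iff` — Huisken–Sinestrari's displayed identity
  `λ₁ + λ₂ = min{W(e₁,e₁) + W(e₂,e₂)}`, p. 143); general `k`: `kConvexClause_iff_eigenvalues`,
  `kConvexClause_lt_iff_eigenvalues`, `isKConvexLevelSetAt_iff_eigenvalues` (the tree's
  `IsKConvexLevelSetAt k F x` ⇔ `λ₁ + ⋯ + λ_k > 0`, Harvey–Lawson Remark 3.12, via `kyFan_lt_iff`).
* **The strictly convex point of Prop. 2.6 (i)** (§ "The farthest point" below; p. 144: "there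
  is at least one point on `M₀` where all eigenvalues are strictly positive" — the step turning
  the fact's weak hypothesis `λ₁ + λ₂ ≥ 0` into strict two-convexity for `t > 0` via the strong
  maximum principle): at a farthest point `x₀` of `{F ≤ 0}` from an interior point `p`,
  `F x₀ = 0` (`exists_eq_zero_forall_norm_sub_le`), `dF(x₀)` is the nonnegative multiple
  `(dF(x₀)(x₀ - p)/R²) ⟨·, x₀ - p⟩` of the radial covector
  (`fderiv_apply_eq_inner_mul_of_forall_norm_sub_le`, `fderiv_apply_sub_pos_of_forall_norm_sub_le`,
  `norm_fderiv_eq_of_forall_norm_sub_le`), and `D²F(x₀)(v, v) ≥ (‖dF(x₀)‖/R) ‖v‖²` on `ker dF(x₀)`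
  (`le_iteratedFDeriv_two_of_forall_norm_sub_le`, by the second-order condition for `F` along a
  parabola osculating the enclosing sphere from outside; `R = ‖x₀ - p‖`), i.e. all principal
  curvatures at `x₀` are `≥ 1/R` (`exists_farthest_forall_le_iteratedFDeriv_two`; Weingarten
  form `h ≥ g/R`: `exists_farthest_weingarten_ge`); hence `{F = 0}` is strictly `k`-convex at
  `x₀` for every `k ≥ 1` (`exists_forall_isKConvexLevelSetAt`, and in the fact's binders
  `exists_forall_isKConvexLevelSetAt_comp`, with the tree's
  `Literature.Geometry.Riemannian.IsKConvexLevelSetAt`).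
* **Prop. 2.7 (i), (ii) and Remark 2.4 (ii)** (pp. 143–145, the pointwise algebra of two-convex
  principal curvatures, sort-free over `lam : Fin n → ℝ` with "`λ₁ + λ₂ ≥ c`" read as
  "`lam i + lam j ≥ c` for `i ≠ j`"): (2.2) `-H ≤ λᵢ ≤ H` (`abs_le_sum_of_twoConvex`,
  `sum_nonneg_of_twoConvex`), (2.3) `|A|² ≤ n H²` (`sum_sq_le_of_twoConvex`) and `H² ≤ n |A|²`
  (`sq_sum_le_mul_sum_sq`), (2.4) `λᵢ ≥ α₀ H/2` off the smallest index
  (`le_of_uniformlyTwoConvex`), and `λ₁ + λ₂ ≥ H/(n-1) ⇒ λ₁ ≥ 0` (`nonneg_of_twoConvex_ge_sum_div`);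
  in the fact's frame-trace idiom: the two-convexity clause implies the weak `k`-clause for
  every `k ≥ 2`, in particular mean convexity (`weakKConvex_succ`, `weakKConvex_mono`,
  `twoConvexClause_weakKConvex`).
* **Prop. 2.7 (iii)** (pp. 144–145), the gradient inequality
  `|H∇ᵢh_kl - ∇ᵢH h_kl|² ≥ (α₀²/8) H² |∇H|²` under `λᵢ + λⱼ ≥ α₀ H`, as pointwise algebra in an
  orthonormal eigenframe with `∇h` totally symmetric (Codazzi):
  `HuiskenSinestrari_gradient_inequality` (own bookkeeping in place of the appeal to
  [18, Lemma 3.2]: `sum_diag_add_sum_offDiag_le_sum₃`, `sum_erase_sq_ge`).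
* **Hadamard's convexity theorem** (§ "Hadamard" below; p. 218: "we recognise a convex closed
  surface which is well known to bound a smooth convex region", cf. Thm. 7.14): a multiplier
  rule at boundary extrema over `{F ≤ 0}` (`exists_fderiv_eq_smul_of_isMinOn_sublevel`),
  supporting half-spaces at every boundary point when the Gauss map is injective
  (`fderiv_apply_sub_nonpos_of_gaussMap_injective`), separation of outside points by the
  tangent hyperplane at the nearest boundary point (`exists_fderiv_apply_sub_pos_of_pos`), hence
  `Convex ℝ {F ≤ 0}` (`convex_sublevel_of_gaussMap_injective`), and — with
  `exists_diffeomorph_sphere_gaussMap` — for every compact regular level hypersurface with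
  `λ₁ > 0` which is the image of a compact connected manifold (`convex_sublevel_of_strictlyConvex`).
* **The convex region is a topological ball** (second clause of Cor. 1.3 in the convex case,
  topological category): `interior {F ≤ 0} = {F < 0}`, `frontier {F ≤ 0} = {F = 0}` for regular
  sublevel sets, and by Mathlib's gauge rescaling an ambient homeomorphism carries a compact
  convex regular region onto the closed unit ball and its boundary hypersurface onto the unit
  sphere (`exists_homeomorph_image_sublevel_eq_closedBall`,
  `exists_homeomorph_image_eq_closedBall_of_strictlyConvex`).
* **`Sⁿ⁻¹ × S¹` is not simply connected** (`not_simplyConnectedSpace_prod_addCircle`,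
  `not_simplyConnectedSpace_of_homotopyEquiv_sphere_prod_circle`, from the tree's circle-valued
  lift lemma): the single-handle case of the `π₁`-obstruction taking Cor. 1.2 to Cor. 1.3.
* **Lemma 2.3** (p. 142): `S₁, …, S_{n-1} > 0 ⇒ λ₁ + λ₂ > 0` for the elementary symmetric
  functions of the principal curvatures (`add_pos_of_esymm_pos`, with Mathlib's `Multiset.esymm`;
  proved here by removing a negative entry, `esymm_pos_of_cons_neg`, `forall_pos_of_esymm_pos`,
  instead of the printed appeal to [19, Lemma 2.4]).
* **Remark 2.4 (i)** (p. 143): the example `(-2, 3, 3)` (`λ₁ + λ₂ > 0`, `S₂ = -3 < 0`;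
  `esymm_two_neg_example`) and the unproved printed claim "if `λ₁ + λ₂ > 0`, then all `S_k`
  with `2k ≤ n` are positive", PROVED here (`esymm_pos_of_add_pos`, via the averaging bounds
  `mul_esymm_ge_of_forall_le` / `mul_esymm_gt_of_forall_lt`:
  `k S_k ≥ a (#s + 1 - k) S_{k-1}` when all entries are `≥ a ≥ 0`).

No `sorry`, no new definitions, no new named facts.

## References

* G. Huisken, C. Sinestrari, *Mean curvature flow with surgeries of two-convex hypersurfaces*,
  Invent. Math. 175 (2009) 137–221: Cor. 1.3 (p. 139), Lemma 2.3, Remark 2.4, Prop. 2.6 and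
  its proof, Prop. 2.7 (pp. 142–145), Thm. 7.14 and its proof (pp. 201–203), proof of
  Cor. 1.2–1.3 (pp. 218–219). [HuiskenSinestrari2008]
* J. Hadamard, *Sur certaines propriétés des trajectoires en dynamique*, J. Math. Pures Appl. (5)
  3 (1897) 331–387 (ovaloids: positive curvature ⇒ the Gauss map is a diffeomorphism and the
  surface bounds a convex body).
* J. M. Lee, *Introduction to Smooth Manifolds*, 2nd ed. (2013), Thm. 4.5 (inverse function
  theorem), Prop. 4.1 (immersions). [LeeSmoothManifolds2013]
-/

noncomputable section

open scoped Manifold ContDiff Topology InnerProductSpace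
open Set Function Module

namespace Literature.Geometry.Riemannian

/-! ### Calculus of the normalisation map `z ↦ z/‖z‖` -/

section Normalize

variable {E : Type*} [NormedAddCommGroup E] [InnerProductSpace ℝ E]

/-- The derivative of the normalisation map `z ↦ ‖z‖⁻¹ • z` at `y ≠ 0` (product rule; the
derivative of `z ↦ ‖z‖⁻¹` is left unevaluated). [folklore] -/
theorem hasFDerivAt_inv_norm_smul {y : E} (hy : y ≠ 0) :
    HasFDerivAt (fun z : E => ‖z‖⁻¹ • z)
      (‖y‖⁻¹ • ContinuousLinearMap.id ℝ E +
        (fderiv ℝ (fun z : E => ‖z‖⁻¹) y).smulRight y) y := by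
  have h1 : DifferentiableAt ℝ (fun z : E => ‖z‖⁻¹) y :=
    (differentiableAt_id.norm ℝ hy).inv (norm_ne_zero_iff.2 hy)
  exact h1.hasFDerivAt.smul (hasFDerivAt_id y)

/-- The kernel of the derivative of `z ↦ ‖z‖⁻¹ • z` at `y ≠ 0` is contained in the line `ℝ y`.
[folklore] -/
theorem exists_eq_smul_of_fderiv_inv_norm_smul_eq_zero {y w : E} (hy : y ≠ 0)
    (hw : fderiv ℝ (fun z : E => ‖z‖⁻¹ • z) y w = 0) : ∃ c : ℝ, w = c • y := by
  rw [(hasFDerivAt_inv_norm_smul hy).fderiv] at hw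
  change ‖y‖⁻¹ • w + (fderiv ℝ (fun z : E => ‖z‖⁻¹) y w) • y = 0 at hw
  have hn : ‖y‖ ≠ 0 := norm_ne_zero_iff.2 hy
  refine ⟨-(‖y‖ * fderiv ℝ (fun z : E => ‖z‖⁻¹) y w), ?_⟩
  have hw' : ‖y‖⁻¹ • w = -(fderiv ℝ (fun z : E => ‖z‖⁻¹) y w • y) :=
    eq_neg_of_add_eq_zero_left hw
  calc w = ‖y‖ • (‖y‖⁻¹ • w) := by rw [smul_smul, mul_inv_cancel₀ hn, one_smul]
    _ = -(‖y‖ * fderiv ℝ (fun z : E => ‖z‖⁻¹) y w) • y := by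
      rw [hw', smul_neg, smul_smul, neg_smul]

/-- The normalisation map is smooth away from the origin. [folklore] -/
theorem contDiffAt_inv_norm_smul {m : ℕ∞ω} {y : E} (hy : y ≠ 0) :
    ContDiffAt ℝ m (fun z : E => ‖z‖⁻¹ • z) y :=
  ((contDiffAt_id.norm ℝ hy).inv (norm_ne_zero_iff.2 hy)).smul contDiffAt_id

end Normalize

/-! ### Normalised vector fields along an immersion as diffeomorphisms onto the sphere -/

section GaussMap

variable {n : ℕ} {M : Type*} [TopologicalSpace M] [ChartedSpace (EuclideanSpace ℝ (Fin n)) M]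
  [IsManifold (𝓡 n) ∞ M]

/-- **Engine: a normalised vector field along an immersion with nondegenerate differential is a
diffeomorphism onto the sphere.** Let `e : M → ℝⁿ⁺¹` be a `C^∞` immersion of a compact connected
boundaryless `n`-manifold, `n ≥ 2`, and `Ψ : ℝⁿ⁺¹ → ℝⁿ⁺¹` a `C^∞` map, nowhere zero on `e(M)`,
such that `dΨ(e m)(de(m) v) ∈ ℝ Ψ(e m)` forces `de(m) v = 0`. Then `m ↦ Ψ(e m)/‖Ψ(e m)‖` is a
diffeomorphism `M ≅ Sⁿ`: its differential is injective (the kernel of `d(z/‖z‖)` is the line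
`ℝ z`), so it is a local diffeomorphism by the inverse function theorem
(`Literature.Topology.FourManifolds.isLocalDiffeomorphAt_of_mfderiv`), and a local
diffeomorphism from a compact connected manifold to the simply connected manifold `Sⁿ`, `n ≥ 2`
(`Literature.AlgebraicTopology.FundamentalGroup.simplyConnectedSpace_euclideanSphere`) is a
diffeomorphism (`Literature.Geometry.Riemannian.diffeomorphOfIsLocalDiffeomorph`). This is the
"well known result" invoked at the end of the proof of Huisken–Sinestrari's Theorem 7.14.
[cite: HuiskenSinestrari2008, Thm. 7.14 (proof, p. 203)] -/
theorem exists_diffeomorph_sphere_of_normalize (hn : 2 ≤ n) [CompactSpace M] [T2Space M]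
    [ConnectedSpace M] {e : M → EuclideanSpace ℝ (Fin (n + 1))}
    (he : Manifold.IsImmersion (𝓡 n) 𝓘(ℝ, EuclideanSpace ℝ (Fin (n + 1))) ∞ e)
    {Ψ : EuclideanSpace ℝ (Fin (n + 1)) → EuclideanSpace ℝ (Fin (n + 1))} (hΨ : ContDiff ℝ ∞ Ψ)
    (hΨ0 : ∀ m, Ψ (e m) ≠ 0)
    (hker : ∀ m v, (∃ c : ℝ,
      fderiv ℝ Ψ (e m) (mfderiv (𝓡 n) 𝓘(ℝ, EuclideanSpace ℝ (Fin (n + 1))) e m v) = c • Ψ (e m)) →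
      mfderiv (𝓡 n) 𝓘(ℝ, EuclideanSpace ℝ (Fin (n + 1))) e m v = 0) :
    ∃ Φ : M ≃ₘ⟮𝓡 n, 𝓡 n⟯ Metric.sphere (0 : EuclideanSpace ℝ (Fin (n + 1))) 1,
      ∀ m, (Φ m : EuclideanSpace ℝ (Fin (n + 1))) = ‖Ψ (e m)‖⁻¹ • Ψ (e m) := by
  haveI hfact : Fact (finrank ℝ (EuclideanSpace ℝ (Fin (n + 1))) = n + 1) :=
    ⟨finrank_euclideanSpace_fin⟩
  -- the map `ν = N ∘ Ψ ∘ e`, `N z = z/‖z‖`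
  set N : EuclideanSpace ℝ (Fin (n + 1)) → EuclideanSpace ℝ (Fin (n + 1)) :=
    fun z => ‖z‖⁻¹ • z with hN
  have hmem : ∀ m, N (Ψ (e m)) ∈ Metric.sphere (0 : EuclideanSpace ℝ (Fin (n + 1))) 1 := by
    intro m
    have h0 : ‖Ψ (e m)‖ ≠ 0 := norm_ne_zero_iff.2 (hΨ0 m)
    simp [hN, norm_smul, h0]
  set ν : M → Metric.sphere (0 : EuclideanSpace ℝ (Fin (n + 1))) 1 :=
    Set.codRestrict (fun m => N (Ψ (e m))) _ hmem with hν
  have he1 : ContMDiff (𝓡 n) 𝓘(ℝ, EuclideanSpace ℝ (Fin (n + 1))) ∞ e := he.contMDiff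
  have hNΨe : ContMDiff (𝓡 n) 𝓘(ℝ, EuclideanSpace ℝ (Fin (n + 1))) ∞ (fun m => N (Ψ (e m))) :=
    fun m => ((contDiffAt_inv_norm_smul (hΨ0 m)).comp _ hΨ.contDiffAt).contMDiffAt.comp m (he1 m)
  have hνsmooth : ContMDiff (𝓡 n) (𝓡 n) ∞ ν := hNΨe.codRestrict_sphere hmem
  -- key step: the differential of `ν` is injective
  have hkey : ∀ m, Injective (mfderiv (𝓡 n) (𝓡 n) ν m) := by
    intro m
    have hz0 : Ψ (e m) ≠ 0 := hΨ0 m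
    set De := mfderiv (𝓡 n) 𝓘(ℝ, EuclideanSpace ℝ (Fin (n + 1))) e m with hDe
    set Dval := mfderiv (𝓡 n) 𝓘(ℝ, EuclideanSpace ℝ (Fin (n + 1))) Subtype.val (ν m) with hDval
    have hval : HasMFDerivAt (𝓡 n) 𝓘(ℝ, EuclideanSpace ℝ (Fin (n + 1))) (Subtype.val ∘ ν) m
        (Dval.comp (mfderiv (𝓡 n) (𝓡 n) ν m)) :=
      ((contMDiff_coe_sphere (m := ∞) (n := n) (ν m)).mdifferentiableAt
        (by simp)).hasMFDerivAt.comp m ((hνsmooth m).mdifferentiableAt (by simp)).hasMFDerivAt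
    have hA : HasFDerivAt (N ∘ Ψ) ((fderiv ℝ N (Ψ (e m))).comp (fderiv ℝ Ψ (e m))) (e m) :=
      ((contDiffAt_inv_norm_smul (m := ∞) hz0).differentiableAt (by simp)).hasFDerivAt.comp
        (e m) ((hΨ.differentiable (by simp)) (e m)).hasFDerivAt
    have hcomp : HasMFDerivAt (𝓡 n) 𝓘(ℝ, EuclideanSpace ℝ (Fin (n + 1))) (Subtype.val ∘ ν) m
        (((fderiv ℝ N (Ψ (e m))).comp (fderiv ℝ Ψ (e m))).comp De) :=
      (hasMFDerivAt_iff_hasFDerivAt.2 hA).comp m ((he1 m).mdifferentiableAt (by simp)).hasMFDerivAt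
    have heq := hasMFDerivAt_unique hval hcomp
    refine (injective_iff_map_eq_zero _).2 fun v hv => ?_
    set w : EuclideanSpace ℝ (Fin (n + 1)) := De v with hw
    have h1 : fderiv ℝ N (Ψ (e m)) (fderiv ℝ Ψ (e m) w) = 0 := by
      have h := DFunLike.congr_fun heq v
      change Dval ((mfderiv (𝓡 n) (𝓡 n) ν m) v) = fderiv ℝ N (Ψ (e m)) (fderiv ℝ Ψ (e m) w) at h
      rw [hv, map_zero] at h
      exact h.symm
    have hw0 : w = 0 := hker m v (exists_eq_smul_of_fderiv_inv_norm_smul_eq_zero hz0 h1)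
    refine Literature.Topology.FourManifolds.mfderiv_injective_of_isImmersion he (by simp) m ?_
    rw [map_zero]
    exact hw0
  -- hence `ν` is a local diffeomorphism everywhere, and a diffeomorphism
  have hloc : IsLocalDiffeomorph (𝓡 n) (𝓡 n) ∞ ν := by
    intro m
    set L : EuclideanSpace ℝ (Fin n) ≃L[ℝ] EuclideanSpace ℝ (Fin n) :=
      LinearEquiv.toContinuousLinearEquiv
        (LinearEquiv.ofInjectiveEndo (mfderiv (𝓡 n) (𝓡 n) ν m).toLinearMap (hkey m)) with hL
    refine Literature.Topology.FourManifolds.isLocalDiffeomorphAt_of_mfderiv isOpen_univ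
      (mem_univ m) hνsmooth.contMDiffOn (by simp) L ?_
    ext v
    rfl
  haveI : SimplyConnectedSpace (Metric.sphere (0 : EuclideanSpace ℝ (Fin (n + 1))) 1) :=
    Literature.AlgebraicTopology.FundamentalGroup.simplyConnectedSpace_euclideanSphere n hn
  haveI : LocallyPathConnectedSpace (Metric.sphere (0 : EuclideanSpace ℝ (Fin (n + 1))) 1) :=
    ChartedSpace.locallyPathConnectedSpace (EuclideanSpace ℝ (Fin n)) _
  exact ⟨diffeomorphOfIsLocalDiffeomorph hloc, fun m => rfl⟩

omit [IsManifold (𝓡 n) ∞ M] in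
/-- For a smooth map `e` into a level set `{F = 0}` of a differentiable `F`, the image of the
differential `de(m)` lies in `ker dF(e m)` (chain rule applied to `F ∘ e = 0`). [folklore] -/
theorem fderiv_apply_mfderiv_eq_zero_of_comp_eq_zero {F : EuclideanSpace ℝ (Fin (n + 1)) → ℝ}
    {e : M → EuclideanSpace ℝ (Fin (n + 1))} (hF : Differentiable ℝ F)
    (he : ContMDiff (𝓡 n) 𝓘(ℝ, EuclideanSpace ℝ (Fin (n + 1))) ∞ e) (hFe : ∀ m, F (e m) = 0)
    (m : M) (v : TangentSpace (𝓡 n) m) :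
    fderiv ℝ F (e m) (mfderiv (𝓡 n) 𝓘(ℝ, EuclideanSpace ℝ (Fin (n + 1))) e m v) = 0 := by
  have h1 : HasMFDerivAt (𝓡 n) 𝓘(ℝ, ℝ) (F ∘ e) m
      ((fderiv ℝ F (e m)).comp (mfderiv (𝓡 n) 𝓘(ℝ, EuclideanSpace ℝ (Fin (n + 1))) e m)) :=
    (hasMFDerivAt_iff_hasFDerivAt.2 (hF (e m)).hasFDerivAt).comp m
      ((he m).mdifferentiableAt (by simp)).hasMFDerivAt
  have h2 : HasMFDerivAt (𝓡 n) 𝓘(ℝ, ℝ) (F ∘ e) m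
      (0 : TangentSpace (𝓡 n) m →L[ℝ] TangentSpace 𝓘(ℝ, ℝ) ((F ∘ e) m)) := by
    have : F ∘ e = fun _ => (0 : ℝ) := funext fun m => hFe m
    rw [this]
    exact hasMFDerivAt_const (I := 𝓡 n) (I' := 𝓘(ℝ, ℝ)) (0 : ℝ) m
  exact DFunLike.congr_fun (hasMFDerivAt_unique h1 h2) v

/-- **Hadamard's theorem (the Gauss map of a closed strictly convex hypersurface is a
diffeomorphism onto `Sⁿ`), as used in Huisken–Sinestrari's Theorem 7.14**: "Since `λ₁ > 0` on
`M`, the Gauss map is also a local diffeomorphism. Then, since `Sⁿ` is simply connected for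
`n > 1`, well known results imply that the map is a global diffeomorphism" (Invent. Math. 175
(2009), p. 203). Level-set form: `e : M → ℝⁿ⁺¹` a smooth immersion of a compact connected
boundaryless `n`-manifold, `n ≥ 2`, with image inside the zero set of a smooth `F` which is
regular there (`F ∘ e = 0`, `dF ≠ 0` on `e(M)`) and strictly convex for the normal `∇F/|∇F|`:
`D²F(x)(w, w) > 0` for every nonzero tangent vector `w` (i.e. `λ₁ > 0`, the second fundamental
form being `D²F|_{ker dF}/|∇F|`). Then the Gauss map `m ↦ ∇F(e m)/|∇F(e m)|` (Mathlib `gradient`)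
is a diffeomorphism `M ≅ Sⁿ`: if its differential kills `v`, then `D²F(e m)(de v, ·)` is a
multiple of `dF(e m)`, so it vanishes on tangent vectors, `D²F(de v, de v) = 0` and `de v = 0`.
[cite: HuiskenSinestrari2008, Thm. 7.14 (proof, p. 203)] -/
theorem exists_diffeomorph_sphere_gaussMap (hn : 2 ≤ n) [CompactSpace M] [T2Space M]
    [ConnectedSpace M] {F : EuclideanSpace ℝ (Fin (n + 1)) → ℝ}
    {e : M → EuclideanSpace ℝ (Fin (n + 1))} (hF : ContDiff ℝ ∞ F)
    (he : Manifold.IsImmersion (𝓡 n) 𝓘(ℝ, EuclideanSpace ℝ (Fin (n + 1))) ∞ e)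
    (hFe : ∀ m, F (e m) = 0) (hdF : ∀ m, fderiv ℝ F (e m) ≠ 0)
    (hconv : ∀ m (w : EuclideanSpace ℝ (Fin (n + 1))), fderiv ℝ F (e m) w = 0 → w ≠ 0 →
      0 < iteratedFDeriv ℝ 2 F (e m) ![w, w]) :
    ∃ Φ : M ≃ₘ⟮𝓡 n, 𝓡 n⟯ Metric.sphere (0 : EuclideanSpace ℝ (Fin (n + 1))) 1,
      ∀ m, (Φ m : EuclideanSpace ℝ (Fin (n + 1))) =
        ‖gradient F (e m)‖⁻¹ • gradient F (e m) := by
  haveI hfact : Fact (finrank ℝ (EuclideanSpace ℝ (Fin (n + 1))) = n + 1) :=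
    ⟨finrank_euclideanSpace_fin⟩
  -- the `ℝ`-linear Riesz isomorphism `T x = ⟪x, ·⟫`
  set T : EuclideanSpace ℝ (Fin (n + 1)) ≃L[ℝ] StrongDual ℝ (EuclideanSpace ℝ (Fin (n + 1))) :=
    ((innerₗ (EuclideanSpace ℝ (Fin (n + 1)))).toContPerfPair).toContinuousLinearEquiv with hT
  have hTapply : ∀ x y : EuclideanSpace ℝ (Fin (n + 1)), T x y = ⟪x, y⟫_ℝ := fun x y => rfl
  have hTsymm : ∀ (ℓ : StrongDual ℝ (EuclideanSpace ℝ (Fin (n + 1))))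
      (u : EuclideanSpace ℝ (Fin (n + 1))), ⟪T.symm ℓ, u⟫_ℝ = ℓ u := by
    intro ℓ u
    rw [← hTapply, ContinuousLinearEquiv.apply_symm_apply]
  -- the gradient field `G = T⁻¹ ∘ dF`
  set G : EuclideanSpace ℝ (Fin (n + 1)) → EuclideanSpace ℝ (Fin (n + 1)) :=
    fun y => T.symm (fderiv ℝ F y) with hG
  have hGinner : ∀ y u, ⟪G y, u⟫_ℝ = fderiv ℝ F y u := fun y u => hTsymm _ _
  have hGgrad : ∀ y, gradient F y = G y := by
    intro y
    refine ext_inner_right ℝ fun u => ?_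
    rw [hGinner, gradient, InnerProductSpace.toDual_symm_apply]
  have hF1 : Differentiable ℝ F := hF.differentiable (by simp)
  have hF' : ContDiff ℝ ∞ (fderiv ℝ F) := (contDiff_infty_iff_fderiv.1 hF).2
  have hGsmooth : ContDiff ℝ ∞ G := T.symm.contDiff.comp hF'
  have hGderiv : ∀ y, HasFDerivAt G ((T.symm : StrongDual ℝ (EuclideanSpace ℝ (Fin (n + 1))) →L[ℝ]
      EuclideanSpace ℝ (Fin (n + 1))).comp (fderiv ℝ (fderiv ℝ F) y)) y :=
    fun y => T.symm.hasFDerivAt.comp y ((hF'.differentiable (by simp)) y).hasFDerivAt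
  have hGne : ∀ m, G (e m) ≠ 0 := by
    intro m h
    apply hdF m
    have : fderiv ℝ F (e m) = T (G (e m)) := (T.apply_symm_apply _).symm
    rw [this, h, map_zero]
  have htan := fderiv_apply_mfderiv_eq_zero_of_comp_eq_zero hF1 he.contMDiff hFe
  -- the kernel condition of the engine
  have hker : ∀ m v, (∃ c : ℝ,
      fderiv ℝ G (e m) (mfderiv (𝓡 n) 𝓘(ℝ, EuclideanSpace ℝ (Fin (n + 1))) e m v) = c • G (e m)) →
      mfderiv (𝓡 n) 𝓘(ℝ, EuclideanSpace ℝ (Fin (n + 1))) e m v = 0 := by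
    rintro m v ⟨c, hc⟩
    set w : EuclideanSpace ℝ (Fin (n + 1)) :=
      mfderiv (𝓡 n) 𝓘(ℝ, EuclideanSpace ℝ (Fin (n + 1))) e m v with hw
    have hc' : T.symm (fderiv ℝ (fderiv ℝ F) (e m) w) = c • G (e m) := by
      rw [← hc, (hGderiv (e m)).fderiv, ContinuousLinearMap.coe_comp, Function.comp_apply,
        ContinuousLinearEquiv.coe_coe]
    have hwtan : fderiv ℝ F (e m) w = 0 := htan m v
    have hD2 : iteratedFDeriv ℝ 2 F (e m) ![w, w] = 0 := by
      rw [iteratedFDeriv_two_apply]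
      simp only [Matrix.cons_val_zero, Matrix.cons_val_one]
      calc fderiv ℝ (fderiv ℝ F) (e m) w w
          = ⟪T.symm (fderiv ℝ (fderiv ℝ F) (e m) w), w⟫_ℝ := (hTsymm _ _).symm
        _ = ⟪c • G (e m), w⟫_ℝ := by rw [hc']
        _ = c * fderiv ℝ F (e m) w := by rw [real_inner_smul_left, hGinner]
        _ = 0 := by rw [hwtan, mul_zero]
    by_contra hne
    exact (lt_irrefl (0 : ℝ)) ((hconv m w hwtan hne).trans_eq hD2)
  clear_value G T
  obtain ⟨Φ, hΦ⟩ := exists_diffeomorph_sphere_of_normalize (Ψ := G) hn he hGsmooth hGne hker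
  exact ⟨Φ, fun m => by rw [hΦ, hGgrad]⟩

/-- **Star-shaped version** (radial projection). Let `e : M → ℝⁿ⁺¹` be a smooth immersion of a
compact connected boundaryless `n`-manifold, `n ≥ 2`, into the zero set of a differentiable `F`,
and `p` a point such that `dF(x)(x - p) ≠ 0` at every `x ∈ e(M)` (every ray from `p` is
transverse to the hypersurface). Then the radial projection from `p`, `m ↦ (e m - p)/|e m - p|`,
is a diffeomorphism `M ≅ Sⁿ`: if its differential kills `v` then `de v = c (e m - p)` is tangent,
so `c dF(e m - p) = 0`, `c = 0`, `de v = 0`. (The classical fact that a closed hypersurface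
transversally star-shaped with respect to a point is a sphere; in Huisken–Sinestrari it
identifies the boundaries of the convex regions met by the surgery — a recognised convex
component, the half ball under a convex cap — proof of Cor. 1.2–1.3, pp. 218–219.)
[cite: HuiskenSinestrari2008, proof of Cor. 1.2 and 1.3, pp. 218–219] -/
theorem exists_diffeomorph_sphere_radial (hn : 2 ≤ n) [CompactSpace M] [T2Space M]
    [ConnectedSpace M] {F : EuclideanSpace ℝ (Fin (n + 1)) → ℝ}
    {e : M → EuclideanSpace ℝ (Fin (n + 1))} (hF : Differentiable ℝ F)
    (he : Manifold.IsImmersion (𝓡 n) 𝓘(ℝ, EuclideanSpace ℝ (Fin (n + 1))) ∞ e)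
    (hFe : ∀ m, F (e m) = 0) (p : EuclideanSpace ℝ (Fin (n + 1)))
    (htrans : ∀ m, fderiv ℝ F (e m) (e m - p) ≠ 0) :
    ∃ Φ : M ≃ₘ⟮𝓡 n, 𝓡 n⟯ Metric.sphere (0 : EuclideanSpace ℝ (Fin (n + 1))) 1,
      ∀ m, (Φ m : EuclideanSpace ℝ (Fin (n + 1))) = ‖e m - p‖⁻¹ • (e m - p) := by
  have hΨ : ContDiff ℝ ∞ (fun y : EuclideanSpace ℝ (Fin (n + 1)) => y - p) :=
    contDiff_id.sub contDiff_const
  have hΨ0 : ∀ m, e m - p ≠ 0 := by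
    intro m h
    apply htrans m
    rw [h, map_zero]
  have htan := fderiv_apply_mfderiv_eq_zero_of_comp_eq_zero hF he.contMDiff hFe
  have hker : ∀ m v, (∃ c : ℝ, fderiv ℝ (fun y : EuclideanSpace ℝ (Fin (n + 1)) => y - p) (e m)
      (mfderiv (𝓡 n) 𝓘(ℝ, EuclideanSpace ℝ (Fin (n + 1))) e m v) = c • (e m - p)) →
      mfderiv (𝓡 n) 𝓘(ℝ, EuclideanSpace ℝ (Fin (n + 1))) e m v = 0 := by
    rintro m v ⟨c, hc⟩
    have hd : fderiv ℝ (fun y : EuclideanSpace ℝ (Fin (n + 1)) => y - p) (e m) =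
        ContinuousLinearMap.id ℝ _ :=
      ((hasFDerivAt_id (e m)).sub_const p).fderiv
    rw [hd, ContinuousLinearMap.id_apply] at hc
    have h0 := htan m v
    rw [hc, map_smul, smul_eq_mul, mul_eq_zero] at h0
    rcases h0 with h0 | h0
    · rw [hc, h0, zero_smul]
      rfl
    · exact absurd h0 (htrans m)
  exact exists_diffeomorph_sphere_of_normalize
    (Ψ := fun y : EuclideanSpace ℝ (Fin (n + 1)) => y - p) hn he hΨ hΨ0 hker

end GaussMap

/-! ### Convex sublevel sets: rays from an interior point are transverse to the boundary -/

section ConvexSublevel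

variable {E : Type*} [NormedAddCommGroup E] [NormedSpace ℝ E]

/-- A function with a regular zero (`F x = 0`, `dF(x) ≠ 0`) takes a negative value: otherwise
`x` would be a minimum and `dF(x) = 0` (Fermat). [folklore] -/
theorem exists_lt_zero_of_fderiv_ne_zero {F : E → ℝ} {x : E} (hx : F x = 0)
    (hdF : fderiv ℝ F x ≠ 0) : ∃ p, F p < 0 := by
  by_contra h
  have h' : ∀ p, 0 ≤ F p := fun p => not_lt.1 fun hp => h ⟨p, hp⟩
  have hmin : IsLocalMin F x :=
    Filter.Eventually.of_forall fun p => (hx.trans_le (h' p) : F x ≤ F p)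
  exact hdF hmin.fderiv_eq_zero

/-- **Rays from an interior point of a convex sublevel set cross its boundary transversally,
outwards.** If `F` is differentiable, `{F ≤ 0}` is convex, `F p < 0` and `x` is a regular zero of
`F`, then `dF(x)(x - p) > 0`. Indeed `F ≤ 0 = F x` on the convex set, so `dF(x)(y - x) ≤ 0` for
every `y` in it (first-order condition at a constrained maximum, Mathlib
`IsLocalMaxOn.hasFDerivWithinAt_nonpos`); taking `y = p + s u` with `dF(x) u > 0` and `s > 0` small
(`F < 0` near `p`) gives `dF(x)(p - x) ≤ -s dF(x) u < 0`. [folklore] -/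
theorem fderiv_apply_sub_pos_of_convex_sublevel {F : E → ℝ} (hF : Differentiable ℝ F)
    (hK : Convex ℝ {x | F x ≤ 0}) {p x : E} (hp : F p < 0) (hx : F x = 0)
    (hdF : fderiv ℝ F x ≠ 0) : 0 < fderiv ℝ F x (x - p) := by
  have hxK : x ∈ {x | F x ≤ 0} := le_of_eq hx
  have hmax : IsLocalMaxOn F {x | F x ≤ 0} x :=
    IsMaxOn.localize fun y hy => (show F y ≤ 0 from hy).trans_eq hx.symm
  have key : ∀ y ∈ {x | F x ≤ 0}, fderiv ℝ F x (y - x) ≤ 0 := fun y hy =>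
    hmax.hasFDerivWithinAt_nonpos (hF x).hasFDerivAt.hasFDerivWithinAt
      (sub_mem_posTangentConeAt_of_segment_subset (hK.segment_subset hxK hy))
  -- a direction `u` with `dF(x) u > 0`
  obtain ⟨u, hu⟩ : ∃ u, 0 < fderiv ℝ F x u := by
    obtain ⟨u₀, hu₀⟩ := DFunLike.ne_iff.1 hdF
    rcases lt_or_gt_of_ne hu₀ with h | h
    · exact ⟨-u₀, by rw [map_neg]; exact neg_pos.2 h⟩
    · exact ⟨u₀, h⟩
  -- `p + s u` lies in `{F ≤ 0}` for small `s > 0`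
  have hc : Continuous fun s : ℝ => F (p + s • u) :=
    hF.continuous.comp (continuous_const.add (continuous_id.smul continuous_const))
  have hp0 : F (p + (0 : ℝ) • u) < 0 := by simpa using hp
  have hev : ∀ᶠ s in 𝓝 (0 : ℝ), F (p + s • u) < 0 := (hc.tendsto 0).eventually_lt_const hp0
  obtain ⟨s, hsK, hs0⟩ :=
    ((hev.filter_mono nhdsWithin_le_nhds).and (self_mem_nhdsWithin (s := Ioi (0 : ℝ)))).exists
  have h1 := key (p + s • u) (le_of_lt hsK)
  have h2 : fderiv ℝ F x (p + s • u - x) = -(fderiv ℝ F x (x - p)) + s * fderiv ℝ F x u := by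
    have : p + s • u - x = -(x - p) + s • u := by abel
    rw [this, map_add, map_neg, map_smul, smul_eq_mul]
  rw [h2] at h1
  have hs0' : (0 : ℝ) < s := hs0
  nlinarith [mul_pos hs0' hu]

end ConvexSublevel

/-! ### The convex cases of Huisken–Sinestrari's Cor. 1.3 (first clause), in the fact's format -/

section ConvexCases

/-- **Cor. 1.3 (first clause) for strictly convex hypersurfaces (Hadamard).** The named fact
`Literature.Geometry.Riemannian.HuiskenSinestrari2009_twoConvex_simplyConnected` with its
two-convexity clause (`λ₁ + λ₂ ≥ 0`: `D²F(x)(v₁, v₁) + D²F(x)(v₂, v₂) ≥ 0` on orthonormal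
tangent pairs) strengthened to strict convexity (`λ₁ > 0`: `D²F(x)(w, w) > 0` for nonzero
tangent `w`) holds: the Gauss map is a diffeomorphism onto `Sⁿ`
(`exists_diffeomorph_sphere_gaussMap`). This is the case of a surface recognised as convex in
Huisken–Sinestrari's surgery algorithm, where the flow terminates at once (Thm. 7.14, Cor. 7.15).
[cite: HuiskenSinestrari2008, Thm. 7.14 and proof of Cor. 1.3, p. 218] -/
theorem HuiskenSinestrari2009_twoConvex_simplyConnected_of_strictlyConvex :
    ∀ (n : ℕ), 3 ≤ n →
    ∀ (M : Type) [TopologicalSpace M] [T2Space M] [SecondCountableTopology M] [CompactSpace M]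
      [ChartedSpace (EuclideanSpace ℝ (Fin n)) M] [IsManifold (𝓡 n) ∞ M],
      SimplyConnectedSpace M →
    ∀ (F : EuclideanSpace ℝ (Fin (n + 1)) → ℝ) (e : M → EuclideanSpace ℝ (Fin (n + 1))),
      ContDiff ℝ ∞ F → IsCompact {x | F x ≤ 0} → (∀ x, F x = 0 → fderiv ℝ F x ≠ 0) →
      Manifold.IsSmoothEmbedding (𝓡 n) 𝓘(ℝ, EuclideanSpace ℝ (Fin (n + 1))) ∞ e →
      Set.range e = {x | F x = 0} →
      (∀ x, F x = 0 → ∀ w : EuclideanSpace ℝ (Fin (n + 1)), fderiv ℝ F x w = 0 → w ≠ 0 →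
        0 < iteratedFDeriv ℝ 2 F x ![w, w]) →
      Nonempty (M ≃ₘ⟮𝓡 n, 𝓡 n⟯ Metric.sphere (0 : EuclideanSpace ℝ (Fin (n + 1))) 1) := by
  intro n hn M _ _ _ _ _ _ hsc F e hF _ hdF he hrange hconv
  haveI := hsc
  have hFe : ∀ m, F (e m) = 0 := fun m => by
    have h : e m ∈ Set.range e := mem_range_self m
    rw [hrange] at h
    exact h
  obtain ⟨Φ, -⟩ := exists_diffeomorph_sphere_gaussMap (by omega) hF he.isImmersion hFe
    (fun m => hdF _ (hFe m)) (fun m w => hconv _ (hFe m) w)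
  exact ⟨Φ⟩

/-- **Cor. 1.3 (first clause) for boundaries of convex bodies.** The named fact
`Literature.Geometry.Riemannian.HuiskenSinestrari2009_twoConvex_simplyConnected` with its
two-convexity clause replaced by convexity of the compact region `{F ≤ 0}` bounded by the
hypersurface (weak convexity `λᵢ ≥ 0`, which implies `λ₁ + λ₂ ≥ 0`) holds: `F` takes a
negative value `F p < 0` (`exists_lt_zero_of_fderiv_ne_zero`), every ray from `p` crosses
`{F = 0}` transversally
(`fderiv_apply_sub_pos_of_convex_sublevel`), so the radial projection from `p` is a
diffeomorphism `M ≅ Sⁿ` (`exists_diffeomorph_sphere_radial`). In Huisken–Sinestrari this is the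
identification of the boundary of a recognised convex region (proof of Cor. 1.2–1.3,
pp. 218–219: "a convex closed surface which is well known to bound a smooth convex region
diffeomorphic to `B̄ⁿ⁺¹`"). [cite: HuiskenSinestrari2008, proof of Cor. 1.2 and 1.3, pp. 218–219] -/
theorem HuiskenSinestrari2009_twoConvex_simplyConnected_of_convex_sublevel :
    ∀ (n : ℕ), 3 ≤ n →
    ∀ (M : Type) [TopologicalSpace M] [T2Space M] [SecondCountableTopology M] [CompactSpace M]
      [ChartedSpace (EuclideanSpace ℝ (Fin n)) M] [IsManifold (𝓡 n) ∞ M],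
      SimplyConnectedSpace M →
    ∀ (F : EuclideanSpace ℝ (Fin (n + 1)) → ℝ) (e : M → EuclideanSpace ℝ (Fin (n + 1))),
      ContDiff ℝ ∞ F → IsCompact {x | F x ≤ 0} → (∀ x, F x = 0 → fderiv ℝ F x ≠ 0) →
      Manifold.IsSmoothEmbedding (𝓡 n) 𝓘(ℝ, EuclideanSpace ℝ (Fin (n + 1))) ∞ e →
      Set.range e = {x | F x = 0} → Convex ℝ {x | F x ≤ 0} →
      Nonempty (M ≃ₘ⟮𝓡 n, 𝓡 n⟯ Metric.sphere (0 : EuclideanSpace ℝ (Fin (n + 1))) 1) := by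
  intro n hn M _ _ _ _ _ _ hsc F e hF _ hdF he hrange hconv
  haveI := hsc
  have hFe : ∀ m, F (e m) = 0 := fun m => by
    have h : e m ∈ Set.range e := mem_range_self m
    rw [hrange] at h
    exact h
  obtain ⟨m₀⟩ : Nonempty M := inferInstance
  obtain ⟨p, hp⟩ := exists_lt_zero_of_fderiv_ne_zero (hFe m₀) (hdF _ (hFe m₀))
  have hF1 : Differentiable ℝ F := hF.differentiable (by simp)
  obtain ⟨Φ, -⟩ := exists_diffeomorph_sphere_radial (by omega) hF1 he.isImmersion hFe p
    fun m => (fderiv_apply_sub_pos_of_convex_sublevel hF1 hconv hp (hFe m) (hdF _ (hFe m))).ne'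
  exact ⟨Φ⟩

/-- **Sign and non-vacuity check: the round sphere satisfies every hypothesis of the fact**
(`n ≥ 2`; the fact asks `n ≥ 3`). With `M = Sⁿ ⊂ ℝⁿ⁺¹`, `e` the inclusion and `F = ‖x‖² - 1`
(so `{F ≤ 0}` is the closed unit ball and `∇F = 2x` is the outer normal): `Sⁿ` is simply
connected (`Literature.AlgebraicTopology.FundamentalGroup.simplyConnectedSpace_euclideanSphere`),
`F` is smooth, `{F ≤ 0}` is compact, `dF ≠ 0` on `{F = 0}`, the inclusion is a smooth embedding
in Mathlib's chart sense (immersion criterion of the tree,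
`Literature.Topology.FourManifolds.isSmoothEmbedding_of_injective_of_injective_mfderiv`, with
Mathlib's `mfderiv_coe_sphere_injective`), its range is `{F = 0}`, and the two-convexity clause
holds (`∑ᵢ D²F(vᵢ, vᵢ) = 4 ≥ 0`, from `pConvex_hypotheses_unitBall`). [folklore] -/
theorem HuiskenSinestrari2009_twoConvex_hypotheses_roundSphere (n : ℕ) (hn : 2 ≤ n) :
    SimplyConnectedSpace (Metric.sphere (0 : EuclideanSpace ℝ (Fin (n + 1))) 1) ∧
    ContDiff ℝ ∞ (fun y : EuclideanSpace ℝ (Fin (n + 1)) => ‖y‖ ^ 2 - 1) ∧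
    IsCompact {x : EuclideanSpace ℝ (Fin (n + 1)) | ‖x‖ ^ 2 - 1 ≤ 0} ∧
    (∀ x : EuclideanSpace ℝ (Fin (n + 1)), ‖x‖ ^ 2 - 1 = 0 →
      fderiv ℝ (fun y : EuclideanSpace ℝ (Fin (n + 1)) => ‖y‖ ^ 2 - 1) x ≠ 0) ∧
    Manifold.IsSmoothEmbedding (𝓡 n) 𝓘(ℝ, EuclideanSpace ℝ (Fin (n + 1))) ∞
      (Subtype.val : Metric.sphere (0 : EuclideanSpace ℝ (Fin (n + 1))) 1 →
        EuclideanSpace ℝ (Fin (n + 1))) ∧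
    Set.range (Subtype.val : Metric.sphere (0 : EuclideanSpace ℝ (Fin (n + 1))) 1 →
        EuclideanSpace ℝ (Fin (n + 1))) = {x | ‖x‖ ^ 2 - 1 = 0} ∧
    (∀ x : EuclideanSpace ℝ (Fin (n + 1)), ‖x‖ ^ 2 - 1 = 0 →
      ∀ v : Fin 2 → EuclideanSpace ℝ (Fin (n + 1)), Orthonormal ℝ v →
      (∀ i, fderiv ℝ (fun y : EuclideanSpace ℝ (Fin (n + 1)) => ‖y‖ ^ 2 - 1) x (v i) = 0) →
      0 ≤ ∑ i, iteratedFDeriv ℝ 2 (fun y : EuclideanSpace ℝ (Fin (n + 1)) => ‖y‖ ^ 2 - 1) x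
        ![v i, v i]) := by
  obtain ⟨h1, h2, h3, h4⟩ :=
    pConvex_hypotheses_unitBall (E := EuclideanSpace ℝ (Fin (n + 1))) (p := 2) (by norm_num)
  haveI hfact : Fact (finrank ℝ (EuclideanSpace ℝ (Fin (n + 1))) = n + 1) :=
    ⟨finrank_euclideanSpace_fin⟩
  refine ⟨Literature.AlgebraicTopology.FundamentalGroup.simplyConnectedSpace_euclideanSphere n hn,
    h1, h2, h3, ?_, ?_, fun x hx v hv hv' => (h4 x hx v hv hv').le⟩
  · exact Literature.Topology.FourManifolds.isSmoothEmbedding_of_injective_of_injective_mfderiv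
      (contMDiff_coe_sphere (n := n)) (by simp) Subtype.val_injective
      fun v => mfderiv_coe_sphere_injective v
  · rw [Subtype.range_coe]
    ext x
    simp only [mem_setOf_eq, Metric.mem_sphere, dist_zero_right, sub_eq_zero]
    constructor
    · intro h
      rw [h, one_pow]
    · intro h
      exact (pow_eq_one_iff_of_nonneg (norm_nonneg x) two_ne_zero).1 h

end ConvexCases

/-! ### The fact implies the `2`-convex rung of the SPC4 convexity ladder -/

section Corollary

/-- **Corollary of the fact for homotopy spheres with a strictly two-convex embedding** (the
shape of the route item `CvxTwoConvexStandard` of `Summits/SmoothPoincare4/…/ConvexityLadder`,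
which is the case `n = 4`): if `M ≃ₕ Sⁿ` (`ContinuousMap.HomotopyEquiv`; so `M` is simply
connected, by `π₁(Sⁿ) = 1` for `n ≥ 2` and homotopy invariance of `π₁`), and `M` embeds onto a
compact regular level set `{F = 0}`
(so `M` is compact: an embedding is proper onto its closed image inside the compact `{F ≤ 0}`)
which is strictly two-convex (`D²F(v₁, v₁) + D²F(v₂, v₂) > 0` on orthonormal tangent pairs, a
fortiori `≥ 0`), then Huisken–Sinestrari's Cor. 1.3 gives `M ≅ Sⁿ`. Users take the fact as the
hypothesis `h`; at `n = 4` the statement is definitionally the route item (checked: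
`example (H : <this statement at n = 4>) : CvxTwoConvexStandard := H` elaborates).
[cite: HuiskenSinestrari2008, Cor. 1.3] -/
theorem HuiskenSinestrari2009_twoConvex_simplyConnected.of_homotopyEquiv_sphere
    (h : HuiskenSinestrari2009_twoConvex_simplyConnected) (n : ℕ) (hn : 3 ≤ n) :
    ∀ (M : Type) [TopologicalSpace M] [T2Space M] [SecondCountableTopology M]
      [ChartedSpace (EuclideanSpace ℝ (Fin n)) M] [IsManifold (𝓡 n) ∞ M],
      ContinuousMap.HomotopyEquiv M (Metric.sphere (0 : EuclideanSpace ℝ (Fin (n + 1))) 1) →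
    ∀ (F : EuclideanSpace ℝ (Fin (n + 1)) → ℝ) (e : M → EuclideanSpace ℝ (Fin (n + 1))),
      ContDiff ℝ ∞ F → IsCompact {x | F x ≤ 0} → (∀ x, F x = 0 → fderiv ℝ F x ≠ 0) →
      Manifold.IsSmoothEmbedding (𝓡 n) 𝓘(ℝ, EuclideanSpace ℝ (Fin (n + 1))) ∞ e →
      Set.range e = {x | F x = 0} →
      (∀ x, F x = 0 → ∀ v : Fin 2 → EuclideanSpace ℝ (Fin (n + 1)), Orthonormal ℝ v →
        (∀ i, fderiv ℝ F x (v i) = 0) → 0 < ∑ i, iteratedFDeriv ℝ 2 F x ![v i, v i]) →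
      Nonempty (M ≃ₘ⟮𝓡 n, 𝓡 n⟯ Metric.sphere (0 : EuclideanSpace ℝ (Fin (n + 1))) 1) := by
  intro M _ _ _ _ _ φ F e hF hK hdF he hrange hconv
  haveI : SimplyConnectedSpace (Metric.sphere (0 : EuclideanSpace ℝ (Fin (n + 1))) 1) :=
    Literature.AlgebraicTopology.FundamentalGroup.simplyConnectedSpace_euclideanSphere n (by omega)
  have hsc : SimplyConnectedSpace M := φ.simplyConnectedSpace_iff.2 inferInstance
  -- `M` is compact: `e` is an embedding onto the compact set `{F = 0}`
  have hzero : IsCompact {x : EuclideanSpace ℝ (Fin (n + 1)) | F x = 0} :=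
    hK.of_isClosed_subset (isClosed_eq hF.continuous continuous_const) fun x hx => le_of_eq hx
  haveI : CompactSpace M := by
    refine ⟨(he.isEmbedding.isCompact_iff).2 ?_⟩
    rwa [Set.image_univ, hrange]
  exact h n hn M hsc F e hF hK hdF he hrange fun x hx v hv hv' => (hconv x hx v hv hv').le

end Corollary

/-! ### The level-set dictionary: tangent space, Gauss map and second fundamental form

The fact encodes Huisken–Sinestrari's two-convexity `λ₁ + λ₂ ≥ 0` (outer normal `ν`, second
fundamental form `h(v, w) = ⟨dν(v), de(w)⟩`, Weingarten equation; p. 137: "the mean curvature of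
a convex surface is positive") by the clause `D²F(x)(u₁, u₁) + D²F(x)(u₂, u₂) ≥ 0` for orthonormal
`u₁, u₂ ∈ ker dF(x)`. The lemmas below certify this dictionary: `ker dF(e m)` is the tangent space
`de(T_m M)`, and for the outer unit normal `ν = ∇F/|∇F| ∘ e` one has
`⟨dν(v), de(w)⟩ = D²F(de v, de w)/|∇F|`, so the clause is exactly `h(v₁, v₁) + h(v₂, v₂) ≥ 0` for
all pairs `(v₁, v₂)` orthonormal in the induced metric — the Ky Fan form of `λ₁ + λ₂ ≥ 0` used by
Huisken–Sinestrari themselves (p. 143: "`λ₁ + λ₂ = min{W(e₁, e₁) + W(e₂, e₂) : |e₁| = |e₂| = 1,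
e₁ ⊥ e₂}`"). -/

section Gradient

variable {V : Type*} [NormedAddCommGroup V] [InnerProductSpace ℝ V] [CompleteSpace V]
  [FiniteDimensional ℝ V]

/-- **The gradient field of a `C²` function is differentiable, with derivative the Hessian read
through the inner product**: `⟨D(∇F)(x) u, w⟩ = D²F(x)(u, w)`. (Mathlib's `gradient` is defined
through the conjugate-linear Riesz map `toDual`; here the `ℝ`-linear Riesz isomorphism
`(innerₗ V).toContPerfPair` is used to differentiate it.) [folklore] -/
theorem exists_hasFDerivAt_gradient {F : V → ℝ} {x : V}
    (hF : DifferentiableAt ℝ (fderiv ℝ F) x) :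
    ∃ L : V →L[ℝ] V, HasFDerivAt (gradient F) L x ∧
      ∀ u w, ⟪L u, w⟫_ℝ = fderiv ℝ (fderiv ℝ F) x u w := by
  set T : V ≃L[ℝ] StrongDual ℝ V := ((innerₗ V).toContPerfPair).toContinuousLinearEquiv with hT
  have hTapply : ∀ x y : V, T x y = ⟪x, y⟫_ℝ := fun x y => rfl
  have hTsymm : ∀ (ℓ : StrongDual ℝ V) (u : V), ⟪T.symm ℓ, u⟫_ℝ = ℓ u := by
    intro ℓ u
    rw [← hTapply, ContinuousLinearEquiv.apply_symm_apply]
  have hgrad : gradient F = fun y => T.symm (fderiv ℝ F y) := by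
    funext y
    refine ext_inner_right ℝ fun u => ?_
    rw [hTsymm, gradient, InnerProductSpace.toDual_symm_apply]
  refine ⟨(T.symm : StrongDual ℝ V →L[ℝ] V).comp (fderiv ℝ (fderiv ℝ F) x), ?_, fun u w => ?_⟩
  · rw [hgrad]
    exact T.symm.hasFDerivAt.comp x hF.hasFDerivAt
  · rw [ContinuousLinearMap.coe_comp, Function.comp_apply, ContinuousLinearEquiv.coe_coe, hTsymm]

omit [FiniteDimensional ℝ V] in
/-- The gradient vanishes exactly where the differential does. [folklore] -/
theorem gradient_eq_zero_iff {F : V → ℝ} {x : V} : gradient F x = 0 ↔ fderiv ℝ F x = 0 := by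
  rw [gradient, LinearIsometryEquiv.map_eq_zero_iff]

end Gradient

section Dictionary

variable {n : ℕ} {M : Type*} [TopologicalSpace M] [ChartedSpace (EuclideanSpace ℝ (Fin n)) M]

/-- A nonzero linear functional on `ℝⁿ⁺¹` has an `n`-dimensional kernel. [folklore] -/
theorem finrank_ker_of_ne_zero {f : EuclideanSpace ℝ (Fin (n + 1)) →L[ℝ] ℝ} (hf : f ≠ 0) :
    finrank ℝ f.ker = n := by
  obtain ⟨u₀, hu₀⟩ := DFunLike.ne_iff.1 hf
  have hsurj : f.range = ⊤ := by
    refine LinearMap.range_eq_top.2 fun r => ⟨(r / f u₀) • u₀, ?_⟩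
    change f ((r / f u₀) • u₀) = r
    rw [map_smul, smul_eq_mul, div_mul_cancel₀ r hu₀]
  have h := LinearMap.finrank_range_add_finrank_ker (f : EuclideanSpace ℝ (Fin (n + 1)) →ₗ[ℝ] ℝ)
  change finrank ℝ f.range + finrank ℝ f.ker = finrank ℝ (EuclideanSpace ℝ (Fin (n + 1))) at h
  rw [hsurj, finrank_top, Module.finrank_self, finrank_euclideanSpace_fin] at h
  omega

/-- **The tangent space of a regular level set**: for an immersion `e` into `{F = 0}` with
`dF(e m) ≠ 0`, the image of `de(m)` (Mathlib's vector-valued differential `mvfderiv`) is exactly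
`ker dF(e m)` (it is contained in it by the chain rule, and both have dimension `n`). [folklore] -/
theorem range_mvfderiv_eq_ker_fderiv [IsManifold (𝓡 n) ∞ M]
    {F : EuclideanSpace ℝ (Fin (n + 1)) → ℝ} {e : M → EuclideanSpace ℝ (Fin (n + 1))}
    (hF : Differentiable ℝ F)
    (he : Manifold.IsImmersion (𝓡 n) 𝓘(ℝ, EuclideanSpace ℝ (Fin (n + 1))) ∞ e)
    (hFe : ∀ m, F (e m) = 0) {m : M} (hdF : fderiv ℝ F (e m) ≠ 0) :
    (mvfderiv (𝓡 n) e m).range = (fderiv ℝ F (e m)).ker := by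
  have hle : (mvfderiv (𝓡 n) e m).range ≤ (fderiv ℝ F (e m)).ker := by
    rintro _ ⟨v, rfl⟩
    exact fderiv_apply_mfderiv_eq_zero_of_comp_eq_zero hF he.contMDiff hFe m v
  refine Submodule.eq_of_le_of_finrank_eq hle ?_
  have hinj : Injective (mvfderiv (𝓡 n) e m) :=
    Literature.Topology.FourManifolds.mfderiv_injective_of_isImmersion he (by simp) m
  rw [LinearMap.finrank_range_of_inj hinj, finrank_ker_of_ne_zero hdF]
  exact finrank_euclideanSpace_fin

/-- **Weingarten equation for a regular level set.** For a smooth map `e` into `{F = 0}` (`F` of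
class `C²`, `dF(e m) ≠ 0`) and the outer unit normal field `ν = ∇F(e ·)/|∇F(e ·)|`, the second
fundamental form `h(v, w) = ⟨dν(m) v, de(m) w⟩` (Huisken–Sinestrari's sign: positive on convex
surfaces for the outer normal; differentials as Mathlib's vector-valued `mvfderiv`) is
`D²F(e m)(de v, de w)/|∇F(e m)|`: differentiate `ν = N ∘ ∇F ∘ e`, `N z = z/‖z‖`, whose derivative
is `‖z‖⁻¹ id` plus a multiple of `z`, and use `⟨∇F(e m), de w⟩ = dF(de w) = 0`. [folklore] -/
theorem inner_mvfderiv_unitNormal_mvfderiv [IsManifold (𝓡 n) ∞ M]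
    {F : EuclideanSpace ℝ (Fin (n + 1)) → ℝ} {e ν : M → EuclideanSpace ℝ (Fin (n + 1))}
    (hF : ContDiff ℝ 2 F) (he : ContMDiff (𝓡 n) 𝓘(ℝ, EuclideanSpace ℝ (Fin (n + 1))) ∞ e)
    (hFe : ∀ m, F (e m) = 0) (hν : ∀ m, ν m = ‖gradient F (e m)‖⁻¹ • gradient F (e m))
    {m : M} (hdF : fderiv ℝ F (e m) ≠ 0) (v w : TangentSpace (𝓡 n) m) :
    ⟪mvfderiv (𝓡 n) ν m v, mvfderiv (𝓡 n) e m w⟫_ℝ =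
      ‖gradient F (e m)‖⁻¹ *
        iteratedFDeriv ℝ 2 F (e m) ![mvfderiv (𝓡 n) e m v, mvfderiv (𝓡 n) e m w] := by
  set De := mvfderiv (𝓡 n) e m with hDe
  set z : EuclideanSpace ℝ (Fin (n + 1)) := gradient F (e m) with hz
  have hz0 : z ≠ 0 := fun h => hdF (gradient_eq_zero_iff.1 h)
  have hF1 : Differentiable ℝ F := hF.differentiable (by simp)
  have hF' : DifferentiableAt ℝ (fderiv ℝ F) (e m) :=
    ((hF.fderiv_right (m := 1) (by norm_num)).differentiable (by simp)) (e m)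
  obtain ⟨L, hL, hLinner⟩ := exists_hasFDerivAt_gradient hF'
  -- `ν = (N ∘ ∇F) ∘ e`
  set N : EuclideanSpace ℝ (Fin (n + 1)) → EuclideanSpace ℝ (Fin (n + 1)) :=
    fun y => ‖y‖⁻¹ • y with hN
  set c' : EuclideanSpace ℝ (Fin (n + 1)) →L[ℝ] ℝ :=
    fderiv ℝ (fun y : EuclideanSpace ℝ (Fin (n + 1)) => ‖y‖⁻¹) z with hc'
  have hνfun : ν = (N ∘ gradient F) ∘ e := funext fun m => hν m
  have hA : HasFDerivAt (N ∘ gradient F)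
      ((‖z‖⁻¹ • ContinuousLinearMap.id ℝ _ + c'.smulRight z).comp L) (e m) :=
    (hasFDerivAt_inv_norm_smul hz0).comp (e m) hL
  have hνd : HasMFDerivAt (𝓡 n) 𝓘(ℝ, EuclideanSpace ℝ (Fin (n + 1))) ν m
      (((‖z‖⁻¹ • ContinuousLinearMap.id ℝ _ + c'.smulRight z).comp L).comp
        (mfderiv (𝓡 n) 𝓘(ℝ, EuclideanSpace ℝ (Fin (n + 1))) e m)) := by
    rw [hνfun]
    exact (hasMFDerivAt_iff_hasFDerivAt.2 hA).comp m
      ((he m).mdifferentiableAt (by simp)).hasMFDerivAt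
  have hνd' : mvfderiv (𝓡 n) ν m v = ‖z‖⁻¹ • L (De v) + (c' (L (De v))) • z := by
    change mfderiv (𝓡 n) 𝓘(ℝ, EuclideanSpace ℝ (Fin (n + 1))) ν m v = _
    rw [hνd.mfderiv]
    rfl
  have htan : ⟪z, De w⟫_ℝ = 0 := by
    rw [hz, inner_gradient_left]
    exact fderiv_apply_mfderiv_eq_zero_of_comp_eq_zero hF1 he hFe m w
  rw [hνd', inner_add_left, real_inner_smul_left, real_inner_smul_left, htan, mul_zero, add_zero,
    hLinner, iteratedFDeriv_two_apply]
  simp only [Matrix.cons_val_zero, Matrix.cons_val_one]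

/-- **The fact's two-convexity clause is Huisken–Sinestrari's `λ₁ + λ₂ ≥ 0` for the outer
normal**, in the Weingarten/Ky Fan form: for an immersion `e` into the regular level set `{F = 0}`
with outer unit normal `ν = ∇F(e ·)/|∇F(e ·)|`, the clause "`D²F(u₁, u₁) + D²F(u₂, u₂) ≥ 0` for
orthonormal `u₁, u₂ ∈ ker dF(e m)`" is equivalent to "`h(v₁, v₁) + h(v₂, v₂) ≥ 0`,
`h(v, w) = ⟨dν v, de w⟩`, for every pair `(v₁, v₂)` of tangent vectors orthonormal in the induced
metric `g(v, w) = ⟨de v, de w⟩`" — whose minimum over such pairs is `λ₁ + λ₂` (Huisken–Sinestrari,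
p. 143, proof of Prop. 2.6). [cite: HuiskenSinestrari2008, Prop. 2.6 (proof), p. 143] -/
theorem twoConvexClause_iff_weingarten [IsManifold (𝓡 n) ∞ M]
    {F : EuclideanSpace ℝ (Fin (n + 1)) → ℝ} {e ν : M → EuclideanSpace ℝ (Fin (n + 1))}
    (hF : ContDiff ℝ 2 F)
    (he : Manifold.IsImmersion (𝓡 n) 𝓘(ℝ, EuclideanSpace ℝ (Fin (n + 1))) ∞ e)
    (hFe : ∀ m, F (e m) = 0) (hν : ∀ m, ν m = ‖gradient F (e m)‖⁻¹ • gradient F (e m))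
    {m : M} (hdF : fderiv ℝ F (e m) ≠ 0) :
    (∀ u : Fin 2 → EuclideanSpace ℝ (Fin (n + 1)), Orthonormal ℝ u →
        (∀ i, fderiv ℝ F (e m) (u i) = 0) → 0 ≤ ∑ i, iteratedFDeriv ℝ 2 F (e m) ![u i, u i]) ↔
      (∀ v : Fin 2 → TangentSpace (𝓡 n) m,
        (∀ i j, ⟪mvfderiv (𝓡 n) e m (v i), mvfderiv (𝓡 n) e m (v j)⟫_ℝ =
          if i = j then (1 : ℝ) else 0) →
        0 ≤ ∑ i, ⟪mvfderiv (𝓡 n) ν m (v i), mvfderiv (𝓡 n) e m (v i)⟫_ℝ) := by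
  set De := mvfderiv (𝓡 n) e m with hDe
  set Dν := mvfderiv (𝓡 n) ν m with hDν
  have hF1 : Differentiable ℝ F := hF.differentiable (by simp)
  have hW : ∀ v w : TangentSpace (𝓡 n) m,
      ⟪Dν v, De w⟫_ℝ = ‖gradient F (e m)‖⁻¹ * iteratedFDeriv ℝ 2 F (e m) ![De v, De w] :=
    inner_mvfderiv_unitNormal_mvfderiv hF he.contMDiff hFe hν hdF
  have htan : ∀ v, fderiv ℝ F (e m) (De v) = 0 := fun v =>
    fderiv_apply_mfderiv_eq_zero_of_comp_eq_zero hF1 he.contMDiff hFe m v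
  have hpos : 0 < ‖gradient F (e m)‖⁻¹ :=
    inv_pos.2 (norm_pos_iff.2 fun h => hdF (gradient_eq_zero_iff.1 h))
  constructor
  · intro h v hv
    have hsum : ∑ i, ⟪Dν (v i), De (v i)⟫_ℝ =
        ‖gradient F (e m)‖⁻¹ * ∑ i, iteratedFDeriv ℝ 2 F (e m) ![De (v i), De (v i)] := by
      rw [Finset.mul_sum]
      exact Finset.sum_congr rfl fun i _ => hW (v i) (v i)
    rw [hsum]
    exact mul_nonneg hpos.le (h (fun i => De (v i)) (orthonormal_iff_ite.2 hv) fun i => htan (v i))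
  · intro h u hu hu0
    -- lift the tangent frame `u` through `de(m)`
    have hmem : ∀ i, u i ∈ De.range := by
      intro i
      rw [hDe, range_mvfderiv_eq_ker_fderiv hF1 he hFe hdF]
      exact hu0 i
    choose v hv using hmem
    have hv' : ∀ i, De (v i) = u i := hv
    have hg : ∀ i j, ⟪De (v i), De (v j)⟫_ℝ = if i = j then (1 : ℝ) else 0 := by
      intro i j
      rw [hv', hv']
      exact orthonormal_iff_ite.1 hu i j
    have h1 := h v hg
    have hsum : ∑ i, ⟪Dν (v i), De (v i)⟫_ℝ =
        ‖gradient F (e m)‖⁻¹ * ∑ i, iteratedFDeriv ℝ 2 F (e m) ![u i, u i] := by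
      rw [Finset.mul_sum]
      exact Finset.sum_congr rfl fun i _ => by rw [hW (v i) (v i), hv']
    rw [hsum] at h1
    exact (mul_nonneg_iff_of_pos_left hpos).1 h1

end Dictionary

/-! ## The fact's two-convexity clause is `λ₁ + λ₂ ≥ 0` for the tangential Hessian (Ky Fan) -/

section KyFanBridge

variable {n : ℕ}

/-- **The tangential Hessian operator.** For `F` of class `C²` at `x`, the restriction of the
Hessian `D²F(x)` to the hyperplane `K = ker dF(x)` is represented by a symmetric operator
`T : K → K`, `⟪T v, w⟫ = D²F(x)(v, w)` (Riesz in the finite-dimensional `K`; symmetry of second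
derivatives). With the outer normal `∇F/|∇F|`, `T/|∇F(x)|` is the Weingarten map of the level
hypersurface at a regular point (cf. `inner_mvfderiv_unitNormal_mvfderiv`). [folklore] -/
theorem exists_tangentialHessian {F : EuclideanSpace ℝ (Fin (n + 1)) → ℝ}
    {x : EuclideanSpace ℝ (Fin (n + 1))} (hF : ContDiff ℝ 2 F) :
    ∃ T : (fderiv ℝ F x).ker →L[ℝ] (fderiv ℝ F x).ker,
      (∀ v w : (fderiv ℝ F x).ker, ⟪T v, w⟫_ℝ =
        iteratedFDeriv ℝ 2 F x ![(v : EuclideanSpace ℝ (Fin (n + 1))), (w : _)]) ∧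
      (T : (fderiv ℝ F x).ker →ₗ[ℝ] (fderiv ℝ F x).ker).IsSymmetric := by
  set K := (fderiv ℝ F x).ker with hK
  set R : K ≃L[ℝ] StrongDual ℝ K := ((innerₗ K).toContPerfPair).toContinuousLinearEquiv with hR
  have hRapply : ∀ v w : K, R v w = ⟪v, w⟫_ℝ := fun v w => rfl
  have hRsymm : ∀ (ℓ : StrongDual ℝ K) (w : K), ⟪R.symm ℓ, w⟫_ℝ = ℓ w := by
    intro ℓ w
    rw [← hRapply, ContinuousLinearEquiv.apply_symm_apply]
  set β : K →L[ℝ] StrongDual ℝ K :=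
    (fderiv ℝ (fderiv ℝ F) x).bilinearComp K.subtypeL K.subtypeL with hβ
  refine ⟨(R.symm : StrongDual ℝ K →L[ℝ] K).comp β, fun v w => ?_, fun v w => ?_⟩
  · rw [ContinuousLinearMap.comp_apply, ContinuousLinearEquiv.coe_coe, hRsymm,
      iteratedFDeriv_two_apply]
    simp [hβ]
  · change ⟪((R.symm : StrongDual ℝ K →L[ℝ] K).comp β) v, w⟫_ℝ =
      ⟪v, ((R.symm : StrongDual ℝ K →L[ℝ] K).comp β) w⟫_ℝ
    rw [ContinuousLinearMap.comp_apply, ContinuousLinearEquiv.coe_coe, hRsymm,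
      ← real_inner_comm v, ContinuousLinearMap.comp_apply, ContinuousLinearEquiv.coe_coe, hRsymm]
    simp only [hβ, ContinuousLinearMap.bilinearComp_apply, Submodule.subtypeL_apply]
    have hsymm := (hF.contDiffAt (x := x)).isSymmSndFDerivAt (by simp)
    exact hsymm (v : EuclideanSpace ℝ (Fin (n + 1))) w

/-- **The two-convexity clause of the fact is `λ₁ + λ₂ ≥ c` for the tangential Hessian** (Ky
Fan, `Literature.Analysis.InnerProduct.kyFan_two_iff`): for any symmetric operator `T` on
`K = ker dF(x)` representing `D²F(x)|_K` (`exists_tangentialHessian`) and `dim K = m + 2`,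
"`D²F(x)(u₁, u₁) + D²F(x)(u₂, u₂) ≥ c` for all orthonormal `u₁, u₂ ∈ ker dF(x)`" holds iff the
two smallest eigenvalues of `T` (Mathlib's antitone enumeration: the last two) sum to `≥ c` —
Huisken–Sinestrari's `λ₁ + λ₂` (times `|∇F(x)|`) for the level hypersurface (p. 143).
[cite: HuiskenSinestrari2008, Prop. 2.6 (proof), p. 143] -/
theorem twoConvexClause_iff_eigenvalues {m : ℕ} {F : EuclideanSpace ℝ (Fin (n + 1)) → ℝ}
    {x : EuclideanSpace ℝ (Fin (n + 1))}
    (T : (fderiv ℝ F x).ker →L[ℝ] (fderiv ℝ F x).ker)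
    (hTB : ∀ v w : (fderiv ℝ F x).ker, ⟪T v, w⟫_ℝ =
      iteratedFDeriv ℝ 2 F x ![(v : EuclideanSpace ℝ (Fin (n + 1))), (w : _)])
    (hT : (T : (fderiv ℝ F x).ker →ₗ[ℝ] (fderiv ℝ F x).ker).IsSymmetric)
    (hd : finrank ℝ (fderiv ℝ F x).ker = m + 2) (c : ℝ) :
    (∀ u : Fin 2 → EuclideanSpace ℝ (Fin (n + 1)), Orthonormal ℝ u →
        (∀ i, fderiv ℝ F x (u i) = 0) → c ≤ ∑ i, iteratedFDeriv ℝ 2 F x ![u i, u i]) ↔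
      c ≤ hT.eigenvalues hd (Fin.last (m + 1)) + hT.eigenvalues hd (Fin.last m).castSucc := by
  rw [← Literature.Analysis.InnerProduct.kyFan_two_iff hT hd c]
  constructor
  · intro h e he
    have h1 := h (fun j => (e j : EuclideanSpace ℝ (Fin (n + 1))))
      (orthonormal_iff_ite.2 fun i j => by
        rw [← Submodule.coe_inner, orthonormal_iff_ite.1 he i j])
      (fun j => (e j).2)
    simpa only [ContinuousLinearMap.coe_coe, hTB] using h1
  · intro h u hu hu0
    set e : Fin 2 → (fderiv ℝ F x).ker := fun j => ⟨u j, hu0 j⟩ with he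
    have he' : Orthonormal ℝ e := orthonormal_iff_ite.2 fun i j => by
      rw [Submodule.coe_inner]
      exact orthonormal_iff_ite.1 hu i j
    have h1 := h e he'
    simpa only [ContinuousLinearMap.coe_coe, hTB] using h1

end KyFanBridge

section KyFanBridgeGeneral

variable {n : ℕ}

/-- Orthonormal `k`-frames of `ℝⁿ⁺¹` inside `ker dF(x)` are the orthonormal `k`-frames of the
inner product space `ker dF(x)`. [folklore] -/
theorem forall_orthonormal_ker_iff {k : ℕ} {f : EuclideanSpace ℝ (Fin (n + 1)) →L[ℝ] ℝ}
    {P : (Fin k → EuclideanSpace ℝ (Fin (n + 1))) → Prop} :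
    (∀ u : Fin k → EuclideanSpace ℝ (Fin (n + 1)), Orthonormal ℝ u → (∀ i, f (u i) = 0) → P u) ↔
      ∀ e : Fin k → f.ker, Orthonormal ℝ e →
        P fun j => (e j : EuclideanSpace ℝ (Fin (n + 1))) := by
  constructor
  · intro h e he
    exact h _ (orthonormal_iff_ite.2 fun i j => by
      rw [← Submodule.coe_inner, orthonormal_iff_ite.1 he i j]) fun j => (e j).2
  · intro h u hu hu0
    set e : Fin k → f.ker := fun j => ⟨u j, hu0 j⟩ with he
    have he' : Orthonormal ℝ e := orthonormal_iff_ite.2 fun i j => by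
      rw [Submodule.coe_inner]
      exact orthonormal_iff_ite.1 hu i j
    exact h e he'

/-- **`k`-convexity clauses are eigenvalue conditions (Ky Fan, general `k`).** For a symmetric
operator `T` on `K = ker dF(x)` representing `D²F(x)|_K` (`exists_tangentialHessian`),
`dim K = d`, `k ≤ d`: "`Σᵢ D²F(x)(uᵢ, uᵢ) ≥ c` for all orthonormal `k`-frames `u` in `ker dF(x)`"
iff the `k` smallest eigenvalues of `T` (the last `k` in Mathlib's antitone enumeration) sum to
`≥ c` (`Literature.Analysis.InnerProduct.kyFan_iff`; Harvey–Lawson Cor. 2.6 / Remark 3.12: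
`k`-convexity of the level set ⇔ `λ₁ + ⋯ + λ_k ≥ 0`). [folklore] -/
theorem kConvexClause_iff_eigenvalues {k d : ℕ} {F : EuclideanSpace ℝ (Fin (n + 1)) → ℝ}
    {x : EuclideanSpace ℝ (Fin (n + 1))}
    (T : (fderiv ℝ F x).ker →L[ℝ] (fderiv ℝ F x).ker)
    (hTB : ∀ v w : (fderiv ℝ F x).ker, ⟪T v, w⟫_ℝ =
      iteratedFDeriv ℝ 2 F x ![(v : EuclideanSpace ℝ (Fin (n + 1))), (w : _)])
    (hT : (T : (fderiv ℝ F x).ker →ₗ[ℝ] (fderiv ℝ F x).ker).IsSymmetric)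
    (hd : finrank ℝ (fderiv ℝ F x).ker = d) (hk : k ≤ d) (c : ℝ) :
    (∀ u : Fin k → EuclideanSpace ℝ (Fin (n + 1)), Orthonormal ℝ u →
        (∀ i, fderiv ℝ F x (u i) = 0) → c ≤ ∑ i, iteratedFDeriv ℝ 2 F x ![u i, u i]) ↔
      c ≤ ∑ i ∈ Finset.univ.filter (fun i : Fin d => d - k ≤ (i : ℕ)), hT.eigenvalues hd i := by
  rw [← Literature.Analysis.InnerProduct.kyFan_iff hT hd hk c, forall_orthonormal_ker_iff]
  simp only [ContinuousLinearMap.coe_coe, hTB]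

/-- Strict form: "`Σᵢ D²F(x)(uᵢ, uᵢ) > c` for all orthonormal `k`-frames in `ker dF(x)`" iff the
`k` smallest eigenvalues of the tangential Hessian sum to `> c`; with `c = 0` the left side is
the tree's `IsKConvexLevelSetAt k F x` (`isKConvexLevelSetAt_iff_eigenvalues`). [folklore] -/
theorem kConvexClause_lt_iff_eigenvalues {k d : ℕ} {F : EuclideanSpace ℝ (Fin (n + 1)) → ℝ}
    {x : EuclideanSpace ℝ (Fin (n + 1))}
    (T : (fderiv ℝ F x).ker →L[ℝ] (fderiv ℝ F x).ker)
    (hTB : ∀ v w : (fderiv ℝ F x).ker, ⟪T v, w⟫_ℝ =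
      iteratedFDeriv ℝ 2 F x ![(v : EuclideanSpace ℝ (Fin (n + 1))), (w : _)])
    (hT : (T : (fderiv ℝ F x).ker →ₗ[ℝ] (fderiv ℝ F x).ker).IsSymmetric)
    (hd : finrank ℝ (fderiv ℝ F x).ker = d) (hk : k ≤ d) (c : ℝ) :
    (∀ u : Fin k → EuclideanSpace ℝ (Fin (n + 1)), Orthonormal ℝ u →
        (∀ i, fderiv ℝ F x (u i) = 0) → c < ∑ i, iteratedFDeriv ℝ 2 F x ![u i, u i]) ↔
      c < ∑ i ∈ Finset.univ.filter (fun i : Fin d => d - k ≤ (i : ℕ)), hT.eigenvalues hd i := by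
  rw [← Literature.Analysis.InnerProduct.kyFan_lt_iff hT hd hk c, forall_orthonormal_ker_iff]
  simp only [ContinuousLinearMap.coe_coe, hTB]

/-- **`k`-convexity of a level set is `λ₁ + ⋯ + λ_k > 0` for the tangential Hessian**
(Harvey–Lawson 2013, Remark 3.12, through Ky Fan's minimum principle): the tree's
`IsKConvexLevelSetAt k F x` holds iff the `k` smallest eigenvalues of any symmetric operator
representing `D²F(x)` on `ker dF(x)` have positive sum. [folklore] -/
theorem isKConvexLevelSetAt_iff_eigenvalues {k d : ℕ} {F : EuclideanSpace ℝ (Fin (n + 1)) → ℝ}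
    {x : EuclideanSpace ℝ (Fin (n + 1))}
    (T : (fderiv ℝ F x).ker →L[ℝ] (fderiv ℝ F x).ker)
    (hTB : ∀ v w : (fderiv ℝ F x).ker, ⟪T v, w⟫_ℝ =
      iteratedFDeriv ℝ 2 F x ![(v : EuclideanSpace ℝ (Fin (n + 1))), (w : _)])
    (hT : (T : (fderiv ℝ F x).ker →ₗ[ℝ] (fderiv ℝ F x).ker).IsSymmetric)
    (hd : finrank ℝ (fderiv ℝ F x).ker = d) (hk : k ≤ d) :
    IsKConvexLevelSetAt k F x ↔
      0 < ∑ i ∈ Finset.univ.filter (fun i : Fin d => d - k ≤ (i : ℕ)), hT.eigenvalues hd i :=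
  kConvexClause_lt_iff_eigenvalues T hTB hT hd hk 0

/-- At a regular point the tangent hyperplane `ker dF(x)` of the level set in `ℝⁿ⁺¹` has
dimension `n` (so the above apply with `d = n`). [folklore] -/
theorem finrank_ker_fderiv {F : EuclideanSpace ℝ (Fin (n + 1)) → ℝ}
    {x : EuclideanSpace ℝ (Fin (n + 1))} (hdF : fderiv ℝ F x ≠ 0) :
    finrank ℝ (fderiv ℝ F x).ker = n :=
  finrank_ker_of_ne_zero hdF

end KyFanBridgeGeneral

/-! ## The farthest point: a strictly convex point on every compact level hypersurface

Huisken–Sinestrari, proof of Prop. 2.6 (i), p. 144: "If `λ₁ + λ₂` were not strictly positive for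
positive times, the strong maximum principle … would imply that `λ₁ + λ₂ = 0` everywhere on `M₀`.
But this is impossible since there is at least one point on `M₀ → ℝⁿ⁺¹` where all eigenvalues are
strictly positive." That point is a farthest point of the surface from any fixed centre; the
comparison with the enclosing sphere through it (cf. Prop. 2.7 (iv), p. 145) bounds all principal
curvatures there from below by `1/R`. Level-set rendering for `Ω = {F ≤ 0}` compact with regular
boundary `{F = 0}` and centre `p ∈ int Ω` (`F p < 0`). -/

section FarthestPoint

variable {E : Type*} [NormedAddCommGroup E] [InnerProductSpace ℝ E]

/-- **The farthest point of `{F ≤ 0}` from an interior point lies on `{F = 0}`.** If `F` is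
continuous, `{F ≤ 0}` is compact and `F p < 0`, there is a point `x₀` with `F x₀ = 0` such that
all of `{F ≤ 0}` lies in the closed ball of radius `‖x₀ - p‖` about `p` (a farthest point of the
compact set from `p`; were `F x₀ < 0`, points slightly beyond `x₀` on the ray from `p` would still
lie in `{F ≤ 0}`). [folklore] -/
theorem exists_eq_zero_forall_norm_sub_le [Nontrivial E] {F : E → ℝ} (hFc : Continuous F)
    (hK : IsCompact {x | F x ≤ 0}) {p : E} (hp : F p < 0) :
    ∃ x₀, F x₀ = 0 ∧ ∀ x, F x ≤ 0 → ‖x - p‖ ≤ ‖x₀ - p‖ := by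
  obtain ⟨x₀, hx₀K, hmax⟩ := hK.exists_isMaxOn ⟨p, hp.le⟩
    ((continuous_id.sub continuous_const).norm).continuousOn
  refine ⟨x₀, ?_, fun x hx => hmax hx⟩
  rcases (show F x₀ ≤ 0 from hx₀K).lt_or_eq with hlt | heq
  swap
  · exact heq
  exfalso
  -- a direction `d` along which `x₀ + t d` moves away from `p` for `t > 0`
  obtain ⟨d, hd⟩ : ∃ d : E, ∀ t : ℝ, 0 < t → ‖x₀ - p‖ < ‖x₀ + t • d - p‖ := by
    by_cases hx₀p : x₀ = p
    · obtain ⟨y, hy⟩ := exists_ne (0 : E)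
      refine ⟨y, fun t ht => ?_⟩
      rw [hx₀p, sub_self, norm_zero, add_sub_cancel_left, norm_smul, Real.norm_of_nonneg ht.le]
      exact mul_pos ht (norm_pos_iff.2 hy)
    · refine ⟨x₀ - p, fun t ht => ?_⟩
      have : x₀ + t • (x₀ - p) - p = (1 + t) • (x₀ - p) := by
        rw [add_smul, one_smul]; abel
      rw [this, norm_smul, Real.norm_of_nonneg (by linarith)]
      have hpos : 0 < ‖x₀ - p‖ := norm_pos_iff.2 (sub_ne_zero.2 hx₀p)
      nlinarith
  have hc : Continuous fun t : ℝ => F (x₀ + t • d) :=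
    hFc.comp (continuous_const.add (continuous_id.smul continuous_const))
  have h0 : F (x₀ + (0 : ℝ) • d) < 0 := by simpa using hlt
  have hev : ∀ᶠ t in 𝓝 (0 : ℝ), F (x₀ + t • d) < 0 := (hc.tendsto 0).eventually_lt_const h0
  obtain ⟨t, htK, ht0⟩ :=
    ((hev.filter_mono nhdsWithin_le_nhds).and (self_mem_nhdsWithin (s := Ioi (0 : ℝ)))).exists
  exact absurd (hmax (le_of_lt htK)) (not_le.2 (hd t ht0))

/-- **First-order condition at the farthest point**: if `{F ≤ 0}` lies in the closed ball of
radius `‖x₀ - p‖` about `p` and `F x₀ = 0`, then `dF(x₀)` kills every vector orthogonal to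
`x₀ - p` (the line `x₀ + t w` leaves the ball for `t ≠ 0`, so `t ↦ F (x₀ + t w)` is minimal at
`t = 0`). [folklore] -/
theorem fderiv_apply_eq_zero_of_forall_norm_sub_le {F : E → ℝ} (hF : Differentiable ℝ F)
    {p x₀ : E} (hx₀ : F x₀ = 0) (hfar : ∀ x, F x ≤ 0 → ‖x - p‖ ≤ ‖x₀ - p‖) {w : E}
    (hw : ⟪w, x₀ - p⟫_ℝ = 0) : fderiv ℝ F x₀ w = 0 := by
  have hmin : IsLocalMin (fun t : ℝ => F (x₀ + t • w)) 0 := by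
    refine Filter.Eventually.of_forall fun t => ?_
    show F (x₀ + (0 : ℝ) • w) ≤ F (x₀ + t • w)
    rw [zero_smul, add_zero, hx₀]
    by_contra h
    rw [not_le] at h
    have h1 := hfar _ h.le
    have h2 : ‖x₀ + t • w - p‖ ^ 2 = ‖x₀ - p‖ ^ 2 + ‖t • w‖ ^ 2 := by
      have : x₀ + t • w - p = (x₀ - p) + t • w := by abel
      rw [this, norm_add_sq_real, real_inner_smul_right, real_inner_comm, hw]
      ring
    have h3 : ‖t • w‖ ^ 2 ≤ 0 := by
      nlinarith [norm_nonneg (x₀ + t • w - p), norm_nonneg (x₀ - p)]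
    have h4 : t • w = 0 := by
      rw [← norm_eq_zero]
      nlinarith [norm_nonneg (t • w)]
    rw [h4, add_zero, hx₀] at h
    exact lt_irrefl _ h
  have hd : HasDerivAt (fun t : ℝ => F (x₀ + t • w)) (fderiv ℝ F x₀ w) 0 := by
    have hγ : HasDerivAt (fun t : ℝ => x₀ + t • w) w 0 := by
      simpa using ((hasDerivAt_id (0 : ℝ)).smul_const w).const_add x₀
    have := (hF (x₀ + (0 : ℝ) • w)).hasFDerivAt.comp_hasDerivAt (0 : ℝ) hγ
    simpa [Function.comp_def] using this
  exact hmin.hasDerivAt_eq_zero hd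

/-- At the farthest point, `dF(x₀)` is a multiple of `⟨·, x₀ - p⟩`:
`dF(x₀) y = (⟨y, x₀ - p⟩/‖x₀ - p‖²) · dF(x₀)(x₀ - p)`. [folklore] -/
theorem fderiv_apply_eq_inner_mul_of_forall_norm_sub_le {F : E → ℝ} (hF : Differentiable ℝ F)
    {p x₀ : E} (hx₀ : F x₀ = 0) (hfar : ∀ x, F x ≤ 0 → ‖x - p‖ ≤ ‖x₀ - p‖) (hne : x₀ ≠ p)
    (y : E) :
    fderiv ℝ F x₀ y = ⟪y, x₀ - p⟫_ℝ / ‖x₀ - p‖ ^ 2 * fderiv ℝ F x₀ (x₀ - p) := by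
  set u := x₀ - p with hu
  have hu0 : ‖u‖ ≠ 0 := norm_ne_zero_iff.2 (sub_ne_zero.2 hne)
  set c : ℝ := ⟪y, u⟫_ℝ / ‖u‖ ^ 2 with hc
  have hperp : ⟪y - c • u, u⟫_ℝ = 0 := by
    rw [inner_sub_left, real_inner_smul_left, real_inner_self_eq_norm_sq, hc,
      div_mul_cancel₀ _ (pow_ne_zero 2 hu0), sub_self]
  have h1 := fderiv_apply_eq_zero_of_forall_norm_sub_le hF hx₀ hfar hperp
  have h2 : y = (y - c • u) + c • u := by abel
  conv_lhs => rw [h2, map_add, h1, zero_add, map_smul, smul_eq_mul]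

/-- **Outward sign at the farthest point**: `dF(x₀)(x₀ - p) ≥ 0` (the ray from `p` through `x₀`
leaves `{F ≤ 0}` at `x₀`). [folklore] -/
theorem fderiv_apply_sub_nonneg_of_forall_norm_sub_le {F : E → ℝ} (hF : Differentiable ℝ F)
    {p x₀ : E} (hx₀ : F x₀ = 0) (hfar : ∀ x, F x ≤ 0 → ‖x - p‖ ≤ ‖x₀ - p‖) (hne : x₀ ≠ p) :
    0 ≤ fderiv ℝ F x₀ (x₀ - p) := by
  have hpos : 0 < ‖x₀ - p‖ := norm_pos_iff.2 (sub_ne_zero.2 hne)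
  -- `F ≥ 0 = F x₀` on the segment `[x₀, x₀ + (x₀ - p)]`
  have hmin : IsLocalMinOn F (segment ℝ x₀ (x₀ + (x₀ - p))) x₀ := by
    refine IsMinOn.localize fun y hy => ?_
    show F x₀ ≤ F y
    rw [hx₀]
    obtain ⟨a, b, ha, hb, hab, rfl⟩ := hy
    by_contra h
    rw [not_le] at h
    have h1 := hfar _ h.le
    have h2 : a • x₀ + b • (x₀ + (x₀ - p)) - p = (1 + b) • (x₀ - p) := by
      rw [add_smul, one_smul, smul_add, ← add_assoc, ← add_smul, hab, one_smul]; abel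
    rw [h2, norm_smul, Real.norm_of_nonneg (by linarith)] at h1
    have hb0 : b = 0 := by nlinarith
    subst hb0
    have ha1 : a = 1 := by linarith
    subst ha1
    simp only [one_smul, zero_smul, add_zero] at h
    rw [hx₀] at h
    exact lt_irrefl _ h
  have := hmin.hasFDerivWithinAt_nonneg (hF x₀).hasFDerivAt.hasFDerivWithinAt
    (sub_mem_posTangentConeAt_of_segment_subset (Subset.refl _))
  simpa using this

/-- … and `dF(x₀)(x₀ - p) > 0` as soon as `dF(x₀) ≠ 0` (by the first-order condition `dF(x₀)`
is a multiple of `⟨·, x₀ - p⟩`). [folklore] -/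
theorem fderiv_apply_sub_pos_of_forall_norm_sub_le {F : E → ℝ} (hF : Differentiable ℝ F)
    {p x₀ : E} (hx₀ : F x₀ = 0) (hfar : ∀ x, F x ≤ 0 → ‖x - p‖ ≤ ‖x₀ - p‖) (hne : x₀ ≠ p)
    (hdF : fderiv ℝ F x₀ ≠ 0) : 0 < fderiv ℝ F x₀ (x₀ - p) := by
  refine (fderiv_apply_sub_nonneg_of_forall_norm_sub_le hF hx₀ hfar hne).lt_of_ne fun h => hdF ?_
  ext y
  rw [fderiv_apply_eq_inner_mul_of_forall_norm_sub_le hF hx₀ hfar hne y, ← h, mul_zero]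
  simp

/-- **Second-order condition at the farthest point (all principal curvatures are `≥ 1/R`).** If
`F` is `C²`, `F x₀ = 0` and `{F ≤ 0}` lies in the closed ball of radius `R = ‖x₀ - p‖ > 0` about
`p`, then for every `v ⊥ x₀ - p`,
`(dF(x₀)(x₀ - p)/R²) ‖v‖² ≤ D²F(x₀)(v, v)`: the parabola
`c(t) = x₀ + t v - (t²‖v‖²/2R²)(x₀ - p)` osculates the sphere of radius `R` from outside, so
`F ∘ c ≥ 0 = F (c 0)` and `(F ∘ c)''(0) = D²F(x₀)(v,v) - (‖v‖²/R²) dF(x₀)(x₀ - p) ≥ 0`. With the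
outer normal `∇F/|∇F|` and `h = D²F|_{ker dF}/|∇F|` this is `h ≥ g/R` at `x₀`. [folklore] -/
theorem le_iteratedFDeriv_two_of_forall_norm_sub_le {F : E → ℝ} (hF : ContDiff ℝ 2 F)
    {p x₀ : E} (hx₀ : F x₀ = 0) (hfar : ∀ x, F x ≤ 0 → ‖x - p‖ ≤ ‖x₀ - p‖) (hne : x₀ ≠ p)
    {v : E} (hv : ⟪v, x₀ - p⟫_ℝ = 0) :
    fderiv ℝ F x₀ (x₀ - p) / ‖x₀ - p‖ ^ 2 * ‖v‖ ^ 2 ≤ iteratedFDeriv ℝ 2 F x₀ ![v, v] := by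
  set u := x₀ - p with hu
  set R : ℝ := ‖u‖ with hR
  have hRpos : 0 < R := norm_pos_iff.2 (sub_ne_zero.2 hne)
  have hF1 : Differentiable ℝ F := hF.differentiable (by simp)
  have hFd : DifferentiableAt ℝ (fderiv ℝ F) x₀ :=
    ((hF.fderiv_right (m := 1) (by norm_num)).differentiable (by simp)) x₀
  -- the osculating parabola
  set s : ℝ := ‖v‖ ^ 2 / (2 * R ^ 2) with hs
  have hsv : ‖v‖ ^ 2 = 2 * s * R ^ 2 := by
    rw [hs]; field_simp
  set w : E := (-s) • u with hw
  set c : ℝ → E := fun t => x₀ + t • v + t ^ 2 • w with hc_def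
  have hc0 : c 0 = x₀ := by simp [hc_def]
  have hc' : ∀ t, HasDerivAt c (v + (2 * t) • w) t := by
    intro t
    have h1 : HasDerivAt (fun y : ℝ => x₀ + y • v) v t := by
      simpa using ((hasDerivAt_id t).smul_const v).const_add x₀
    have h2 : HasDerivAt (fun y : ℝ => y ^ 2 • w) ((2 * t) • w) t := by
      simpa [pow_one] using (hasDerivAt_pow 2 t).smul_const w
    rw [hc_def]
    exact h1.add h2
  -- `c t` lies outside the open ball: `‖c t - p‖² = R² + (R s t²)²`
  have hdist : ∀ t, ‖c t - p‖ ^ 2 = R ^ 2 + (R * s * t ^ 2) ^ 2 := by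
    intro t
    have h1 : c t - p = (1 - s * t ^ 2) • u + t • v := by
      simp only [hc_def, hw, hu, smul_smul, sub_smul, one_smul, smul_neg, neg_smul,
        mul_comm (t ^ 2) s]
      abel
    rw [h1, norm_add_sq_real, real_inner_smul_left, real_inner_smul_right, real_inner_comm, hv,
      norm_smul, norm_smul, Real.norm_eq_abs, Real.norm_eq_abs, mul_pow, mul_pow, sq_abs, sq_abs,
      ← hR, hsv]
    ring
  -- hence `F ∘ c ≥ 0 = F (c 0)`
  set φ : ℝ → ℝ := fun t => F (c t) with hφ
  have hφmin : IsLocalMin φ 0 := by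
    refine Filter.Eventually.of_forall fun t => ?_
    show F (c 0) ≤ F (c t)
    rw [hc0, hx₀]
    by_contra h
    rw [not_le] at h
    have h1 := hfar _ h.le
    have h2 : (R * s * t ^ 2) ^ 2 ≤ 0 := by
      have := hdist t
      nlinarith [norm_nonneg (c t - p)]
    have h3 : R * s * t ^ 2 = 0 := by nlinarith [sq_nonneg (R * s * t ^ 2)]
    have h4 : s * t ^ 2 = 0 := by
      rcases mul_eq_zero.1 (show R * (s * t ^ 2) = 0 by rw [← mul_assoc]; exact h3) with h | h
      · exact absurd h hRpos.ne'
      · exact h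
    -- then `c t = x₀`
    have h5 : c t = x₀ := by
      rcases mul_eq_zero.1 h4 with hs0 | ht0
      · have hv0 : v = 0 := by
          rw [← norm_eq_zero]; nlinarith [norm_nonneg v, hsv, hs0]
        simp [hc_def, hw, hs0, hv0]
      · have : t = 0 := pow_eq_zero_iff two_ne_zero |>.1 ht0
        simp [hc_def, this]
    rw [h5, hx₀] at h
    exact lt_irrefl _ h
  -- first derivative of `φ` everywhere, second derivative at `0`
  have hφ' : ∀ t, HasDerivAt φ (fderiv ℝ F (c t) (v + (2 * t) • w)) t := fun t =>
    (hF1 (c t)).hasFDerivAt.comp_hasDerivAt t (hc' t)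
  have hderiv : deriv φ = fun t => fderiv ℝ F (c t) (v + (2 * t) • w) :=
    funext fun t => (hφ' t).deriv
  have hφ'' : HasDerivAt (deriv φ)
      (fderiv ℝ (fderiv ℝ F) x₀ v v + fderiv ℝ F x₀ ((2 : ℝ) • w)) 0 := by
    rw [hderiv]
    have h1 : HasDerivAt (fun t => fderiv ℝ F (c t))
        (fderiv ℝ (fderiv ℝ F) x₀ (v + (2 * (0 : ℝ)) • w)) 0 := by
      have hFd' : DifferentiableAt ℝ (fderiv ℝ F) (c 0) := by rw [hc0]; exact hFd
      have := hFd'.hasFDerivAt.comp_hasDerivAt (0 : ℝ) (hc' 0)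
      rwa [hc0] at this
    have h2 : HasDerivAt (fun t : ℝ => v + (2 * t) • w) ((2 : ℝ) • w) 0 := by
      have := (((hasDerivAt_id (0 : ℝ)).const_mul 2).smul_const w).const_add v
      simpa using this
    have h3 := h1.clm_apply h2
    simp only [mul_zero, zero_smul, add_zero, hc0] at h3
    exact h3
  have key : 0 ≤ fderiv ℝ (fderiv ℝ F) x₀ v v + fderiv ℝ F x₀ ((2 : ℝ) • w) := by
    rw [← hφ''.deriv]
    exact Literature.Analysis.PDE.deriv_deriv_nonneg_of_isLocalMin hφmin
      (hφ' 0).continuousAt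
  rw [iteratedFDeriv_two_apply]
  simp only [Matrix.cons_val_zero, Matrix.cons_val_one]
  rw [hw, smul_smul, map_smul, smul_eq_mul, hs] at key
  have hR2 : R ^ 2 ≠ 0 := pow_ne_zero 2 hRpos.ne'
  have : fderiv ℝ F x₀ u / R ^ 2 * ‖v‖ ^ 2 =
      -(2 * -(‖v‖ ^ 2 / (2 * R ^ 2)) * fderiv ℝ F x₀ u) := by
    ring
  rw [this]
  linarith


/-- At the farthest point, `‖dF(x₀)‖ = dF(x₀)(x₀ - p)/‖x₀ - p‖` (the differential is the multiple
`(dF(x₀)(x₀ - p)/R²) ⟨·, x₀ - p⟩` of the inner product with the outward radial vector).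
[folklore] -/
theorem norm_fderiv_eq_of_forall_norm_sub_le {F : E → ℝ} (hF : Differentiable ℝ F)
    {p x₀ : E} (hx₀ : F x₀ = 0) (hfar : ∀ x, F x ≤ 0 → ‖x - p‖ ≤ ‖x₀ - p‖) (hne : x₀ ≠ p) :
    ‖fderiv ℝ F x₀‖ = fderiv ℝ F x₀ (x₀ - p) / ‖x₀ - p‖ := by
  have hR : 0 < ‖x₀ - p‖ := norm_pos_iff.2 (sub_ne_zero.2 hne)
  have h0 : 0 ≤ fderiv ℝ F x₀ (x₀ - p) :=
    fderiv_apply_sub_nonneg_of_forall_norm_sub_le hF hx₀ hfar hne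
  refine le_antisymm ?_ ?_
  · refine ContinuousLinearMap.opNorm_le_bound _ (div_nonneg h0 hR.le) fun y => ?_
    rw [fderiv_apply_eq_inner_mul_of_forall_norm_sub_le hF hx₀ hfar hne y, Real.norm_eq_abs,
      abs_mul, abs_of_nonneg h0, abs_div, abs_of_nonneg (sq_nonneg ‖x₀ - p‖), div_mul_eq_mul_div,
      div_le_iff₀ (pow_pos hR 2)]
    have h1 : |⟪y, x₀ - p⟫_ℝ| ≤ ‖y‖ * ‖x₀ - p‖ := abs_real_inner_le_norm _ _
    calc |⟪y, x₀ - p⟫_ℝ| * fderiv ℝ F x₀ (x₀ - p)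
        ≤ ‖y‖ * ‖x₀ - p‖ * fderiv ℝ F x₀ (x₀ - p) := mul_le_mul_of_nonneg_right h1 h0
      _ = fderiv ℝ F x₀ (x₀ - p) / ‖x₀ - p‖ * ‖y‖ * ‖x₀ - p‖ ^ 2 := by
        simp only [div_mul_eq_mul_div]
        rw [eq_div_iff hR.ne']
        ring
  · rw [div_le_iff₀ hR]
    have h1 := (fderiv ℝ F x₀).le_opNorm (x₀ - p)
    rw [Real.norm_eq_abs] at h1
    exact (le_abs_self _).trans h1

/-- **Huisken–Sinestrari, Prop. 2.6 (i), proof (p. 144): "there is at least one point on `M₀`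
where all eigenvalues are strictly positive"** — the farthest point from an interior point, in
the level-set idiom of the fact. If `F` is `C²`, `{F ≤ 0}` is compact, `F p < 0` and `dF ≠ 0` on
`{F = 0}`, then at a farthest point `x₀ ∈ {F = 0}` of `{F ≤ 0}` from `p`, with `R = ‖x₀ - p‖`,
`D²F(x₀)(v, v) ≥ (‖dF(x₀)‖/R) ‖v‖²` for every tangent vector `v ∈ ker dF(x₀)`: all principal
curvatures of `{F = 0}` at `x₀` (outer normal `∇F/|∇F|`, `h = D²F|_{ker dF}/|∇F|`) are
`≥ 1/R > 0` ("comparison with an enclosing round sphere", p. 145).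
[cite: HuiskenSinestrari2008, Prop. 2.6 (i) (proof), p. 144] -/
theorem exists_farthest_forall_le_iteratedFDeriv_two [Nontrivial E] {F : E → ℝ}
    (hF : ContDiff ℝ 2 F) (hK : IsCompact {x | F x ≤ 0}) {p : E} (hp : F p < 0)
    (hreg : ∀ x, F x = 0 → fderiv ℝ F x ≠ 0) :
    ∃ x₀, F x₀ = 0 ∧ x₀ ≠ p ∧ (∀ x, F x ≤ 0 → ‖x - p‖ ≤ ‖x₀ - p‖) ∧
      ∀ v, fderiv ℝ F x₀ v = 0 →
        ‖fderiv ℝ F x₀‖ / ‖x₀ - p‖ * ‖v‖ ^ 2 ≤ iteratedFDeriv ℝ 2 F x₀ ![v, v] := by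
  have hF1 : Differentiable ℝ F := hF.differentiable (by simp)
  obtain ⟨x₀, hx₀, hfar⟩ := exists_eq_zero_forall_norm_sub_le hF.continuous hK hp
  have hne : x₀ ≠ p := fun h => by rw [h] at hx₀; exact hp.ne hx₀
  have hR : 0 < ‖x₀ - p‖ := norm_pos_iff.2 (sub_ne_zero.2 hne)
  refine ⟨x₀, hx₀, hne, hfar, fun v hv => ?_⟩
  have hpos := fderiv_apply_sub_pos_of_forall_norm_sub_le hF1 hx₀ hfar hne (hreg x₀ hx₀)
  -- tangent vectors are orthogonal to `x₀ - p`
  have hperp : ⟪v, x₀ - p⟫_ℝ = 0 := by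
    have h := fderiv_apply_eq_inner_mul_of_forall_norm_sub_le hF1 hx₀ hfar hne v
    rw [hv] at h
    have h' : ⟪v, x₀ - p⟫_ℝ / ‖x₀ - p‖ ^ 2 = 0 := by
      rcases mul_eq_zero.1 h.symm with h | h
      · exact h
      · exact absurd h hpos.ne'
    simpa [hR.ne'] using h'
  have h := le_iteratedFDeriv_two_of_forall_norm_sub_le hF hx₀ hfar hne hperp
  rwa [norm_fderiv_eq_of_forall_norm_sub_le hF1 hx₀ hfar hne, div_div, ← sq]

/-- Consequence: a compact regular level hypersurface `{F = 0} = ∂{F ≤ 0}` has a point at which it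
is strictly `k`-convex for every `k ≥ 1` (`Literature.Geometry.Riemannian.IsKConvexLevelSetAt`:
all sums of `k` principal curvatures, indeed all principal curvatures, are positive there).
[cite: HuiskenSinestrari2008, Prop. 2.6 (i) (proof), p. 144] -/
theorem exists_forall_isKConvexLevelSetAt [Nontrivial E] {F : E → ℝ} (hF : ContDiff ℝ 2 F)
    (hK : IsCompact {x | F x ≤ 0}) (hreg : ∀ x, F x = 0 → fderiv ℝ F x ≠ 0)
    (hne : ∃ x, F x = 0) :
    ∃ x₀, F x₀ = 0 ∧ ∀ k, 1 ≤ k → IsKConvexLevelSetAt k F x₀ := by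
  obtain ⟨x, hx⟩ := hne
  obtain ⟨p, hp⟩ := exists_lt_zero_of_fderiv_ne_zero hx (hreg x hx)
  obtain ⟨x₀, hx₀, hx₀p, -, hcurv⟩ := exists_farthest_forall_le_iteratedFDeriv_two hF hK hp hreg
  refine ⟨x₀, hx₀, fun k hk v hv hv0 => ?_⟩
  have hR : 0 < ‖x₀ - p‖ := norm_pos_iff.2 (sub_ne_zero.2 hx₀p)
  have hc : 0 < ‖fderiv ℝ F x₀‖ / ‖x₀ - p‖ := div_pos (norm_pos_iff.2 (hreg x₀ hx₀)) hR
  haveI : Nonempty (Fin k) := ⟨⟨0, hk⟩⟩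
  refine Finset.sum_pos (fun i _ => lt_of_lt_of_le ?_ (hcurv (v i) (hv0 i))) Finset.univ_nonempty
  rw [hv.1 i, one_pow, mul_one]
  exact hc

end FarthestPoint

section FarthestPointManifold

/-- **Prop. 2.6 (i)'s strictly convex point, in the format of the fact.** Under the hypotheses of
`HuiskenSinestrari2009_twoConvex_simplyConnected` on `F` and `e` (for any nonempty `M`; no
curvature hypothesis is needed), there is a point `m : M` at which the hypersurface
`e(M) = {F = 0}` is strictly `k`-convex for every `k ≥ 1`, i.e. all its principal curvatures with
respect to the outer normal are positive.
[cite: HuiskenSinestrari2008, Prop. 2.6 (i) (proof), p. 144] -/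
theorem exists_forall_isKConvexLevelSetAt_comp {n : ℕ} {M : Type*} [Nonempty M]
    {F : EuclideanSpace ℝ (Fin (n + 1)) → ℝ} {e : M → EuclideanSpace ℝ (Fin (n + 1))}
    (hF : ContDiff ℝ 2 F) (hK : IsCompact {x | F x ≤ 0}) (hreg : ∀ x, F x = 0 → fderiv ℝ F x ≠ 0)
    (hrange : Set.range e = {x | F x = 0}) :
    ∃ m : M, ∀ k, 1 ≤ k → IsKConvexLevelSetAt k F (e m) := by
  haveI : Nontrivial (EuclideanSpace ℝ (Fin (n + 1))) :=
    Module.nontrivial_of_finrank_pos (R := ℝ) (by rw [finrank_euclideanSpace_fin]; omega)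
  obtain ⟨m₁⟩ := ‹Nonempty M›
  have hm₁ : F (e m₁) = 0 := by
    have : e m₁ ∈ Set.range e := ⟨m₁, rfl⟩
    rw [hrange] at this
    exact this
  obtain ⟨x₀, hx₀, hk⟩ := exists_forall_isKConvexLevelSetAt hF hK hreg ⟨e m₁, hm₁⟩
  have hx₀' : x₀ ∈ Set.range e := by rw [hrange]; exact hx₀
  obtain ⟨m, rfl⟩ := hx₀'
  exact ⟨m, hk⟩

variable {n : ℕ} {M : Type*} [TopologicalSpace M] [ChartedSpace (EuclideanSpace ℝ (Fin n)) M]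

/-- **All principal curvatures are `≥ 1/R` at the farthest point** (Weingarten form, outer unit
normal `ν = ∇F(e ·)/|∇F(e ·)|`, `h(v, w) = ⟨dν v, de w⟩`, induced metric `g(v, w) = ⟨de v, de w⟩`):
for a smooth map `e` of `M` onto the regular compact level hypersurface `{F = 0} = ∂{F ≤ 0}` and
an interior point `p` (`F p < 0`), there is `m : M` with `e m` farthest from `p` on `e(M)`, and
there `h(v, v) ≥ g(v, v)/R`, `R = ‖e m - p‖` — the enclosing-sphere comparison behind "there is
at least one point where all eigenvalues are strictly positive" (Huisken–Sinestrari, proof of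
Prop. 2.6 (i), p. 144). [cite: HuiskenSinestrari2008, Prop. 2.6 (i) (proof), p. 144] -/
theorem exists_farthest_weingarten_ge [IsManifold (𝓡 n) ∞ M]
    {F : EuclideanSpace ℝ (Fin (n + 1)) → ℝ} {e ν : M → EuclideanSpace ℝ (Fin (n + 1))}
    (hF : ContDiff ℝ 2 F) (he : ContMDiff (𝓡 n) 𝓘(ℝ, EuclideanSpace ℝ (Fin (n + 1))) ∞ e)
    (hK : IsCompact {x | F x ≤ 0}) (hreg : ∀ x, F x = 0 → fderiv ℝ F x ≠ 0)
    (hrange : Set.range e = {x | F x = 0})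
    (hν : ∀ m, ν m = ‖gradient F (e m)‖⁻¹ • gradient F (e m)) {p : EuclideanSpace ℝ (Fin (n + 1))}
    (hp : F p < 0) :
    ∃ m : M, (∀ m', ‖e m' - p‖ ≤ ‖e m - p‖) ∧ ∀ v : TangentSpace (𝓡 n) m,
      ‖e m - p‖⁻¹ * ‖mvfderiv (𝓡 n) e m v‖ ^ 2 ≤
        ⟪mvfderiv (𝓡 n) ν m v, mvfderiv (𝓡 n) e m v⟫_ℝ := by
  haveI : Nontrivial (EuclideanSpace ℝ (Fin (n + 1))) :=
    Module.nontrivial_of_finrank_pos (R := ℝ) (by rw [finrank_euclideanSpace_fin]; omega)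
  have hF1 : Differentiable ℝ F := hF.differentiable (by simp)
  have hFe : ∀ m, F (e m) = 0 := fun m => by
    have : e m ∈ Set.range e := ⟨m, rfl⟩
    rw [hrange] at this
    exact this
  obtain ⟨x₀, hx₀, hx₀p, hfar, hcurv⟩ := exists_farthest_forall_le_iteratedFDeriv_two hF hK hp hreg
  have hx₀' : x₀ ∈ Set.range e := by rw [hrange]; exact hx₀
  obtain ⟨m, rfl⟩ := hx₀'
  refine ⟨m, fun m' => hfar _ (hFe m').le, fun v => ?_⟩
  have hdF : fderiv ℝ F (e m) ≠ 0 := hreg _ hx₀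
  have htan : fderiv ℝ F (e m) (mvfderiv (𝓡 n) e m v) = 0 :=
    fderiv_apply_mfderiv_eq_zero_of_comp_eq_zero hF1 he hFe m v
  rw [inner_mvfderiv_unitNormal_mvfderiv hF he hFe hν hdF]
  have hgrad : ‖gradient F (e m)‖ = ‖fderiv ℝ F (e m)‖ := by
    rw [gradient, LinearIsometryEquiv.norm_map]
  have hgpos : 0 < ‖fderiv ℝ F (e m)‖ := norm_pos_iff.2 hdF
  have h := hcurv _ htan
  rw [hgrad, ← div_le_iff₀' (inv_pos.2 hgpos), div_inv_eq_mul]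
  calc ‖e m - p‖⁻¹ * ‖mvfderiv (𝓡 n) e m v‖ ^ 2 * ‖fderiv ℝ F (e m)‖
      = ‖fderiv ℝ F (e m)‖ / ‖e m - p‖ * ‖mvfderiv (𝓡 n) e m v‖ ^ 2 := by
        rw [div_eq_mul_inv]; ring
    _ ≤ _ := h

end FarthestPointManifold

/-! ### Huisken–Sinestrari, Prop. 2.7 (i), (ii) and Remark 2.4 (ii): the pointwise algebra of
two-convex principal curvatures (pp. 143–145, (2.2)–(2.4))

Sort-free rendering: the principal curvatures at a point are any family `lam : Fin n → ℝ`
(no ordering); "`λ₁ + λ₂ ≥ c`" (the two smallest) is "`lam i + lam j ≥ c` for all `i ≠ j`";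
`H = Σᵢ lam i` and `|A|² = Σᵢ (lam i)²`. -/

section PrincipalCurvatureAlgebra

variable {n : ℕ}

/-- Among `n ≥ 3` indices there is one different from two given ones: Mathlib's
`Fin.exists_ne_and_ne_of_two_lt`; deprecated restatement (dedup-01134, 2026-08-16). [folklore] -/
@[deprecated Fin.exists_ne_and_ne_of_two_lt (since := "2026-08-16")]
theorem exists_ne_ne_of_three_le (hn : 3 ≤ n) (a b : Fin n) : ∃ c : Fin n, c ≠ a ∧ c ≠ b :=
  Fin.exists_ne_and_ne_of_two_lt a b hn

/-- A sum dominates three of its (distinct) terms when the others are nonnegative. [folklore] -/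
theorem add_add_le_sum_of_nonneg {f : Fin n → ℝ} {a b c : Fin n} (hab : a ≠ b) (hac : a ≠ c)
    (hbc : b ≠ c) (h : ∀ j, j ≠ a → j ≠ b → j ≠ c → 0 ≤ f j) :
    f a + f b + f c ≤ ∑ j, f j := by
  have key := Finset.sum_le_sum_of_subset_of_nonneg (f := f)
    (Finset.subset_univ ({a, b, c} : Finset (Fin n)))
    (fun j _ hj => h j (fun e => hj (by simp [e])) (fun e => hj (by simp [e]))
      (fun e => hj (by simp [e])))
  rw [Finset.sum_insert (by simp [hab, hac]), Finset.sum_pair hbc] at key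
  linarith

/-- **Two-convexity leaves at most one negative principal curvature**: if `lam m < 0` then
`lam j > 0` for all `j ≠ m`. [cite: HuiskenSinestrari2008, proof of Prop. 2.7 (i), p. 144] -/
theorem pos_of_twoConvex_of_neg {lam : Fin n → ℝ} (h2 : ∀ i j, i ≠ j → 0 ≤ lam i + lam j)
    {m j : Fin n} (hm : lam m < 0) (hj : j ≠ m) : 0 < lam j := by
  have := h2 j m hj
  linarith

/-- **Huisken–Sinestrari (2.2)** (Prop. 2.7 (i), proof, p. 144): on a two-convex hypersurface of
dimension `n ≥ 3`, `-H ≤ λᵢ ≤ H` for every principal curvature (`H = λ₁ + ⋯ + λₙ`); printed: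
"`-λ₁ = λ₁ - 2λ₁ ≤ λ₁ + 2λ₂ ≤ λ₁ + λ₂ + λ₃ ≤ H` and also `λₙ ≤ λ₁ + λ₂ + λₙ ≤ H`".
[cite: HuiskenSinestrari2008, Prop. 2.7 (i), (2.2)] -/
theorem abs_le_sum_of_twoConvex (hn : 3 ≤ n) {lam : Fin n → ℝ}
    (h2 : ∀ i j, i ≠ j → 0 ≤ lam i + lam j) (i : Fin n) : |lam i| ≤ ∑ j, lam j := by
  rw [abs_le]
  by_cases hall : ∀ j, 0 ≤ lam j
  · constructor
    · linarith [Finset.sum_nonneg fun j (_ : j ∈ Finset.univ) => hall j, hall i]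
    · exact Finset.single_le_sum (fun j _ => hall j) (Finset.mem_univ i)
  push Not at hall
  obtain ⟨m, hm⟩ := hall
  have hpos : ∀ j, j ≠ m → 0 < lam j := fun j hj => pos_of_twoConvex_of_neg h2 hm hj
  by_cases him : i = m
  · subst him
    obtain ⟨k₁, hk₁⟩ : ∃ k₁ : Fin n, k₁ ≠ i := by
      haveI : Nontrivial (Fin n) := Fin.nontrivial_iff_two_le.2 (by omega)
      exact exists_ne i
    obtain ⟨k₂, hk₂i, hk₂k₁⟩ := Fin.exists_ne_and_ne_of_two_lt i k₁ hn
    have hsum := add_add_le_sum_of_nonneg (f := lam) hk₁.symm hk₂i.symm hk₂k₁.symm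
      fun j hj _ _ => (hpos j hj).le
    have := h2 i k₁ hk₁.symm
    have := h2 i k₂ hk₂i.symm
    constructor <;> nlinarith [hpos k₁ hk₁, hpos k₂ hk₂i]
  · obtain ⟨k, hki, hkm⟩ := Fin.exists_ne_and_ne_of_two_lt i m hn
    have hsum := add_add_le_sum_of_nonneg (f := lam) him (Ne.symm hki) (Ne.symm hkm)
      fun j _ hj _ => (hpos j hj).le
    have := h2 m k (Ne.symm hkm)
    constructor <;> nlinarith [hpos i him, hpos k hkm]

/-- In particular `H ≥ 0` on a two-convex hypersurface of dimension `n ≥ 3`.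
[cite: HuiskenSinestrari2008, Prop. 2.7 (i), (2.2)] -/
theorem sum_nonneg_of_twoConvex (hn : 3 ≤ n) {lam : Fin n → ℝ}
    (h2 : ∀ i j, i ≠ j → 0 ≤ lam i + lam j) : 0 ≤ ∑ j, lam j :=
  (abs_nonneg _).trans (abs_le_sum_of_twoConvex hn h2 ⟨0, by omega⟩)

/-- **Huisken–Sinestrari (2.3)** (Prop. 2.7 (i)): `|A|² ≤ n (max |λᵢ|)² ≤ n H²` on a two-convex
hypersurface of dimension `n ≥ 3`. [cite: HuiskenSinestrari2008, Prop. 2.7 (i), (2.3)] -/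
theorem sum_sq_le_of_twoConvex (hn : 3 ≤ n) {lam : Fin n → ℝ}
    (h2 : ∀ i j, i ≠ j → 0 ≤ lam i + lam j) :
    ∑ j, lam j ^ 2 ≤ n * (∑ j, lam j) ^ 2 := by
  have h : ∀ i, lam i ^ 2 ≤ (∑ j, lam j) ^ 2 := fun i =>
    sq_le_sq' (abs_le.1 (abs_le_sum_of_twoConvex hn h2 i)).1
      (abs_le.1 (abs_le_sum_of_twoConvex hn h2 i)).2
  calc ∑ j, lam j ^ 2 ≤ ∑ _j : Fin n, (∑ j, lam j) ^ 2 := Finset.sum_le_sum fun i _ => h i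
    _ = n * (∑ j, lam j) ^ 2 := by
      rw [Finset.sum_const, Finset.card_univ, Fintype.card_fin, nsmul_eq_mul]

/-- **Prop. 2.7 (i), lower bound `H²/n ≤ |A|²`** — Cauchy–Schwarz, valid for any hypersurface
(Mathlib's `sq_sum_le_card_mul_sum_sq`). [cite: HuiskenSinestrari2008, Prop. 2.7 (i)] -/
theorem sq_sum_le_mul_sum_sq (lam : Fin n → ℝ) : (∑ j, lam j) ^ 2 ≤ n * ∑ j, lam j ^ 2 := by
  have h := sq_sum_le_card_mul_sum_sq (s := Finset.univ) (f := lam)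
  rwa [Finset.card_univ, Fintype.card_fin] at h

/-- **Huisken–Sinestrari (2.4)** (Prop. 2.7 (ii), p. 145): `λ₁ + λ₂ ≥ α₀ H` implies
`λᵢ ≥ (λ₁ + λ₂)/2 ≥ α₀ H/2` for `i = 2, …, n` — sort-free: for every index `i` dominating some
other index `j`. [cite: HuiskenSinestrari2008, Prop. 2.7 (ii), (2.4)] -/
theorem le_of_uniformlyTwoConvex {lam : Fin n → ℝ} {α₀ H : ℝ}
    (h2 : ∀ i j, i ≠ j → α₀ * H ≤ lam i + lam j) {i j : Fin n} (hij : i ≠ j)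
    (hle : lam j ≤ lam i) : α₀ * H / 2 ≤ lam i := by
  have := h2 i j hij
  linarith

/-- **Huisken–Sinestrari, Remark 2.4 (ii)** (p. 143): "any surface with `λ₁ + λ₂ ≥ H/(n - 1)` is
convex: … keeping into account that `H ≥ λ₁ + (n - 1)λ₂`, we find that `λ₁ ≥ λ₁/(n - 1)`, which
implies that `λ₁ ≥ 0`" — for `n ≥ 3` principal curvatures, sort-free.
[cite: HuiskenSinestrari2008, Remark 2.4 (ii)] -/
theorem nonneg_of_twoConvex_ge_sum_div (hn : 3 ≤ n) {lam : Fin n → ℝ}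
    (h : ∀ i j, i ≠ j → (∑ k, lam k) / (n - 1) ≤ lam i + lam j) (i : Fin n) : 0 ≤ lam i := by
  by_contra hi
  rw [not_le] at hi
  set T : Finset (Fin n) := Finset.univ.erase i with hT
  have hTne : T.Nonempty := by
    obtain ⟨k, hk⟩ : ∃ k : Fin n, k ≠ i := by
      haveI : Nontrivial (Fin n) := Fin.nontrivial_iff_two_le.2 (by omega)
      exact exists_ne i
    exact ⟨k, Finset.mem_erase.2 ⟨hk, Finset.mem_univ k⟩⟩
  obtain ⟨j₀, hj₀T, hj₀min⟩ := Finset.exists_min_image T lam hTne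
  have hj₀i : j₀ ≠ i := (Finset.mem_erase.1 hj₀T).1
  have hcardT : T.card = n - 1 := by
    rw [hT, Finset.card_erase_of_mem (Finset.mem_univ i), Finset.card_univ, Fintype.card_fin]
  have hsumT : ((n : ℝ) - 1) * lam j₀ ≤ ∑ k ∈ T, lam k := by
    have h1 := Finset.card_nsmul_le_sum T lam (lam j₀) fun k hk => hj₀min k hk
    rw [hcardT, nsmul_eq_mul, Nat.cast_sub (by omega : 1 ≤ n), Nat.cast_one] at h1
    exact h1
  have hsum : ∑ k, lam k = lam i + ∑ k ∈ T, lam k := by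
    rw [hT, Finset.add_sum_erase _ _ (Finset.mem_univ i)]
  have h1 := h i j₀ hj₀i.symm
  have h3 : (3 : ℝ) ≤ n := by exact_mod_cast hn
  rw [hsum, div_le_iff₀ (by linarith)] at h1
  nlinarith

end PrincipalCurvatureAlgebra

/-! ### Two-convex ⇒ weakly `k`-convex (`k ≥ 2`), in the fact's frame-trace idiom -/

section WeakMonotone

variable {E : Type*} [NormedAddCommGroup E] [InnerProductSpace ℝ E]

/-- **Weak `k`-convexity of a level set is monotone in `k`** (`k ≥ 1`): if
`Σᵢ D²F(x)[vᵢ, vᵢ] ≥ 0` for every orthonormal `k`-frame in `ker dF(x)`, then the same holds for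
every orthonormal `(k+1)`-frame — average over the `k + 1` sub-frames (the weak form of the
tree's `IsKConvexLevelSetAt.succ`; the trace form of `λ₁ + ⋯ + λ_k ≥ 0 ⇒ λ₁ + ⋯ + λ_{k+1} ≥ 0`).
[folklore] -/
theorem weakKConvex_succ {k : ℕ} (hk : 1 ≤ k) {F : E → ℝ} {x : E}
    (h : ∀ v : Fin k → E, Orthonormal ℝ v → (∀ i, fderiv ℝ F x (v i) = 0) →
      0 ≤ ∑ i, iteratedFDeriv ℝ 2 F x ![v i, v i])
    (v : Fin (k + 1) → E) (hv : Orthonormal ℝ v) (hker : ∀ i, fderiv ℝ F x (v i) = 0) :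
    0 ≤ ∑ i, iteratedFDeriv ℝ 2 F x ![v i, v i] := by
  set Q : Fin (k + 1) → ℝ := fun l => iteratedFDeriv ℝ 2 F x ![v l, v l] with hQ
  have hsub : ∀ j : Fin (k + 1), 0 ≤ (∑ l, Q l) - Q j := by
    intro j
    have horth : Orthonormal ℝ (v ∘ j.succAbove) := hv.comp _ Fin.succAbove_right_injective
    have hpos := h (v ∘ j.succAbove) horth fun i => hker _
    have hsplit : ∑ l, Q l = Q j + ∑ i, Q (j.succAbove i) := Fin.sum_univ_succAbove Q j
    simp only [Function.comp_apply] at hpos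
    linarith
  have hsum : 0 ≤ ∑ j : Fin (k + 1), ((∑ l, Q l) - Q j) := Finset.sum_nonneg fun j _ => hsub j
  have hcalc : ∑ j : Fin (k + 1), ((∑ l, Q l) - Q j) = k * ∑ l, Q l := by
    rw [Finset.sum_sub_distrib, Finset.sum_const, Finset.card_univ, Fintype.card_fin]
    simp only [nsmul_eq_mul, Nat.cast_add, Nat.cast_one]
    ring
  rw [hcalc] at hsum
  have hk' : (0 : ℝ) < k := by exact_mod_cast hk
  exact (mul_nonneg_iff_of_pos_left hk').1 hsum

/-- **Monotonicity in `k`** of weak `k`-convexity, `1 ≤ k ≤ l`. [folklore] -/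
theorem weakKConvex_mono {k l : ℕ} (hk : 1 ≤ k) (hkl : k ≤ l) {F : E → ℝ} {x : E}
    (h : ∀ v : Fin k → E, Orthonormal ℝ v → (∀ i, fderiv ℝ F x (v i) = 0) →
      0 ≤ ∑ i, iteratedFDeriv ℝ 2 F x ![v i, v i])
    (v : Fin l → E) (hv : Orthonormal ℝ v) (hker : ∀ i, fderiv ℝ F x (v i) = 0) :
    0 ≤ ∑ i, iteratedFDeriv ℝ 2 F x ![v i, v i] := by
  induction l, hkl using Nat.le_induction with
  | base => exact h v hv hker
  | succ l hkl ih =>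
    exact weakKConvex_succ (hk.trans hkl) (fun w hw hw0 => ih w hw hw0) v hv hker

/-- **Two-convex ⇒ weakly `k`-convex for every `k ≥ 2`, in particular mean-convex** (trace
form of Huisken–Sinestrari (2.2): `λ₁ + λ₂ ≥ 0 ⇒ λ₁ + ⋯ + λ_k ≥ 0`, `H ≥ 0`): the two-convexity
clause of `HuiskenSinestrari2009_twoConvex_simplyConnected` at a point implies
`Σᵢ D²F(x)[vᵢ, vᵢ] ≥ 0` for every orthonormal `k`-frame `v` in `ker dF(x)`, `k ≥ 2`.
[cite: HuiskenSinestrari2008, Prop. 2.7 (i), (2.2)] -/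
theorem twoConvexClause_weakKConvex {F : E → ℝ} {x : E}
    (h2 : ∀ v : Fin 2 → E, Orthonormal ℝ v → (∀ i, fderiv ℝ F x (v i) = 0) →
      0 ≤ ∑ i, iteratedFDeriv ℝ 2 F x ![v i, v i])
    {k : ℕ} (hk : 2 ≤ k) (v : Fin k → E) (hv : Orthonormal ℝ v)
    (hker : ∀ i, fderiv ℝ F x (v i) = 0) : 0 ≤ ∑ i, iteratedFDeriv ℝ 2 F x ![v i, v i] :=
  weakKConvex_mono (by norm_num) hk h2 v hv hker

end WeakMonotone

/-! ### Huisken–Sinestrari, Prop. 2.7 (iii): the gradient inequality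
`|H ∇ᵢh_kl - ∇ᵢH h_kl|² ≥ (α₀²/8) H² |∇H|²` from `λ₁ + λ₂ ≥ α₀ H` (p. 144–145)

Pointwise algebra in an orthonormal eigenframe of the Weingarten map at the point
(`h_kl = λ_k δ_kl`), with `T_ikl = ∇ᵢh_kl` totally symmetric (symmetry of `h` and the Codazzi
equations) and `∇ᵢH = Σ_k T_ikk`. -/

section GradientInequality

open Finset

variable {n : ℕ}

/-- A sum dominates two of its (distinct) terms when the others are nonnegative. [folklore] -/
theorem add_le_sum_of_nonneg {f : Fin n → ℝ} {a b : Fin n} (hab : a ≠ b)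
    (h : ∀ j, j ≠ a → j ≠ b → 0 ≤ f j) : f a + f b ≤ ∑ j, f j := by
  have key := Finset.sum_le_sum_of_subset_of_nonneg (f := f)
    (Finset.subset_univ ({a, b} : Finset (Fin n)))
    (fun j _ hj => h j (fun e => hj (by simp [e])) (fun e => hj (by simp [e])))
  rw [Finset.sum_pair hab] at key
  exact key

/-- **Bookkeeping of index triples**: for nonnegative `g`, the full triple sum dominates the sum
over the triples `(i, k, k)`, `(i, k, i)` and `(i, i, k)` (`k ≠ i`), which are pairwise
distinct. [folklore] -/
theorem sum_diag_add_sum_offDiag_le_sum₃ (g : Fin n → Fin n → Fin n → ℝ)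
    (hg : ∀ i k l, 0 ≤ g i k l) :
    ∑ i, ∑ k, g i k k + ∑ i, ∑ k ∈ univ.erase i, (g i k i + g i i k) ≤
      ∑ i, ∑ k, ∑ l, g i k l := by
  have key : ∀ i, (∑ k, g i k k + ∑ k ∈ univ.erase i, (g i k i + g i i k)) ≤ ∑ k, ∑ l, g i k l := by
    intro i
    -- split `k = i` off the outer sum
    rw [← Finset.add_sum_erase _ (fun k => ∑ l, g i k l) (mem_univ i),
      ← Finset.add_sum_erase _ (fun k => g i k k) (mem_univ i), Finset.sum_add_distrib]
    -- `Σ_l g i i l = g i i i + Σ_{l ≠ i} g i i l`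
    rw [← Finset.add_sum_erase _ (fun l => g i i l) (mem_univ i)]
    -- for `k ≠ i`: `g i k k + g i k i ≤ Σ_l g i k l`
    have h2 : ∑ k ∈ univ.erase i, g i k k + ∑ k ∈ univ.erase i, g i k i ≤
        ∑ k ∈ univ.erase i, ∑ l, g i k l := by
      rw [← Finset.sum_add_distrib]
      refine Finset.sum_le_sum fun k hk => ?_
      have hki : k ≠ i := (mem_erase.1 hk).1
      exact add_le_sum_of_nonneg hki fun j _ _ => hg i k j
    linarith
  have := Finset.sum_le_sum fun i (_ : i ∈ (univ : Finset (Fin n))) => key i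
  rwa [Finset.sum_add_distrib] at this

/-- Swapping the order of a double sum over ordered pairs of distinct indices. [folklore] -/
theorem sum_erase_comm (f : Fin n → Fin n → ℝ) :
    ∑ i, ∑ k ∈ univ.erase i, f i k = ∑ k, ∑ i ∈ univ.erase k, f i k := by
  have h1 : ∀ i, ∑ k ∈ univ.erase i, f i k = ∑ k, f i k - f i i := fun i => by
    rw [← Finset.add_sum_erase _ (fun k => f i k) (mem_univ i)]; ring
  have h2 : ∀ k, ∑ i ∈ univ.erase k, f i k = ∑ i, f i k - f k k := fun k => by
    rw [← Finset.add_sum_erase _ (fun i => f i k) (mem_univ k)]; ring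
  simp_rw [h1, h2, Finset.sum_sub_distrib]
  rw [Finset.sum_comm]

/-- **At most one principal curvature lies below `α₀H/2`** under `λᵢ + λⱼ ≥ α₀ H` (`i ≠ j`),
hence `Σ_{k ≠ l} λ_k² ≥ (n - 2) (α₀ H/2)²` for every `l` when `α₀ H ≥ 0` (Huisken–Sinestrari
(2.4): `λᵢ ≥ α₀H/2`, `i ≥ 2`). [cite: HuiskenSinestrari2008, Prop. 2.7 (ii)–(iii), (2.4)] -/
theorem sum_erase_sq_ge {lam : Fin n → ℝ} {c : ℝ} (hc : 0 ≤ c)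
    (h2 : ∀ i j, i ≠ j → 2 * c ≤ lam i + lam j) (l : Fin n) :
    ((n : ℝ) - 2) * c ^ 2 ≤ ∑ k ∈ univ.erase l, lam k ^ 2 := by
  classical
  set G : Finset (Fin n) := (univ.erase l).filter fun k => c ≤ lam k with hG
  set B : Finset (Fin n) := (univ.erase l).filter fun k => ¬ c ≤ lam k with hB
  have hBcard : B.card ≤ 1 := by
    refine Finset.card_le_one.2 fun i hi j hj => ?_
    by_contra hij
    have hi' := (mem_filter.1 hi).2
    have hj' := (mem_filter.1 hj).2
    have := h2 i j hij
    push Not at hi' hj'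
    linarith
  have hcard : G.card + B.card = n - 1 := by
    rw [hG, hB, Finset.card_filter_add_card_filter_not,
      Finset.card_erase_of_mem (mem_univ l), card_univ, Fintype.card_fin]
  have hGsub : G ⊆ univ.erase l := filter_subset _ _
  have h1 : ∑ k ∈ G, lam k ^ 2 ≤ ∑ k ∈ univ.erase l, lam k ^ 2 :=
    Finset.sum_le_sum_of_subset_of_nonneg hGsub fun k _ _ => sq_nonneg _
  have h3 : G.card • c ^ 2 ≤ ∑ k ∈ G, lam k ^ 2 :=
    Finset.card_nsmul_le_sum G _ _ fun k hk => by
      have hk' : c ≤ lam k := (mem_filter.1 hk).2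
      exact pow_le_pow_left₀ hc hk' 2
  rw [nsmul_eq_mul] at h3
  have hGcard : (n : ℝ) - 2 ≤ G.card := by
    have : n ≤ G.card + 2 := by omega
    have h' : (n : ℝ) ≤ (G.card : ℝ) + 2 := by exact_mod_cast this
    linarith
  calc ((n : ℝ) - 2) * c ^ 2 ≤ (G.card : ℝ) * c ^ 2 :=
        mul_le_mul_of_nonneg_right hGcard (sq_nonneg _)
    _ ≤ ∑ k ∈ G, lam k ^ 2 := h3
    _ ≤ _ := h1

/-- **Huisken–Sinestrari, Prop. 2.7 (iii)** (p. 144–145). In an orthonormal eigenframe of the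
Weingarten map at a point of an `n`-dimensional hypersurface, `n ≥ 3` (`h_kl = λ_k δ_kl`,
`H = Σ λ_k`), let `T_ikl = ∇ᵢh_kl` (totally symmetric by the Codazzi equations) and
`∇ᵢH = Σ_k T_ikk`. If `λᵢ + λⱼ ≥ α₀ H` for `i ≠ j` (uniform two-convexity) with `α₀ ≥ 0`, `H ≥ 0`,
then "`|H∇ᵢh_kl - ∇ᵢH h_kl|² ≥ (α₀²/8) H² |∇H|²`". Printed proof: by the proof of Lemma 3.2 in
[18], `|H∇ᵢh_kl - ∇ᵢH h_kl|² ≥ ½ Σ_{i<n} λᵢ² |∇H|²`, and `Σ_{2 ≤ i < n} λᵢ² ≥ (n-2) α₀² H²/4` by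
(2.4). Proof here: keep, of `Σ_{ikl}`, the triples `(l,k,k)`, `(k,k,l)`, `(k,l,k)`; for
`k ≠ l`, `(H a - E λ)² + 2H²a² ≥ (2/3) E² λ²` (`a = T_lkk`, `E = ∇_l H`), and at most one `λ_k`
lies below `α₀H/2`. [cite: HuiskenSinestrari2008, Prop. 2.7 (iii)] -/
theorem HuiskenSinestrari_gradient_inequality (hn : 3 ≤ n) {lam : Fin n → ℝ}
    {T : Fin n → Fin n → Fin n → ℝ} (hT₁ : ∀ i k l, T i k l = T k i l)
    (hT₂ : ∀ i k l, T i k l = T i l k) {α₀ : ℝ} (hα₀ : 0 ≤ α₀) (hH : 0 ≤ ∑ j, lam j)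
    (h2 : ∀ i j, i ≠ j → α₀ * ∑ j, lam j ≤ lam i + lam j) :
    α₀ ^ 2 / 8 * (∑ j, lam j) ^ 2 * ∑ i, (∑ k, T i k k) ^ 2 ≤
      ∑ i, ∑ k, ∑ l,
        ((∑ j, lam j) * T i k l - (∑ m, T i m m) * (if k = l then lam k else 0)) ^ 2 := by
  set H : ℝ := ∑ j, lam j with hHdef
  set E : Fin n → ℝ := fun i => ∑ m, T i m m with hE
  set g : Fin n → Fin n → Fin n → ℝ :=
    fun i k l => (H * T i k l - E i * (if k = l then lam k else 0)) ^ 2 with hg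
  have hg0 : ∀ i k l, 0 ≤ g i k l := fun i k l => sq_nonneg _
  -- (1) keep the triples `(i,k,k)`, `(i,k,i)`, `(i,i,k)`
  have step1 := sum_diag_add_sum_offDiag_le_sum₃ g hg0
  have hdiag : ∀ i k, g i k k = (H * T i k k - E i * lam k) ^ 2 := fun i k => by
    simp [hg]
  have hoff : ∀ i, ∀ k ∈ univ.erase i, g i k i + g i i k = 2 * H ^ 2 * T k i i ^ 2 := by
    intro i k hk
    have hki : k ≠ i := (mem_erase.1 hk).1
    have e1 : T i k i = T k i i := hT₁ i k i
    have e2 : T i i k = T k i i := by rw [hT₂ i i k, hT₁ i k i]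
    simp only [hg, if_neg hki, if_neg (Ne.symm hki), mul_zero, sub_zero, e1, e2]
    ring
  have step1' : ∑ i, ∑ k, (H * T i k k - E i * lam k) ^ 2 +
      ∑ l, ∑ k ∈ univ.erase l, 2 * H ^ 2 * T l k k ^ 2 ≤ ∑ i, ∑ k, ∑ l, g i k l := by
    have hA : ∑ i, ∑ k, g i k k = ∑ i, ∑ k, (H * T i k k - E i * lam k) ^ 2 :=
      Finset.sum_congr rfl fun i _ => Finset.sum_congr rfl fun k _ => hdiag i k
    have hB : ∑ i, ∑ k ∈ univ.erase i, (g i k i + g i i k) =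
        ∑ l, ∑ k ∈ univ.erase l, 2 * H ^ 2 * T l k k ^ 2 := by
      rw [show (∑ i, ∑ k ∈ univ.erase i, (g i k i + g i i k)) =
          ∑ i, ∑ k ∈ univ.erase i, 2 * H ^ 2 * T k i i ^ 2 from
        Finset.sum_congr rfl fun i _ => Finset.sum_congr rfl fun k hk => hoff i k hk]
      exact sum_erase_comm (fun i k => 2 * H ^ 2 * T k i i ^ 2)
    rw [← hA, ← hB]
    exact step1
  -- (2) per `l`: `Σ_{k ≠ l} [(H a_k - E_l λ_k)² + 2H² a_k²] ≥ (2/3) E_l² Σ_{k ≠ l} λ_k²`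
  have step2 : ∀ l, 2 / 3 * E l ^ 2 * ∑ k ∈ univ.erase l, lam k ^ 2 ≤
      ∑ k, (H * T l k k - E l * lam k) ^ 2 + ∑ k ∈ univ.erase l, 2 * H ^ 2 * T l k k ^ 2 := by
    intro l
    have hdrop : ∑ k ∈ univ.erase l, (H * T l k k - E l * lam k) ^ 2 ≤
        ∑ k, (H * T l k k - E l * lam k) ^ 2 :=
      Finset.sum_le_sum_of_subset_of_nonneg (erase_subset _ _) fun k _ _ => sq_nonneg _
    have hterm : ∀ k, 2 / 3 * E l ^ 2 * lam k ^ 2 ≤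
        (H * T l k k - E l * lam k) ^ 2 + 2 * H ^ 2 * T l k k ^ 2 := fun k => by
      nlinarith [sq_nonneg (3 * H * T l k k - E l * lam k)]
    have hsum := Finset.sum_le_sum fun k (_ : k ∈ univ.erase l) => hterm k
    rw [← Finset.mul_sum, Finset.sum_add_distrib] at hsum
    linarith
  -- (3) `Σ_{k ≠ l} λ_k² ≥ (n-2) (α₀H/2)²`
  have step3 : ∀ l, ((n : ℝ) - 2) * (α₀ * H / 2) ^ 2 ≤ ∑ k ∈ univ.erase l, lam k ^ 2 :=
    fun l => sum_erase_sq_ge (c := α₀ * H / 2) (by positivity)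
      (fun i j hij => by have := h2 i j hij; linarith) l
  -- (4) combine
  have hn' : (3 : ℝ) ≤ n := by exact_mod_cast hn
  calc α₀ ^ 2 / 8 * H ^ 2 * ∑ i, E i ^ 2
      = ∑ l, α₀ ^ 2 / 8 * H ^ 2 * E l ^ 2 := by rw [Finset.mul_sum]
    _ ≤ ∑ l, 2 / 3 * E l ^ 2 * ∑ k ∈ univ.erase l, lam k ^ 2 := by
        refine Finset.sum_le_sum fun l _ => ?_
        have h3 := step3 l
        have hE2 : 0 ≤ E l ^ 2 := sq_nonneg _
        have : α₀ ^ 2 / 8 * H ^ 2 ≤ 2 / 3 * (((n : ℝ) - 2) * (α₀ * H / 2) ^ 2) := by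
          nlinarith [sq_nonneg (α₀ * H)]
        calc α₀ ^ 2 / 8 * H ^ 2 * E l ^ 2 ≤ 2 / 3 * (((n : ℝ) - 2) * (α₀ * H / 2) ^ 2) * E l ^ 2 :=
              mul_le_mul_of_nonneg_right this hE2
          _ ≤ 2 / 3 * (∑ k ∈ univ.erase l, lam k ^ 2) * E l ^ 2 := by
              refine mul_le_mul_of_nonneg_right ?_ hE2
              exact mul_le_mul_of_nonneg_left h3 (by norm_num)
          _ = 2 / 3 * E l ^ 2 * ∑ k ∈ univ.erase l, lam k ^ 2 := by ring
    _ ≤ ∑ l, (∑ k, (H * T l k k - E l * lam k) ^ 2 +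
          ∑ k ∈ univ.erase l, 2 * H ^ 2 * T l k k ^ 2) := Finset.sum_le_sum fun l _ => step2 l
    _ = ∑ i, ∑ k, (H * T i k k - E i * lam k) ^ 2 +
          ∑ l, ∑ k ∈ univ.erase l, 2 * H ^ 2 * T l k k ^ 2 := Finset.sum_add_distrib
    _ ≤ ∑ i, ∑ k, ∑ l, g i k l := step1'

end GradientInequality

/-! ### Huisken–Sinestrari, Lemma 2.3: `S₁, …, S_{n-1} > 0 ⇒ λ₁ + λ₂ > 0` (p. 142)

Elementary symmetric functions `S_k` of the principal curvatures are Mathlib's `Multiset.esymm` of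
the multiset of values `{lam i}` (`= ∑_{#t = k} ∏_{i ∈ t} lam i`, `Finset.esymm_map_val`). -/

section ElementarySymmetric

/-- `S₀(s) = 1`. [folklore] -/
theorem esymm_zero_eq_one (s : Multiset ℝ) : s.esymm 0 = 1 := by
  simp [Multiset.esymm, Multiset.powersetCard_zero_left]

/-- `S_{k+1}(a ∷ s) = S_{k+1}(s) + a S_k(s)`. [folklore] -/
theorem esymm_cons_succ (a : ℝ) (s : Multiset ℝ) (k : ℕ) :
    (a ::ₘ s).esymm (k + 1) = s.esymm (k + 1) + a * s.esymm k := by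
  simp only [Multiset.esymm, Multiset.powersetCard_cons, Multiset.map_add, Multiset.sum_add,
    Multiset.map_map, Function.comp_def, Multiset.prod_cons]
  rw [← Multiset.sum_map_mul_left]

/-- `S_{#s}(s) = ∏ s`. [folklore] -/
theorem esymm_card_eq_prod (s : Multiset ℝ) : s.esymm (Multiset.card s) = s.prod := by
  rw [Multiset.esymm, Multiset.powersetCard_self, Multiset.map_singleton, Multiset.sum_singleton]

/-- `S_k(s) = 0` for `k > #s`. [folklore] -/
theorem esymm_eq_zero_of_card_lt (s : Multiset ℝ) {k : ℕ} (h : Multiset.card s < k) :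
    s.esymm k = 0 := by
  simp [Multiset.esymm, Multiset.powersetCard_eq_empty _ h]

/-- `S_k(s) ≥ 0` when all entries of `s` are nonnegative. [folklore] -/
theorem esymm_nonneg_of_forall_nonneg (s : Multiset ℝ) (hs : ∀ a ∈ s, 0 ≤ a) (k : ℕ) :
    0 ≤ s.esymm k := by
  refine Multiset.sum_nonneg fun x hx => ?_
  obtain ⟨t, ht, rfl⟩ := Multiset.mem_map.1 hx
  exact Multiset.prod_nonneg fun a ha =>
    hs a (Multiset.mem_of_le (Multiset.mem_powersetCard.1 ht).1 ha)

/-- **Removing a negative entry preserves the positivity of all elementary symmetric functions**: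
if `a < 0` and `S_k(a ∷ s) > 0` for all `k ≤ #s`, then `S_k(s) > 0` for all `k ≤ #s` — by
induction on `k` from `S_{k+1}(a ∷ s) = S_{k+1}(s) + a S_k(s)`. [folklore] -/
theorem esymm_pos_of_cons_neg {a : ℝ} {s : Multiset ℝ} (ha : a < 0)
    (h : ∀ k, k ≤ Multiset.card s → 0 < (a ::ₘ s).esymm k) :
    ∀ k, k ≤ Multiset.card s → 0 < s.esymm k := by
  intro k
  induction k with
  | zero => intro; rw [esymm_zero_eq_one]; exact one_pos
  | succ k ih =>
    intro hk
    have h1 := h (k + 1) hk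
    rw [esymm_cons_succ] at h1
    have h2 : a * s.esymm k < 0 := mul_neg_of_neg_of_pos ha (ih (Nat.le_of_succ_le hk))
    linarith

/-- If `S_k(s) > 0` for all `k ≤ #s`, then every entry of `s` is positive (a zero entry kills
`S_{#s} = ∏ s`; a negative entry `b` can be removed by the previous lemma, making `∏ (s - b) > 0`
and `∏ s = b ∏ (s - b) < 0`). [folklore] -/
theorem forall_pos_of_esymm_pos {s : Multiset ℝ}
    (h : ∀ k, k ≤ Multiset.card s → 0 < s.esymm k) : ∀ b ∈ s, 0 < b := by
  intro b hb
  by_contra hb0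
  rw [not_lt] at hb0
  have hprod : 0 < s.prod := by rw [← esymm_card_eq_prod]; exact h _ le_rfl
  rcases hb0.lt_or_eq with hlt | heq
  · have hs : s = b ::ₘ s.erase b := (Multiset.cons_erase hb).symm
    have hcard : Multiset.card (s.erase b) + 1 = Multiset.card s :=
      Multiset.card_erase_add_one hb
    have h' : ∀ k, k ≤ Multiset.card (s.erase b) → 0 < (b ::ₘ s.erase b).esymm k :=
      fun k hk => by rw [← hs]; exact h k (by omega)
    have hpos := esymm_pos_of_cons_neg hlt h' _ le_rfl
    rw [esymm_card_eq_prod] at hpos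
    rw [hs, Multiset.prod_cons] at hprod
    nlinarith
  · rw [heq] at hb
    have := Multiset.prod_eq_zero hb
    linarith

/-- **Huisken–Sinestrari, Lemma 2.3** (p. 142): "Let `M` be a smooth `n`-dimensional hypersurface
such that `S₁ > 0, …, S_{n-1} > 0`. Then `λ₁ + λ₂ > 0`." Here `S_k` is the `k`-th elementary
symmetric polynomial of the principal curvatures `lam : Fin n → ℝ` (Mathlib's `Multiset.esymm`
of the multiset of values, `= ∑_{#t = k} ∏_{i ∈ t} lam i` by `Finset.esymm_map_val`; the tree's
`Literature.RingTheory.SymmetricFunctions.SymmPoly.esymm lam k`), and the conclusion is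
sort-free: `lam i + lam j > 0` for all `i ≠ j`. Printed proof: induction on `n` through
[19, Lemma 2.4] (`S₁, …, S_k > 0 ⇒ S_{h;i} > 0` for `h < k`); proof here: removing a *negative*
entry preserves the positivity of all `S_k` (`esymm_pos_of_cons_neg`), so all other curvatures
are positive (`forall_pos_of_esymm_pos`), and then
`0 < S_{n-1} = λⱼ ∏' + λᵢ S_{n-2}(rest) ≤ (λᵢ + λⱼ) ∏'`, `∏' = ∏_{l ≠ i, j} λ_l > 0`.
[cite: HuiskenSinestrari2008, Lemma 2.3] -/
theorem add_pos_of_esymm_pos {n : ℕ} {lam : Fin n → ℝ}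
    (hS : ∀ k, 1 ≤ k → k < n → 0 < ((Finset.univ : Finset (Fin n)).val.map lam).esymm k)
    {i j : Fin n} (hij : i ≠ j) : 0 < lam i + lam j := by
  wlog hle : lam i ≤ lam j generalizing i j
  · rw [add_comm]; exact this hij.symm (le_of_not_ge hle)
  set m := (Finset.univ : Finset (Fin n)).val.map lam with hm
  have hcard : Multiset.card m = n := by simp [hm]
  -- `m = lam i ∷ μ`, `μ = lam j ∷ μ'`
  set μ := ((Finset.univ : Finset (Fin n)).erase i).val.map lam with hμ
  set μ' := (((Finset.univ : Finset (Fin n)).erase i).erase j).val.map lam with hμ'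
  have hm_cons : m = lam i ::ₘ μ := by
    rw [hm, hμ, ← Multiset.map_cons, ← Finset.insert_val_of_notMem (Finset.notMem_erase i _),
      Finset.insert_erase (Finset.mem_univ i)]
  have hji : j ∈ (Finset.univ : Finset (Fin n)).erase i :=
    Finset.mem_erase.2 ⟨hij.symm, Finset.mem_univ j⟩
  have hμ_cons : μ = lam j ::ₘ μ' := by
    rw [hμ, hμ', ← Multiset.map_cons, ← Finset.insert_val_of_notMem (Finset.notMem_erase j _),
      Finset.insert_erase hji]
  have hcardμ : Multiset.card μ + 1 = n := by
    have h := congrArg Multiset.card hm_cons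
    rw [Multiset.card_cons, hcard] at h
    omega
  have hcardμ' : Multiset.card μ' + 1 = Multiset.card μ := by
    have h := congrArg Multiset.card hμ_cons
    rw [Multiset.card_cons] at h
    omega
  have hmemj : lam j ∈ μ := by rw [hμ_cons]; exact Multiset.mem_cons_self _ _
  have hmem' : ∀ b ∈ μ', b ∈ μ := fun b hb => by rw [hμ_cons]; exact Multiset.mem_cons_of_mem hb
  -- `S_{n-1}(m) = lam j ∏ μ' + lam i S_{#μ'}(lam j ∷ μ')`
  have key : m.esymm (n - 1) =
      lam j * μ'.esymm (Multiset.card μ') + lam i * (lam j ::ₘ μ').esymm (Multiset.card μ') := by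
    rw [hm_cons, show n - 1 = Multiset.card μ' + 1 by omega, esymm_cons_succ, hμ_cons,
      esymm_cons_succ, esymm_eq_zero_of_card_lt _ (Nat.lt_succ_self _), zero_add]
  have hSn1 := hS (n - 1) (by omega) (by omega)
  rw [key] at hSn1
  by_cases hi : 0 ≤ lam i
  · rcases hi.lt_or_eq with hpos | h0
    · linarith
    · -- `lam i = 0`; then `lam j = 0` is impossible since `S_{n-1} > 0`
      by_contra hcon
      have hj0 : lam j = 0 := le_antisymm (by linarith) (by linarith)
      rw [← h0, hj0, zero_mul, zero_mul, add_zero] at hSn1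
      exact lt_irrefl _ hSn1
  · rw [not_le] at hi
    have h1 : ∀ k, k ≤ Multiset.card μ → 0 < (lam i ::ₘ μ).esymm k := fun k hk => by
      rcases Nat.eq_zero_or_pos k with rfl | hk0
      · rw [esymm_zero_eq_one]; exact one_pos
      · rw [← hm_cons]; exact hS k hk0 (by omega)
    have hall := forall_pos_of_esymm_pos (esymm_pos_of_cons_neg hi h1)
    set P := μ'.esymm (Multiset.card μ') with hP
    have hPpos : 0 < P := by
      rw [hP, esymm_card_eq_prod]
      exact Multiset.prod_pos fun b hb => hall b (hmem' b hb)
    have hge : P ≤ (lam j ::ₘ μ').esymm (Multiset.card μ') := by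
      rcases (Multiset.card μ').eq_zero_or_pos with h0 | hpos'
      · rw [hP, h0, esymm_zero_eq_one, esymm_zero_eq_one]
      · obtain ⟨c, hc⟩ : ∃ c, Multiset.card μ' = c + 1 := ⟨_, (Nat.succ_pred_eq_of_pos hpos').symm⟩
        rw [hP, hc, esymm_cons_succ]
        have : 0 ≤ lam j * μ'.esymm c :=
          mul_nonneg (hall _ hmemj).le
            (esymm_nonneg_of_forall_nonneg μ' (fun b hb => (hall b (hmem' b hb)).le) c)
        linarith
    have h3 : lam i * (lam j ::ₘ μ').esymm (Multiset.card μ') ≤ lam i * P :=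
      mul_le_mul_of_nonpos_left hge hi.le
    have h4 : 0 < (lam i + lam j) * P := by nlinarith
    by_contra hcon
    rw [not_lt] at hcon
    nlinarith

end ElementarySymmetric

/-! ### Huisken–Sinestrari, Remark 2.4 (i) (p. 143): `λ₁ + λ₂ > 0` does not give `S₂ > 0`
(example `(-2, 3, 3)`), but gives `S_k > 0` whenever `2k ≤ n` -/

section RemarkTwoFour

/-- All `S_j(s)`, `j ≤ #s`, are positive when all entries of `s` are positive. [folklore] -/
theorem esymm_pos_of_forall_pos {s : Multiset ℝ} (hs : ∀ b ∈ s, 0 < b) :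
    ∀ {j : ℕ}, j ≤ Multiset.card s → 0 < s.esymm j := by
  induction s using Multiset.induction_on with
  | empty =>
    intro j hj
    have : j = 0 := by simpa using hj
    subst this
    rw [esymm_zero_eq_one]; exact one_pos
  | cons b s ih =>
    intro j hj
    have hb : 0 < b := hs b (Multiset.mem_cons_self _ _)
    have hs' : ∀ c ∈ s, 0 < c := fun c hc => hs c (Multiset.mem_cons_of_mem hc)
    rcases j with _ | j
    · rw [esymm_zero_eq_one]; exact one_pos
    · rw [Multiset.card_cons] at hj
      rw [esymm_cons_succ]
      have h1 : 0 ≤ s.esymm (j + 1) := esymm_nonneg_of_forall_nonneg s (fun c hc => (hs' c hc).le) _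
      have h2 : 0 < s.esymm j := ih hs' (by omega)
      nlinarith [mul_pos hb h2]

/-- **Averaging bound** `k S_k(s) ≥ a (#s + 1 - k) S_{k-1}(s)` (`k ≥ 1`) when all entries of `s`
are `≥ a ≥ 0` — the weak form of
`k S_k = Σᵢ sᵢ S_{k-1;i} ≥ a Σᵢ S_{k-1;i} = a (#s - k + 1) S_{k-1}`, proved by induction on `s`.
[folklore] -/
theorem mul_esymm_ge_of_forall_le {a : ℝ} (ha : 0 ≤ a) {s : Multiset ℝ} (hs : ∀ b ∈ s, a ≤ b) :
    ∀ k : ℕ, 1 ≤ k →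
      a * ((Multiset.card s : ℝ) + 1 - k) * s.esymm (k - 1) ≤ k * s.esymm k := by
  induction s using Multiset.induction_on with
  | empty =>
    intro k hk
    have hR : (0 : Multiset ℝ).esymm k = 0 := esymm_eq_zero_of_card_lt _ (by simp; omega)
    rw [hR, mul_zero]
    rcases Nat.exists_eq_add_of_le' hk with ⟨j, rfl⟩
    rcases j with _ | j
    · simp
    · rw [Nat.add_sub_cancel, esymm_eq_zero_of_card_lt _ (by simp)]
      simp
  | cons b s ih =>
    intro k hk
    have hb : a ≤ b := hs b (Multiset.mem_cons_self _ _)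
    have hs' : ∀ c ∈ s, a ≤ c := fun c hc => hs c (Multiset.mem_cons_of_mem hc)
    have hnn : ∀ j, 0 ≤ s.esymm j := fun j =>
      esymm_nonneg_of_forall_nonneg s (fun c hc => ha.trans (hs' c hc)) j
    rcases Nat.exists_eq_add_of_le' hk with ⟨j, rfl⟩
    rw [Multiset.card_cons, Nat.add_sub_cancel, esymm_cons_succ]
    push_cast
    rcases j with _ | j
    · -- `k = 1`: `S₁(b ∷ s) = S₁(s) + b ≥ a #s + a`
      have h1 := ih hs' 1 le_rfl
      simp only [Nat.cast_one, Nat.sub_self, esymm_zero_eq_one, mul_one, one_mul,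
        add_sub_cancel_right] at h1
      simp only [esymm_zero_eq_one]
      norm_num
      nlinarith
    · -- `k = j + 2`
      rw [esymm_cons_succ]
      have h1 := ih hs' (j + 2) (by omega)
      have h2 := ih hs' (j + 1) (by omega)
      rw [show j + 2 - 1 = j + 1 from rfl] at h1
      rw [show j + 1 - 1 = j from rfl] at h2
      push_cast at h1 h2 ⊢
      have h3 : a * s.esymm (j + 1) ≤ b * s.esymm (j + 1) :=
        mul_le_mul_of_nonneg_right hb (hnn _)
      have h4 : 0 ≤ b := ha.trans hb
      nlinarith [mul_le_mul_of_nonneg_left h2 h4, hnn j, hnn (j + 1), hnn (j + 2)]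

/-- **Strict averaging bound** `k S_k(s) > a (#s + 1 - k) S_{k-1}(s)` for `1 ≤ k ≤ #s` when all
entries of `s` are `> a ≥ 0`. [folklore] -/
theorem mul_esymm_gt_of_forall_lt {a : ℝ} (ha : 0 ≤ a) {s : Multiset ℝ} (hs : ∀ b ∈ s, a < b)
    {k : ℕ} (hk1 : 1 ≤ k) (hk : k ≤ Multiset.card s) :
    a * ((Multiset.card s : ℝ) + 1 - k) * s.esymm (k - 1) < k * s.esymm k := by
  -- `s = b ∷ s'`
  obtain ⟨b, hbmem⟩ : ∃ b, b ∈ s := Multiset.card_pos_iff_exists_mem.1 (by omega)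
  obtain ⟨s', rfl⟩ := Multiset.exists_cons_of_mem hbmem
  have hb : a < b := hs b (Multiset.mem_cons_self _ _)
  have hs' : ∀ c ∈ s', a < c := fun c hc => hs c (Multiset.mem_cons_of_mem hc)
  have hpos : ∀ {j}, j ≤ Multiset.card s' → 0 < s'.esymm j := fun hj =>
    esymm_pos_of_forall_pos (fun c hc => ha.trans_lt (hs' c hc)) hj
  have hnn : ∀ j, 0 ≤ s'.esymm j := fun j =>
    esymm_nonneg_of_forall_nonneg s' (fun c hc => (ha.trans_lt (hs' c hc)).le) j
  have ih := mul_esymm_ge_of_forall_le ha (s := s') (fun c hc => (hs' c hc).le)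
  rw [Multiset.card_cons] at hk ⊢
  rcases Nat.exists_eq_add_of_le' hk1 with ⟨j, rfl⟩
  rw [Nat.add_sub_cancel, esymm_cons_succ]
  push_cast
  rcases j with _ | j
  · have h1 := ih 1 le_rfl
    simp only [Nat.cast_one, Nat.sub_self, esymm_zero_eq_one, mul_one, one_mul,
      add_sub_cancel_right] at h1
    simp only [esymm_zero_eq_one]
    norm_num
    nlinarith
  · rw [esymm_cons_succ]
    have h1 := ih (j + 2) (by omega)
    have h2 := ih (j + 1) (by omega)
    rw [show j + 2 - 1 = j + 1 from rfl] at h1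
    rw [show j + 1 - 1 = j from rfl] at h2
    push_cast at h1 h2 ⊢
    have h3 : a * s'.esymm (j + 1) < b * s'.esymm (j + 1) :=
      mul_lt_mul_of_pos_right hb (hpos (by omega))
    have h4 : 0 ≤ b := ha.trans hb.le
    nlinarith [mul_le_mul_of_nonneg_left h2 h4, hnn j, hnn (j + 1), hnn (j + 2)]

/-- **Huisken–Sinestrari, Remark 2.4 (i), second sentence** (p. 143): "it can be checked that,
if `λ₁ + λ₂ > 0`, then all `S_k` with `2k ≤ n` are positive" — here for the elementary symmetric
functions (`Multiset.esymm` of the values) of any family `lam : Fin n → ℝ` with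
`lam i + lam j > 0` for `i ≠ j`: at most one entry is `≤ 0`, say `-a`; the others exceed `a`,
and `S_k = S_k(rest) - a S_{k-1}(rest) > 0` by the averaging bound
`k S_k(rest) > a (n - k) S_{k-1}(rest) ≥ a k S_{k-1}(rest)`.
[cite: HuiskenSinestrari2008, Remark 2.4 (i)] -/
theorem esymm_pos_of_add_pos {n : ℕ} {lam : Fin n → ℝ} (h2 : ∀ i j, i ≠ j → 0 < lam i + lam j)
    {k : ℕ} (hk1 : 1 ≤ k) (hk : 2 * k ≤ n) :
    0 < ((Finset.univ : Finset (Fin n)).val.map lam).esymm k := by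
  set m := (Finset.univ : Finset (Fin n)).val.map lam with hm
  have hcard : Multiset.card m = n := by simp [hm]
  by_cases hall : ∀ i, 0 < lam i
  · refine esymm_pos_of_forall_pos (s := m) ?_ (by omega)
    intro b hb
    obtain ⟨i, -, rfl⟩ := Multiset.mem_map.1 hb
    exact hall i
  push Not at hall
  obtain ⟨i, hi⟩ := hall
  set a : ℝ := -lam i with ha
  have ha0 : 0 ≤ a := by linarith
  set μ := ((Finset.univ : Finset (Fin n)).erase i).val.map lam with hμ
  have hm_cons : m = lam i ::ₘ μ := by
    rw [hm, hμ, ← Multiset.map_cons, ← Finset.insert_val_of_notMem (Finset.notMem_erase i _),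
      Finset.insert_erase (Finset.mem_univ i)]
  have hμgt : ∀ b ∈ μ, a < b := by
    intro b hb
    obtain ⟨j, hj, rfl⟩ := Multiset.mem_map.1 hb
    have hji : j ≠ i := (Finset.mem_erase.1 (Finset.mem_def.2 hj)).1
    have := h2 j i hji
    linarith
  have hcardμ : Multiset.card μ + 1 = n := by
    have h := congrArg Multiset.card hm_cons
    rw [Multiset.card_cons, hcard] at h
    omega
  rcases Nat.exists_eq_add_of_le' hk1 with ⟨j, rfl⟩
  rw [hm_cons, esymm_cons_succ]
  have key := mul_esymm_gt_of_forall_lt ha0 hμgt (k := j + 1) (by omega) (by omega)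
  rw [Nat.add_sub_cancel] at key
  have hcast : ((Multiset.card μ : ℕ) : ℝ) = n - 1 := by
    have : (n : ℝ) = Multiset.card μ + 1 := by exact_mod_cast hcardμ.symm
    linarith
  rw [hcast] at key
  push_cast at key
  have hnn : 0 ≤ μ.esymm j :=
    esymm_nonneg_of_forall_nonneg μ (fun b hb => (ha0.trans_lt (hμgt b hb)).le) j
  have hkn : (2 : ℝ) * (j + 1) ≤ n := by exact_mod_cast hk
  -- `(j+1) S_{j+1}(μ) > a (n - 1 - j) S_j(μ) ≥ a (j + 1) S_j(μ)`
  have h5 : a * (j + 1) * μ.esymm j ≤ a * ((n : ℝ) - 1 + 1 - (j + 1)) * μ.esymm j := by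
    apply mul_le_mul_of_nonneg_right _ hnn
    apply mul_le_mul_of_nonneg_left _ ha0
    linarith
  rw [ha] at h5 key
  nlinarith

/-- **Remark 2.4 (i), the example**: in dimension `3`, `(λ₁, λ₂, λ₃) = (-2, 3, 3)` has
`λ₁ + λ₂ > 0` (indeed all pairwise sums positive) but `S₂ = -3 < 0` (while `S₁ = 4 > 0`).
[cite: HuiskenSinestrari2008, Remark 2.4 (i)] -/
theorem esymm_two_neg_example :
    ((-2 : ℝ) ::ₘ 3 ::ₘ 3 ::ₘ 0).esymm 2 = -3 ∧ ((-2 : ℝ) ::ₘ 3 ::ₘ 3 ::ₘ 0).esymm 1 = 4 ∧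
      (0 : ℝ) < -2 + 3 ∧ (0 : ℝ) < 3 + 3 := by
  have e1 : ∀ (c : ℝ) (t : Multiset ℝ), (c ::ₘ t).esymm 1 = t.esymm 1 + c * t.esymm 0 :=
    fun c t => esymm_cons_succ c t 0
  have e2 : ∀ (c : ℝ) (t : Multiset ℝ), (c ::ₘ t).esymm 2 = t.esymm 2 + c * t.esymm 1 :=
    fun c t => esymm_cons_succ c t 1
  have h01 : (0 : Multiset ℝ).esymm 1 = 0 := esymm_eq_zero_of_card_lt _ (by simp)
  have h02 : (0 : Multiset ℝ).esymm 2 = 0 := esymm_eq_zero_of_card_lt _ (by simp)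
  refine ⟨?_, ?_, by norm_num, by norm_num⟩
  · simp only [e1, e2, h01, h02, esymm_zero_eq_one]
    norm_num
  · simp only [e1, h01, esymm_zero_eq_one]
    norm_num

end RemarkTwoFour

/-! ## Hadamard: a closed strictly convex hypersurface bounds a convex body

Huisken–Sinestrari, proof of Cor. 1.2–1.3, p. 218: "we recognise a convex closed surface which is
well known to bound a smooth convex region diffeomorphic to `B̄ⁿ⁺¹`, compare Theorem 7.14"
(Hadamard 1897). Level-set rendering for `Ω = {F ≤ 0}` compact with regular boundary `{F = 0}`:
a first-order multiplier rule at boundary extrema of functions on `Ω`, supporting half-spaces at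
every boundary point (using injectivity of the Gauss map, `exists_diffeomorph_sphere_gaussMap`),
and the nearest-point argument. -/

section Multiplier

open Filter

variable {E : Type*} [NormedAddCommGroup E] [NormedSpace ℝ E]

/-- **Inward directions enter the sublevel set**: if `F x₁ = 0` and `dF(x₁) v < 0` then
`F (x₁ + t v) < 0` for all small `t > 0`. [folklore] -/
theorem eventually_lt_zero_of_fderiv_apply_neg {F : E → ℝ} {x₁ v : E} {F' : E →L[ℝ] ℝ}
    (hx₁ : F x₁ = 0) (hF : HasFDerivAt F F' x₁) (hv : F' v < 0) :
    ∀ᶠ t in 𝓝[>] (0 : ℝ), F (x₁ + t • v) < 0 := by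
  have hψ : HasDerivAt (fun t : ℝ => F (x₁ + t • v)) (F' v) 0 := by
    have hγ : HasDerivAt (fun t : ℝ => x₁ + t • v) v 0 := by
      simpa using ((hasDerivAt_id (0 : ℝ)).smul_const v).const_add x₁
    have hF0 : HasFDerivAt F F' (x₁ + (0 : ℝ) • v) := by simpa using hF
    simpa [Function.comp_def] using hF0.comp_hasDerivAt (0 : ℝ) hγ
  have ht := hψ.tendsto_slope_zero_right
  have hev := ht.eventually_lt_const hv
  filter_upwards [hev, self_mem_nhdsWithin] with t ht1 ht2
  have ht0 : (0 : ℝ) < t := ht2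
  simp only [zero_add, zero_smul, add_zero, hx₁, sub_zero, smul_eq_mul] at ht1
  by_contra h
  rw [not_lt] at h
  have : 0 ≤ t⁻¹ * F (x₁ + t • v) := mul_nonneg (inv_nonneg.2 ht0.le) h
  linarith

/-- **Multiplier rule at a boundary minimum over a sublevel set.** If `x₁` minimises `φ` over
`{F ≤ 0}`, `F x₁ = 0`, and `dF(x₁) ≠ 0`, then `dφ(x₁) = a · dF(x₁)` with `a ≤ 0` (Karush–Kuhn–
Tucker for one inequality constraint: `dφ(x₁) ≥ 0` on the inward cone `{dF(x₁) < 0}`, hence on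
its closure, hence `dφ(x₁)` vanishes on `ker dF(x₁)`). [folklore] -/
theorem exists_fderiv_eq_smul_of_isMinOn_sublevel {F φ : E → ℝ} {x₁ : E} {F' φ' : E →L[ℝ] ℝ}
    (hmin : ∀ z, F z ≤ 0 → φ x₁ ≤ φ z) (hx₁ : F x₁ = 0) (hF : HasFDerivAt F F' x₁)
    (hφ : HasFDerivAt φ φ' x₁) (hF' : F' ≠ 0) : ∃ a : ℝ, a ≤ 0 ∧ φ' = a • F' := by
  -- `φ' ≥ 0` on strictly inward directions
  have h1 : ∀ v, F' v < 0 → 0 ≤ φ' v := by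
    intro v hv
    have hψ : HasDerivAt (fun t : ℝ => φ (x₁ + t • v)) (φ' v) 0 := by
      have hγ : HasDerivAt (fun t : ℝ => x₁ + t • v) v 0 := by
        simpa using ((hasDerivAt_id (0 : ℝ)).smul_const v).const_add x₁
      have hφ0 : HasFDerivAt φ φ' (x₁ + (0 : ℝ) • v) := by simpa using hφ
      simpa [Function.comp_def] using hφ0.comp_hasDerivAt (0 : ℝ) hγ
    refine ge_of_tendsto hψ.tendsto_slope_zero_right ?_
    filter_upwards [eventually_lt_zero_of_fderiv_apply_neg hx₁ hF hv, self_mem_nhdsWithin]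
      with t ht1 ht2
    have ht0 : (0 : ℝ) < t := ht2
    simp only [zero_add, zero_smul, add_zero, smul_eq_mul]
    exact mul_nonneg (inv_nonneg.2 ht0.le) (sub_nonneg.2 (hmin _ ht1.le))
  -- a direction `v₀` with `F' v₀ < 0`
  obtain ⟨v₀, hv₀⟩ : ∃ v₀, F' v₀ < 0 := by
    obtain ⟨u, hu⟩ := DFunLike.ne_iff.1 hF'
    rcases lt_or_gt_of_ne hu with h | h
    · exact ⟨u, h⟩
    · exact ⟨-u, by rw [map_neg]; exact neg_neg_of_pos h⟩
  -- `φ' ≥ 0` on the closed inward half-space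
  have h2 : ∀ v, F' v ≤ 0 → 0 ≤ φ' v := by
    intro v hv
    have key : ∀ ε : ℝ, 0 < ε → ε * (-φ' v₀) ≤ φ' v := by
      intro ε hε
      have := h1 (v + ε • v₀) (by rw [map_add, map_smul, smul_eq_mul]; nlinarith)
      rw [map_add, map_smul, smul_eq_mul] at this
      linarith
    have ht : Tendsto (fun ε : ℝ => ε * (-φ' v₀)) (𝓝[>] 0) (𝓝 0) := by
      have : Tendsto (fun ε : ℝ => ε * (-φ' v₀)) (𝓝 0) (𝓝 (0 * (-φ' v₀))) :=
        (continuous_id.mul continuous_const).tendsto 0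
      rw [zero_mul] at this
      exact this.mono_left nhdsWithin_le_nhds
    exact le_of_tendsto ht (by
      filter_upwards [self_mem_nhdsWithin] with ε hε using key ε hε)
  -- hence `φ'` vanishes on `ker F'` and is a nonpositive multiple of `F'`
  have h3 : ∀ v, F' v = 0 → φ' v = 0 := fun v hv =>
    le_antisymm
      (by have := h2 (-v) (by rw [map_neg, hv, neg_zero]); rwa [map_neg, neg_nonneg] at this)
      (h2 v hv.le)
  refine ⟨φ' v₀ / F' v₀, div_nonpos_of_nonneg_of_nonpos (h1 v₀ hv₀) hv₀.le, ?_⟩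
  ext v
  have hdec : v = (v - (F' v / F' v₀) • v₀) + (F' v / F' v₀) • v₀ := by abel
  have hker : F' (v - (F' v / F' v₀) • v₀) = 0 := by
    rw [map_sub, map_smul, smul_eq_mul, div_mul_cancel₀ _ hv₀.ne, sub_self]
  show φ' v = φ' v₀ / F' v₀ * F' v
  conv_lhs => rw [hdec, map_add, h3 _ hker, zero_add, map_smul, smul_eq_mul]
  field_simp

/-- A continuous function attains no maximum over `{F ≤ 0}` at a point with `F < 0` along which
it can still increase: if `x₁` maximises the continuous linear functional `ℓ` over `{F ≤ 0}`
(`F` continuous) and `ℓ ≠ 0`, then `F x₁ = 0`. [folklore] -/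
theorem eq_zero_of_isMaxOn_clm {F : E → ℝ} (hFc : Continuous F) {ℓ : E →L[ℝ] ℝ} (hℓ : ℓ ≠ 0)
    {x₁ : E} (hx₁K : F x₁ ≤ 0) (hmax : ∀ z, F z ≤ 0 → ℓ z ≤ ℓ x₁) : F x₁ = 0 := by
  rcases hx₁K.lt_or_eq with hlt | heq
  swap
  · exact heq
  exfalso
  obtain ⟨w, hw⟩ : ∃ w, 0 < ℓ w := by
    obtain ⟨u, hu⟩ := DFunLike.ne_iff.1 hℓ
    rcases lt_or_gt_of_ne hu with h | h
    · exact ⟨-u, by rw [map_neg]; exact neg_pos.2 h⟩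
    · exact ⟨u, h⟩
  have hc : Continuous fun t : ℝ => F (x₁ + t • w) :=
    hFc.comp (continuous_const.add (continuous_id.smul continuous_const))
  have h0 : F (x₁ + (0 : ℝ) • w) < 0 := by simpa using hlt
  obtain ⟨t, htK, ht0⟩ :=
    ((((hc.tendsto 0).eventually_lt_const h0).filter_mono nhdsWithin_le_nhds).and
      (self_mem_nhdsWithin (s := Ioi (0 : ℝ)))).exists
  have h1 := hmax _ htK.le
  rw [map_add, map_smul, smul_eq_mul] at h1
  have : (0 : ℝ) < t := ht0
  nlinarith [mul_pos this hw]

end Multiplier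

section Hadamard

open Filter

variable {E : Type*} [NormedAddCommGroup E] [InnerProductSpace ℝ E]

/-- **Supporting half-spaces from injectivity of the Gauss map.** Let `F` be `C¹` with
`{F ≤ 0}` compact and `dF ≠ 0` on `{F = 0}`, and suppose that two boundary points whose
differentials are positive multiples of each other coincide (the outer unit normal
`∇F/|∇F|` is injective on `{F = 0}`). Then the tangent hyperplane at every boundary point
supports `{F ≤ 0}`: `dF(x)(z - x) ≤ 0` for `F x = 0`, `F z ≤ 0` (maximise `dF(x)` over `{F ≤ 0}`:
the maximiser is a boundary point whose differential is a positive multiple of `dF(x)` by the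
multiplier rule, hence equals `x`). [folklore] -/
theorem fderiv_apply_sub_nonpos_of_gaussMap_injective {F : E → ℝ} (hF : ContDiff ℝ 1 F)
    (hK : IsCompact {x | F x ≤ 0}) (hreg : ∀ x, F x = 0 → fderiv ℝ F x ≠ 0)
    (hinj : ∀ x x', F x = 0 → F x' = 0 →
      (∃ c : ℝ, 0 < c ∧ fderiv ℝ F x = c • fderiv ℝ F x') → x = x')
    {x z : E} (hx : F x = 0) (hz : F z ≤ 0) : fderiv ℝ F x (z - x) ≤ 0 := by
  have hF1 : Differentiable ℝ F := hF.differentiable (by simp)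
  set ℓ := fderiv ℝ F x with hℓ
  have hℓ0 : ℓ ≠ 0 := hreg x hx
  obtain ⟨x₁, hx₁K, hmax⟩ := hK.exists_isMaxOn ⟨x, hx.le⟩ ℓ.continuous.continuousOn
  have hmax' : ∀ w, F w ≤ 0 → ℓ w ≤ ℓ x₁ := fun w hw => hmax hw
  have hx₁ : F x₁ = 0 := eq_zero_of_isMaxOn_clm hF.continuous hℓ0 hx₁K hmax'
  -- multiplier rule for `φ = -ℓ`
  obtain ⟨a, ha, haeq⟩ := exists_fderiv_eq_smul_of_isMinOn_sublevel (φ := fun w => -ℓ w)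
    (φ' := -ℓ) (fun w hw => neg_le_neg (hmax' w hw)) hx₁ (hF1 x₁).hasFDerivAt
    ℓ.hasFDerivAt.neg (hreg x₁ hx₁)
  have ha0 : a ≠ 0 := by
    rintro rfl
    rw [zero_smul, neg_eq_zero] at haeq
    exact hℓ0 haeq
  have hxx₁ : x = x₁ := hinj x x₁ hx hx₁ ⟨-a, by
    refine ⟨lt_of_le_of_ne (neg_nonneg.2 ha) (Ne.symm (neg_ne_zero.2 ha0)), ?_⟩
    rw [neg_smul, ← haeq, neg_neg]⟩
  subst hxx₁
  have := hmax' z hz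
  rw [map_sub]
  linarith

/-- **Nearest boundary point to an outside point.** If `F` is `C¹`, `{F ≤ 0}` is compact and
nonempty with `dF ≠ 0` on `{F = 0}`, and `F y > 0`, then some boundary point `x₁` has
`dF(x₁)(y - x₁) > 0` (the nearest point of `{F ≤ 0}` to `y`: by the multiplier rule for
`‖· - y‖²`, `y - x₁` is a positive multiple of `∇F(x₁)`). [folklore] -/
theorem exists_fderiv_apply_sub_pos_of_pos {F : E → ℝ} (hF : ContDiff ℝ 1 F)
    (hK : IsCompact {x | F x ≤ 0}) (hne : {x | F x ≤ 0}.Nonempty)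
    (hreg : ∀ x, F x = 0 → fderiv ℝ F x ≠ 0) {y : E} (hy : 0 < F y) :
    ∃ x₁, F x₁ = 0 ∧ 0 < fderiv ℝ F x₁ (y - x₁) := by
  have hF1 : Differentiable ℝ F := hF.differentiable (by simp)
  set φ : E → ℝ := fun z => ‖z - y‖ ^ 2 with hφ
  obtain ⟨x₁, hx₁K, hmin⟩ := hK.exists_isMinOn hne
    ((continuous_id.sub continuous_const).norm.pow 2).continuousOn
  have hmin' : ∀ z, F z ≤ 0 → φ x₁ ≤ φ z := fun z hz => hmin hz
  have hx₁y : x₁ ≠ y := fun h => by rw [h] at hx₁K; exact (not_le.2 hy) hx₁K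
  -- the nearest point is a boundary point
  have hx₁ : F x₁ = 0 := by
    rcases (show F x₁ ≤ 0 from hx₁K).lt_or_eq with hlt | heq
    swap
    · exact heq
    exfalso
    have hc : Continuous fun t : ℝ => F (x₁ + t • (y - x₁)) :=
      hF.continuous.comp (continuous_const.add (continuous_id.smul continuous_const))
    have h0 : F (x₁ + (0 : ℝ) • (y - x₁)) < 0 := by simpa using hlt
    have hev := ((hc.tendsto 0).eventually_lt_const h0).filter_mono
      (nhdsWithin_le_nhds (s := Ioi (0 : ℝ)))
    obtain ⟨t, htK, ht0, ht1⟩ := (hev.and (Ioo_mem_nhdsGT (zero_lt_one' ℝ))).exists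
    have h1 := hmin' _ htK.le
    have h2 : x₁ + t • (y - x₁) - y = (1 - t) • (x₁ - y) := by
      rw [sub_smul, one_smul]
      simp only [smul_sub]
      abel
    simp only [hφ, h2, norm_smul, Real.norm_of_nonneg (by linarith : (0 : ℝ) ≤ 1 - t),
      mul_pow] at h1
    have hpos : 0 < ‖x₁ - y‖ ^ 2 := pow_pos (norm_pos_iff.2 (sub_ne_zero.2 hx₁y)) 2
    have h3 : (1 - t) ^ 2 < 1 := by nlinarith
    have h4 := mul_lt_mul_of_pos_right h3 hpos
    linarith
  -- multiplier rule for `φ = ‖· - y‖²`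
  have hφ' : HasFDerivAt φ ((2 : ℕ) • (innerSL ℝ (x₁ - y)).comp (ContinuousLinearMap.id ℝ E)) x₁ :=
    ((hasFDerivAt_id x₁).sub_const y).norm_sq
  obtain ⟨a, ha, haeq⟩ := exists_fderiv_eq_smul_of_isMinOn_sublevel hmin' hx₁
    (hF1 x₁).hasFDerivAt hφ' (hreg x₁ hx₁)
  have key : ∀ v, 2 * ⟪x₁ - y, v⟫_ℝ = a * fderiv ℝ F x₁ v := fun v => by
    have := DFunLike.congr_fun haeq v
    rw [inner_sub_left]
    simpa using this
  have ha0 : a ≠ 0 := by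
    rintro rfl
    have h := key (x₁ - y)
    rw [zero_mul, real_inner_self_eq_norm_sq] at h
    have : ‖x₁ - y‖ = 0 := by nlinarith [norm_nonneg (x₁ - y)]
    exact hx₁y (sub_eq_zero.1 (norm_eq_zero.1 this))
  have ha' : a < 0 := lt_of_le_of_ne ha ha0
  refine ⟨x₁, hx₁, ?_⟩
  have h := key (y - x₁)
  have hinner : ⟪x₁ - y, y - x₁⟫_ℝ = -‖y - x₁‖ ^ 2 := by
    rw [← neg_sub y x₁, inner_neg_left, real_inner_self_eq_norm_sq]
  rw [hinner] at h
  have hpos : 0 < ‖y - x₁‖ ^ 2 := pow_pos (norm_pos_iff.2 (sub_ne_zero.2 (Ne.symm hx₁y))) 2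
  nlinarith

/-- **Convexity of a compact region whose boundary has injective Gauss map** (the abstract core
of Hadamard's theorem): for `F` of class `C¹` with `{F ≤ 0}` compact, `dF ≠ 0` on `{F = 0}` and
the outer normal direction injective on `{F = 0}`, the region `{F ≤ 0}` is convex (it is the
intersection of its supporting half-spaces: a point outside is separated by the tangent
hyperplane at the nearest boundary point). [folklore] -/
theorem convex_sublevel_of_gaussMap_injective {F : E → ℝ} (hF : ContDiff ℝ 1 F)
    (hK : IsCompact {x | F x ≤ 0}) (hreg : ∀ x, F x = 0 → fderiv ℝ F x ≠ 0)
    (hinj : ∀ x x', F x = 0 → F x' = 0 →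
      (∃ c : ℝ, 0 < c ∧ fderiv ℝ F x = c • fderiv ℝ F x') → x = x') :
    Convex ℝ {x | F x ≤ 0} := by
  intro z₁ hz₁ z₂ hz₂ a b ha hb hab
  by_contra hw
  have hw' : 0 < F (a • z₁ + b • z₂) := not_le.1 hw
  obtain ⟨x₁, hx₁, hpos⟩ :=
    exists_fderiv_apply_sub_pos_of_pos hF hK ⟨z₁, hz₁⟩ hreg hw'
  have h1 := fderiv_apply_sub_nonpos_of_gaussMap_injective hF hK hreg hinj hx₁ hz₁
  have h2 := fderiv_apply_sub_nonpos_of_gaussMap_injective hF hK hreg hinj hx₁ hz₂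
  have hdec : a • z₁ + b • z₂ - x₁ = a • (z₁ - x₁) + b • (z₂ - x₁) := by
    calc a • z₁ + b • z₂ - x₁ = a • z₁ + b • z₂ - (a + b) • x₁ := by rw [hab, one_smul]
      _ = a • (z₁ - x₁) + b • (z₂ - x₁) := by rw [add_smul, smul_sub, smul_sub]; abel
  rw [hdec, map_add, map_smul, map_smul, smul_eq_mul, smul_eq_mul] at hpos
  nlinarith [mul_nonpos_of_nonneg_of_nonpos ha h1, mul_nonpos_of_nonneg_of_nonpos hb h2]

end Hadamard

section HadamardManifold

variable {n : ℕ} {M : Type*} [TopologicalSpace M] [ChartedSpace (EuclideanSpace ℝ (Fin n)) M]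
  [IsManifold (𝓡 n) ∞ M]

/-- **Hadamard (1897): a closed connected strictly convex hypersurface bounds a convex body** —
the fact "well known" to Huisken–Sinestrari (proof of Cor. 1.2–1.3, p. 218: "we recognise a
convex closed surface which is well known to bound a smooth convex region diffeomorphic to
`B̄ⁿ⁺¹`, compare Theorem 7.14"). Level-set form: `e : M → ℝⁿ⁺¹` a smooth immersion of a compact
connected boundaryless `n`-manifold, `n ≥ 2`, onto the regular zero set `{F = 0}` of a smooth
`F` with `{F ≤ 0}` compact, strictly convex for the outer normal (`D²F > 0` on `ker dF ∖ 0`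
along `{F = 0}`, i.e. `λ₁ > 0`). Then `{F ≤ 0}` is convex: the Gauss map is a diffeomorphism onto
`Sⁿ` (`exists_diffeomorph_sphere_gaussMap`), in particular injective, so every tangent hyperplane
supports the region (`fderiv_apply_sub_nonpos_of_gaussMap_injective`) and a point outside is
separated by the tangent hyperplane at its nearest boundary point
(`convex_sublevel_of_gaussMap_injective`).
[cite: HuiskenSinestrari2008, proof of Cor. 1.2 and 1.3, p. 218] -/
theorem convex_sublevel_of_strictlyConvex (hn : 2 ≤ n) [CompactSpace M] [T2Space M]
    [ConnectedSpace M] {F : EuclideanSpace ℝ (Fin (n + 1)) → ℝ}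
    {e : M → EuclideanSpace ℝ (Fin (n + 1))} (hF : ContDiff ℝ ∞ F)
    (he : Manifold.IsImmersion (𝓡 n) 𝓘(ℝ, EuclideanSpace ℝ (Fin (n + 1))) ∞ e)
    (hK : IsCompact {x | F x ≤ 0}) (hreg : ∀ x, F x = 0 → fderiv ℝ F x ≠ 0)
    (hrange : Set.range e = {x | F x = 0})
    (hconv : ∀ x, F x = 0 → ∀ w : EuclideanSpace ℝ (Fin (n + 1)), fderiv ℝ F x w = 0 →
      w ≠ 0 → 0 < iteratedFDeriv ℝ 2 F x ![w, w]) :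
    Convex ℝ {x | F x ≤ 0} := by
  have hFe : ∀ m, F (e m) = 0 := fun m => by
    have h : e m ∈ Set.range e := ⟨m, rfl⟩
    rw [hrange] at h
    exact h
  obtain ⟨Φ, hΦ⟩ := exists_diffeomorph_sphere_gaussMap hn hF he hFe (fun m => hreg _ (hFe m))
    (fun m w hw hw0 => hconv _ (hFe m) w hw hw0)
  refine convex_sublevel_of_gaussMap_injective (hF.of_le (mod_cast le_top)) hK hreg ?_
  rintro x x' hx hx' ⟨c, hc, hcx⟩
  have hxm : x ∈ Set.range e := by rw [hrange]; exact hx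
  have hxm' : x' ∈ Set.range e := by rw [hrange]; exact hx'
  obtain ⟨m, rfl⟩ := hxm
  obtain ⟨m', rfl⟩ := hxm'
  have hgrad : gradient F (e m) = c • gradient F (e m') := by
    refine ext_inner_right ℝ fun u => ?_
    rw [inner_gradient_left, real_inner_smul_left, inner_gradient_left, hcx]
    rfl
  have hg0 : ‖gradient F (e m')‖ ≠ 0 :=
    norm_ne_zero_iff.2 fun h => hreg _ (hFe m') (gradient_eq_zero_iff.1 h)
  have hΦeq : (Φ m : EuclideanSpace ℝ (Fin (n + 1))) = Φ m' := by
    rw [hΦ, hΦ, hgrad, norm_smul, Real.norm_of_nonneg hc.le, smul_smul]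
    congr 1
    field_simp
  have hmm' : m = m' := Φ.injective (Subtype.ext hΦeq)
  rw [hmm']

end HadamardManifold

/-! ## The region bounded by a convex hypersurface is a topological ball (second clause of
Cor. 1.3 in the convex case, topological category) -/

section Ball

variable {E : Type*} [NormedAddCommGroup E] [NormedSpace ℝ E]

/-- The interior of a regular sublevel set `{F ≤ 0}` is `{F < 0}`: a zero of `F` interior to
`{F ≤ 0}` would be a local maximum, where `dF` vanishes. [folklore] -/
theorem interior_sublevel_eq {F : E → ℝ} (hF : Differentiable ℝ F)
    (hreg : ∀ x, F x = 0 → fderiv ℝ F x ≠ 0) : interior {x | F x ≤ 0} = {x | F x < 0} := by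
  refine Subset.antisymm (fun x hx => ?_)
    ((isOpen_lt hF.continuous continuous_const).subset_interior_iff.2
      fun x (hx : F x < 0) => show F x ≤ 0 from hx.le)
  have hxK : F x ≤ 0 := interior_subset (s := {x | F x ≤ 0}) hx
  rcases hxK.lt_or_eq with hlt | heq
  · exact hlt
  · exfalso
    refine hreg x heq ?_
    have hmax : IsLocalMax F x := by
      filter_upwards [mem_interior_iff_mem_nhds.1 hx] with y hy
      exact (show F y ≤ 0 from hy).trans_eq heq.symm
    exact hmax.fderiv_eq_zero

/-- The frontier of a regular sublevel set `{F ≤ 0}` is the level set `{F = 0}`. [folklore] -/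
theorem frontier_sublevel_eq {F : E → ℝ} (hF : Differentiable ℝ F)
    (hreg : ∀ x, F x = 0 → fderiv ℝ F x ≠ 0) : frontier {x | F x ≤ 0} = {x | F x = 0} := by
  rw [frontier, interior_sublevel_eq hF hreg,
    (isClosed_le hF.continuous continuous_const).closure_eq]
  ext x
  constructor
  · rintro ⟨h1, h2⟩
    exact le_antisymm h1 (not_lt.1 h2)
  · intro h
    exact ⟨(h : F x = 0).le, not_lt.2 (h : F x = 0).ge⟩

/-- **A compact convex region with regular nonempty boundary is an (ambient) topological ball**:
if `F` is differentiable, `{F ≤ 0}` is compact and convex, `dF ≠ 0` on `{F = 0} ≠ ∅`, then a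
homeomorphism of the ambient space maps `{F ≤ 0}` onto the closed unit ball, `{F < 0}` onto the
open unit ball and the hypersurface `{F = 0}` onto the unit sphere (Mathlib's gauge rescaling,
`exists_homeomorph_image_interior_closure_frontier_eq_unitBall`). [folklore] -/
theorem exists_homeomorph_image_sublevel_eq_closedBall {F : E → ℝ} (hF : Differentiable ℝ F)
    (hK : IsCompact {x | F x ≤ 0}) (hconv : Convex ℝ {x | F x ≤ 0})
    (hreg : ∀ x, F x = 0 → fderiv ℝ F x ≠ 0) (hne : ∃ x, F x = 0) :
    ∃ h : E ≃ₜ E, h '' {x | F x ≤ 0} = Metric.closedBall 0 1 ∧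
      h '' {x | F x < 0} = Metric.ball 0 1 ∧ h '' {x | F x = 0} = Metric.sphere 0 1 := by
  obtain ⟨x, hx⟩ := hne
  obtain ⟨p, hp⟩ := exists_lt_zero_of_fderiv_ne_zero hx (hreg x hx)
  have hint : (interior {x | F x ≤ 0}).Nonempty :=
    ⟨p, by rw [interior_sublevel_eq hF hreg]; exact hp⟩
  obtain ⟨h, h1, h2, h3⟩ :=
    exists_homeomorph_image_interior_closure_frontier_eq_unitBall hconv hint hK.isBounded
  rw [interior_sublevel_eq hF hreg] at h1
  rw [(isClosed_le hF.continuous continuous_const).closure_eq] at h2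
  rw [frontier_sublevel_eq hF hreg] at h3
  exact ⟨h, h2, h1, h3⟩

end Ball

section BallManifold

variable {n : ℕ} {M : Type*} [TopologicalSpace M] [ChartedSpace (EuclideanSpace ℝ (Fin n)) M]
  [IsManifold (𝓡 n) ∞ M]

/-- **Second clause of Huisken–Sinestrari's Cor. 1.3 in the convex case, topological category.**
A closed connected strictly convex (`λ₁ > 0`) hypersurface `e(M) = {F = 0} ⊂ ℝⁿ⁺¹`, `n ≥ 2`,
bounds a region `{F ≤ 0}` which an ambient homeomorphism of `ℝⁿ⁺¹` carries onto the closed unit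
ball, the hypersurface going onto the unit sphere (p. 218: "a convex closed surface which is well
known to bound a smooth convex region diffeomorphic to `B̄ⁿ⁺¹`"; here: Hadamard's convexity
`convex_sublevel_of_strictlyConvex` and gauge rescaling — the smooth standardness of the closed
region as a manifold with boundary is not asserted).
[cite: HuiskenSinestrari2008, Cor. 1.3 and its proof, p. 218] -/
theorem exists_homeomorph_image_eq_closedBall_of_strictlyConvex (hn : 2 ≤ n) [CompactSpace M]
    [T2Space M] [ConnectedSpace M] [Nonempty M] {F : EuclideanSpace ℝ (Fin (n + 1)) → ℝ}
    {e : M → EuclideanSpace ℝ (Fin (n + 1))} (hF : ContDiff ℝ ∞ F)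
    (he : Manifold.IsImmersion (𝓡 n) 𝓘(ℝ, EuclideanSpace ℝ (Fin (n + 1))) ∞ e)
    (hK : IsCompact {x | F x ≤ 0}) (hreg : ∀ x, F x = 0 → fderiv ℝ F x ≠ 0)
    (hrange : Set.range e = {x | F x = 0})
    (hconv : ∀ x, F x = 0 → ∀ w : EuclideanSpace ℝ (Fin (n + 1)), fderiv ℝ F x w = 0 →
      w ≠ 0 → 0 < iteratedFDeriv ℝ 2 F x ![w, w]) :
    ∃ h : EuclideanSpace ℝ (Fin (n + 1)) ≃ₜ EuclideanSpace ℝ (Fin (n + 1)),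
      h '' {x | F x ≤ 0} = Metric.closedBall 0 1 ∧ h '' Set.range e = Metric.sphere 0 1 := by
  have hc := convex_sublevel_of_strictlyConvex hn hF he hK hreg hrange hconv
  obtain ⟨m⟩ := ‹Nonempty M›
  have hm : F (e m) = 0 := by
    have h : e m ∈ Set.range e := ⟨m, rfl⟩
    rw [hrange] at h
    exact h
  obtain ⟨h, h1, -, h3⟩ := exists_homeomorph_image_sublevel_eq_closedBall
    (hF.differentiable (by simp)) hK hc hreg ⟨e m, hm⟩
  exact ⟨h, h1, by rw [hrange]; exact h3⟩

end BallManifold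

/-! ## `Sⁿ⁻¹ × S¹` is not simply connected (the `π₁`-obstruction in Cor. 1.2 ⇒ Cor. 1.3) -/

section PiOne

/-- **A product with a circle is not simply connected**: for nonempty `Y` and `p ≠ 0`,
`Y × ℝ/pℤ` is not simply connected — the loop `t ↦ (y₀, t p)` has the non-closing real lift
`t ↦ t p` of its circle coordinate (tree:
`Literature.AlgebraicTopology.FundamentalGroup.AddCircle.not_simplyConnectedSpace_of_lift`).
[folklore] -/
theorem not_simplyConnectedSpace_prod_addCircle {Y : Type*} [TopologicalSpace Y] [Nonempty Y]
    {p : ℝ} (hp : p ≠ 0) : ¬ SimplyConnectedSpace (Y × AddCircle p) := by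
  obtain ⟨y₀⟩ := ‹Nonempty Y›
  let g : C(Y × AddCircle p, AddCircle p) := ⟨Prod.snd, continuous_snd⟩
  let γ : Path (y₀, ((0 : ℝ) : AddCircle p)) (y₀, ((0 : ℝ) : AddCircle p)) :=
    { toFun := fun t => (y₀, (((t : ℝ) * p : ℝ) : AddCircle p))
      continuous_toFun := by fun_prop
      source' := by simp
      target' := by simp }
  refine Literature.AlgebraicTopology.FundamentalGroup.AddCircle.not_simplyConnectedSpace_of_lift
    g γ (G := fun t => (t : ℝ) * p) (by fun_prop) (fun t => rfl) ?_
  simp [hp]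

/-- **`Sⁿ⁻¹ × S¹` is not simply connected** (`n ≥ 1`), and neither is any space homotopy
equivalent — in particular homeomorphic or diffeomorphic — to it: the single-handle case of the
`π₁`-obstruction by which Huisken–Sinestrari pass from Cor. 1.2 ("diffeomorphic either to `Sⁿ` or
to a finite connected sum of `Sⁿ⁻¹ × S¹`") to Cor. 1.3 for simply connected `M` (p. 219: "if
the initial surface `M` is simply connected, it must have bounded a region which is
diffeomorphic to a standard closed ball").
[cite: HuiskenSinestrari2008, proof of Cor. 1.3, p. 219] -/
theorem not_simplyConnectedSpace_of_homotopyEquiv_sphere_prod_circle {n : ℕ} (hn : 1 ≤ n)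
    {X : Type*} [TopologicalSpace X]
    (e : ContinuousMap.HomotopyEquiv X
      (Metric.sphere (0 : EuclideanSpace ℝ (Fin n)) 1 × Circle)) :
    ¬ SimplyConnectedSpace X := by
  intro hX
  haveI : Nonempty (Metric.sphere (0 : EuclideanSpace ℝ (Fin n)) 1) := by
    haveI : Nontrivial (EuclideanSpace ℝ (Fin n)) :=
      Module.nontrivial_of_finrank_pos (R := ℝ) (by rw [finrank_euclideanSpace_fin]; omega)
    exact (NormedSpace.sphere_nonempty.2 zero_le_one).to_subtype
  have h1 : SimplyConnectedSpace (Metric.sphere (0 : EuclideanSpace ℝ (Fin n)) 1 × Circle) :=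
    e.simplyConnectedSpace_iff.1 hX
  have e2 : (Metric.sphere (0 : EuclideanSpace ℝ (Fin n)) 1 × Circle) ≃ₜ
      (Metric.sphere (0 : EuclideanSpace ℝ (Fin n)) 1 × AddCircle (2 * Real.pi)) :=
    Homeomorph.prodCongr (Homeomorph.refl _) AddCircle.homeomorphCircle'.symm
  have h2 := e2.toHomotopyEquiv.simplyConnectedSpace_iff.1 h1
  exact not_simplyConnectedSpace_prod_addCircle (by positivity) h2

end PiOne

/-! ### Positive hyperplane: weak two-convexity with a nondegenerate tangential Hessian

At an upward-normal point where the height function is nondegenerate, `λ₁ + λ₂ ≥ 0` leaves at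
most one negative principal curvature — the hypothesis of the tree's exp-height theorem
`Literature.Topology.FourManifolds.ExpHeight.exists_regularSublevel_isHandlebodyOfIndexLE_one`. -/

section PositiveSubspace

open scoped RealInnerProductSpace
open Literature.Topology.FourManifolds Literature.Analysis.InnerProduct

variable {n : ℕ}

/-- **Weak two-convexity plus nondegeneracy gives a positive hyperplane.**  Let
`K = ker dF(p)` with `dF(p) = c ⟪v, ·⟫`, `c ≠ 0` (so `K = vᗮ`).  If `D²F(p)|_K` is nondegenerate
and `D²F(p)(u₁, u₁) + D²F(p)(u₂, u₂) ≥ 0` for every orthonormal pair in `K` (the fact's clause,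
`λ₁ + λ₂ ≥ 0`), then `D²F(p)` is positive definite on a subspace `P ≤ K` of codimension `≤ 1`
in `K`: diagonalise the tangential Hessian operator (`exists_tangentialHessian`); no eigenvalue
vanishes, and two negative ones would give an orthonormal pair with negative sum, so all but at
most one are positive. [folklore] -/
theorem exists_posSubspace_of_twoConvex {F : EuclideanSpace ℝ (Fin (n + 1)) → ℝ}
    {p v : EuclideanSpace ℝ (Fin (n + 1))} {c : ℝ} (hF : ContDiff ℝ 2 F) (hc : c ≠ 0)
    (hDF : fderiv ℝ F p = c • innerSL ℝ v)
    (hnd : ∀ w, ⟪v, w⟫ = 0 → (∀ u, ⟪v, u⟫ = 0 → fderiv ℝ (fderiv ℝ F) p w u = 0) → w = 0)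
    (h2 : ∀ u : Fin 2 → EuclideanSpace ℝ (Fin (n + 1)), Orthonormal ℝ u →
      (∀ i, fderiv ℝ F p (u i) = 0) → 0 ≤ ∑ i, iteratedFDeriv ℝ 2 F p ![u i, u i]) :
    ∃ P : Submodule ℝ (EuclideanSpace ℝ (Fin (n + 1))), (∀ w ∈ P, ⟪v, w⟫ = 0) ∧
      n + 1 ≤ finrank ℝ P + 2 ∧ ∀ w ∈ P, w ≠ 0 → 0 < fderiv ℝ (fderiv ℝ F) p w w := by
  classical
  set K := (fderiv ℝ F p).ker with hKdef
  have hKv : ∀ w, w ∈ K ↔ ⟪v, w⟫ = 0 := fun w => by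
    rw [hKdef, LinearMap.mem_ker]
    change fderiv ℝ F p w = 0 ↔ _
    rw [hDF]
    simp [hc]
  -- dimension of `K`
  have hKdim : n ≤ finrank ℝ K := by
    have h1 := LinearMap.finrank_range_add_finrank_ker
      (fderiv ℝ F p : EuclideanSpace ℝ (Fin (n + 1)) →ₗ[ℝ] ℝ)
    have h2 : finrank ℝ (LinearMap.range
        (fderiv ℝ F p : EuclideanSpace ℝ (Fin (n + 1)) →ₗ[ℝ] ℝ)) ≤ 1 :=
      (Submodule.finrank_le _).trans (by simp)
    have h3 : finrank ℝ (EuclideanSpace ℝ (Fin (n + 1))) = n + 1 := finrank_euclideanSpace_fin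
    change _ + finrank ℝ K = _ at h1
    omega
  -- the tangential Hessian operator and its eigenbasis
  obtain ⟨T, hTB, hT⟩ := exists_tangentialHessian (x := p) hF
  set d := finrank ℝ K with hd
  have hd' : finrank ℝ K = d := rfl
  set b := hT.eigenvectorBasis hd' with hb
  set μ := hT.eigenvalues hd' with hμ
  have hTB' : ∀ a a' : K, fderiv ℝ (fderiv ℝ F) p a a' = ⟪T a, a'⟫ := fun a a' => by
    rw [hTB, iteratedFDeriv_two_apply]; rfl
  have hdiag : ∀ i, ⟪T (b i), b i⟫ = μ i := fun i =>
    inner_apply_eigenvectorBasis_self hT hd' i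
  have hTbi : ∀ i, T (b i) = μ i • b i := fun i => by
    simpa only [ContinuousLinearMap.coe_coe, RCLike.ofReal_real_eq_id, id_eq] using
      hT.apply_eigenvectorBasis hd' i
  -- no eigenvalue vanishes
  have hμ0 : ∀ i, μ i ≠ 0 := by
    intro i hi
    have hzero : ((b i : K) : EuclideanSpace ℝ (Fin (n + 1))) = 0 := by
      refine hnd _ ((hKv _).1 (b i).2) fun u hu => ?_
      rw [hTB' (b i) ⟨u, (hKv u).2 hu⟩, hTbi, hi, zero_smul, inner_zero_left]
    have hbi0 : b i = 0 := by exact_mod_cast hzero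
    have h1 : ‖(b i : K)‖ = 1 := b.orthonormal.1 i
    rw [hbi0, norm_zero] at h1
    exact zero_ne_one h1
  -- the eigenvectors, read in the ambient space, form an orthonormal family in `K`
  have hon' : Orthonormal ℝ (fun k => ((b k : K) : EuclideanSpace ℝ (Fin (n + 1)))) :=
    (K.subtypeₗᵢ.orthonormal_comp_iff).2 b.orthonormal
  -- at most one negative eigenvalue
  have hpair : ∀ i j, i ≠ j → ¬ (μ i < 0 ∧ μ j < 0) := by
    intro i j hij ⟨hi, hj⟩
    have hinj : Function.Injective (![i, j] : Fin 2 → Fin d) := by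
      intro k l hkl
      fin_cases k <;> fin_cases l
      · rfl
      · exact absurd hkl (by simpa using hij)
      · exact absurd hkl (by simpa using hij.symm)
      · rfl
    set u : Fin 2 → EuclideanSpace ℝ (Fin (n + 1)) :=
      (fun k => ((b k : K) : EuclideanSpace ℝ (Fin (n + 1)))) ∘ ![i, j] with hu
    have hon : Orthonormal ℝ u := hon'.comp _ hinj
    have hker : ∀ k, fderiv ℝ F p (u k) = 0 := fun k => (b (![i, j] k)).2
    have h := h2 u hon hker
    rw [Fin.sum_univ_two] at h
    have e0 : iteratedFDeriv ℝ 2 F p ![u 0, u 0] = μ i := by rw [← hdiag i, hTB]; rfl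
    have e1 : iteratedFDeriv ℝ 2 F p ![u 1, u 1] = μ j := by rw [← hdiag j, hTB]; rfl
    rw [e0, e1] at h
    linarith
  set N : Finset (Fin d) := Finset.univ.filter fun i => μ i < 0 with hN
  have hNcard : N.card ≤ 1 := by
    rw [Finset.card_le_one]
    intro i hi j hj
    by_contra hij
    rw [hN, Finset.mem_filter] at hi hj
    exact hpair i j hij ⟨hi.2, hj.2⟩
  have hpos : ∀ i, i ∉ N → 0 < μ i := fun i hi => by
    rw [hN, Finset.mem_filter] at hi
    push Not at hi
    exact lt_of_le_of_ne (hi (Finset.mem_univ i)) (hμ0 i).symm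
  -- the positive subspace: the orthogonal complement, in `K`, of the negative eigenvectors
  set S : Submodule ℝ K := Submodule.span ℝ ((N.image fun i => b i : Finset K) : Set K) with hS
  have hSdim : finrank ℝ S ≤ 1 :=
    (finrank_span_finset_le_card _).trans (Finset.card_image_le.trans hNcard)
  have hP₀dim : d ≤ finrank ℝ Sᗮ + 1 := by
    have := Submodule.finrank_add_finrank_orthogonal S
    rw [hd'] at this
    omega
  have hmemS : ∀ i ∈ N, b i ∈ S := fun i hi =>
    Submodule.subset_span (Finset.mem_coe.2 (Finset.mem_image_of_mem _ hi))
  refine ⟨Sᗮ.map K.subtype, fun w hw => ?_, ?_, fun w hw hw0 => ?_⟩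
  · obtain ⟨w₀, -, rfl⟩ := Submodule.mem_map.1 hw
    exact (hKv _).1 w₀.2
  · rw [Submodule.finrank_map_subtype_eq]
    omega
  · obtain ⟨w₀, hw₀, rfl⟩ := Submodule.mem_map.1 hw
    have hw₀0 : w₀ ≠ 0 := fun h => hw0 (by simp [h])
    have horth : ∀ i ∈ N, ⟪b i, w₀⟫ = 0 := fun i hi =>
      Submodule.inner_right_of_mem_orthogonal (hmemS i hi) hw₀
    change 0 < fderiv ℝ (fderiv ℝ F) p (K.subtype w₀) (K.subtype w₀)
    have hsum := inner_apply_self_eq_sum_eigenvalues hT hd' w₀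
    rw [ContinuousLinearMap.coe_coe] at hsum
    rw [Submodule.subtype_apply, hTB' w₀ w₀, hsum]
    -- all terms are nonnegative, and one is positive
    have hterm : ∀ i, 0 ≤ μ i * ⟪b i, w₀⟫ ^ 2 := by
      intro i
      by_cases hi : i ∈ N
      · rw [horth i hi]; simp
      · exact mul_nonneg (hpos i hi).le (sq_nonneg _)
    obtain ⟨i₀, hi₀⟩ : ∃ i, ⟪b i, w₀⟫ ≠ 0 := by
      by_contra hall
      push Not at hall
      apply hw₀0
      rw [← b.sum_repr' w₀]
      exact Finset.sum_eq_zero fun i _ => by rw [hall i, zero_smul]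
    have hi₀N : i₀ ∉ N := fun h => hi₀ (horth i₀ h)
    have hlt : 0 < μ i₀ * ⟪b i₀, w₀⟫ ^ 2 := mul_pos (hpos i₀ hi₀N) (by positivity)
    calc (0 : ℝ) < μ i₀ * ⟪b i₀, w₀⟫ ^ 2 := hlt
      _ ≤ ∑ i, μ i * ⟪b i, w₀⟫ ^ 2 :=
          Finset.single_le_sum (f := fun i => μ i * ⟪b i, w₀⟫ ^ 2) (fun i _ => hterm i)
            (Finset.mem_univ i₀)
      _ = ∑ i, hT.eigenvalues hd' i * ⟪(hT.eigenvectorBasis hd') i, w₀⟫ ^ 2 := rfl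

end PositiveSubspace



/-! ### Discharge of the fact: the region bounded by `M` is a ball (Morse theory), so `M ≅ 𝕊ⁿ` -/

section Discharge

open scoped RealInnerProductSpace
open Metric MeasureTheory Literature.Topology.FourManifolds Literature.Analysis.InnerProduct

/-- **Huisken–Sinestrari 2009, Corollary 1.3 (first clause), discharged**: a smooth closed
simply connected two-convex embedded hypersurface `Mⁿ ⊂ ℝⁿ⁺¹`, `n ≥ 3`, is diffeomorphic to the
standard sphere `Sⁿ`.

*Proof route.*  Huisken–Sinestrari derive Cor. 1.3 from their Thm. 1.1 (mean curvature flow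
with surgeries, pp. 218–219); the tree has no mean curvature flow.  We follow instead the
"different approaches" the paper points to for Cor. 1.2 (p. 139, refs. [9, 23, 27, 30]: Morse
theory of height functions on `p`-convex domains — Sha 1986, Wu 1987) in the form PROVED in the
tree's Morse-theory library (`Literature/Topology/FourManifolds`), which yields the standard
smooth structure because the region `Ω = {F ≤ 0}` is recognised as a ball:
1. (Guillemin–Pollack, `ae_isMorse_height`; `HeightDictionary.isMorse_inner_comp_iff`) for
   almost every direction `v` the height `⟪v, e ·⟫` is a Morse function on `M`, i.e. the
   tangential Hessian `D²F|_{vᗮ}` is nondegenerate at every horizontal point of `∂Ω = e(M)`;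
2. (`exists_posSubspace_of_twoConvex`) weak two-convexity `λ₁ + λ₂ ≥ 0` then leaves at most
   ONE negative principal curvature at each upward-normal point, so
3. (`ExpHeight.exists_regularSublevel_isHandlebodyOfIndexLE_one`, the exp-height Morse function
   `e^{t⟪v,·⟫} F`) `Ω` is a handlebody with handles of index `≤ 1`; cancelling the surplus
   `0`-handles (Milnor 1965, Thm. 8.1, `HandlebodyBall.exists_isMorseAdapted_ncard_zero_eq_one`)
   it is a `1`-handlebody with `m` one-handles, `π₁(Ω) ≅ F_m`
   (`IsMorseAdapted.isFreeOfRank_fundamentalGroup`), onto which `π₁(∂Ω) = π₁(M) = 1` surjects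
   for `n ≥ 2` (`IsMorseAdapted.surjective_and_injective_inclHom_boundary`); hence `m = 0`,
4. a Morse function with a single critical point, a minimum, makes `Ω ≅ 𝔻ⁿ⁺¹`
   (`IsMorseAdapted.nonempty_diffeomorph_closedBall`, Milnor's disc lemma), and restricting the
   diffeomorphism to the boundary, `M ≅ ∂Ω ≅ ∂𝔻ⁿ⁺¹ = 𝕊ⁿ` (`BoundaryData.restrictDiffeomorph`).
This also proves the second clause of Cor. 1.3 (the region is a smoothly embedded standard
ball) on the way. [cite: HuiskenSinestrari2008, Corollary 1.3 (p. 139, with the remark on refs. [9, 23, 27, 30])]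
[cite: Milnor1963, §2–§3, §6] [cite: MilnorHCobordism1965, Thm. 8.1] -/
theorem HuiskenSinestrari2009_twoConvex_simplyConnected_holds :
    HuiskenSinestrari2009_twoConvex_simplyConnected := by
  intro n hn M _ _ _ _ _ _ hsc F e hF hK hreg he hrange h2c
  classical
  -- `M` is nonempty and connected
  haveI : Nonempty M := inferInstance
  have hdim : finrank ℝ (EuclideanSpace ℝ (Fin (n + 1))) = n + 1 := finrank_euclideanSpace_fin
  have hF2 : ContDiff ℝ 2 F := hF.of_le (by norm_cast)
  have hecont : ContMDiff (𝓡 n) 𝓘(ℝ, EuclideanSpace ℝ (Fin (n + 1))) ∞ e := he.contMDiff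
  have heinj : ∀ y, Injective (mfderiv (𝓡 n) 𝓘(ℝ, EuclideanSpace ℝ (Fin (n + 1))) e y) :=
    fun y => injective_mfderiv_of_isImmersionAt' (he.isImmersion.isImmersionAt y)
  have hFe : ∀ y, F (e y) = 0 := fun y => by
    have : e y ∈ Set.range e := mem_range_self y
    rw [hrange] at this
    exact this
  -- Step 1: a generic direction `v`: the height `⟪v, e ·⟫` is a Morse function
  have hae : ∀ᵐ a ∂(volume : Measure (EuclideanSpace ℝ (Fin (n + 1)))),
      IsMorse (𝓡 n) (fun y => ⟪a, e y⟫) := ae_isMorse_height hecont heinj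
  have hae0 : ∀ᵐ a ∂(volume : Measure (EuclideanSpace ℝ (Fin (n + 1)))), a ≠ 0 := by
    rw [ae_iff]
    simp
  obtain ⟨v, hvM, hv0⟩ := (hae.and hae0).exists
  -- Step 2: at horizontal points the tangential Hessian is nondegenerate …
  have hnd := (HeightDictionary.isMorse_inner_comp_iff hdim hecont heinj hF2 hFe
    (fun y => hreg _ (hFe y)) hv0).1 hvM
  -- … and, by two-convexity, positive on a hyperplane of the tangent space
  have hP : ∀ p, F p = 0 → ∀ c : ℝ, 0 < c → fderiv ℝ F p = c • innerSL ℝ v →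
      (∀ w, ⟪v, w⟫ = 0 → (∀ u, ⟪v, u⟫ = 0 → fderiv ℝ (fderiv ℝ F) p w u = 0) → w = 0) ∧
      ∃ P : Submodule ℝ (EuclideanSpace ℝ (Fin (n + 1))), (∀ w ∈ P, ⟪v, w⟫ = 0) ∧
        n + 1 ≤ finrank ℝ P + 2 ∧ ∀ w ∈ P, w ≠ 0 → 0 < fderiv ℝ (fderiv ℝ F) p w w := by
    intro p hp c hc hDF
    have hp' : p ∈ Set.range e := by rw [hrange]; exact hp
    obtain ⟨x, rfl⟩ := hp'
    exact ⟨hnd x c hDF,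
      exists_posSubspace_of_twoConvex hF2 hc.ne' hDF (hnd x c hDF) (h2c (e x) hp)⟩
  -- Step 3: `Ω = {F ≤ 0}` is a handlebody of index `≤ 1`
  obtain ⟨U, f, h0, hKU, hle, hzero, hcs, hhb⟩ :=
    ExpHeight.exists_regularSublevel_isHandlebodyOfIndexLE_one (n := n) hF hK hreg hv0 hP
  haveI := hcs
  obtain ⟨x₀⟩ := (inferInstance : Nonempty M)
  haveI hWne : Nonempty (RegularSublevel h0) :=
    ⟨RegularSublevel.mk h0 ⟨e x₀, hKU (hFe x₀).le⟩ ((hle _).2 (hFe x₀).le)⟩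
  -- the inclusion `Ω → ℝⁿ⁺¹` and its range
  set ι : RegularSublevel h0 → EuclideanSpace ℝ (Fin (n + 1)) :=
    Subtype.val ∘ RegularSublevel.incl h0 with hι
  have hιemb : Topology.IsEmbedding ι :=
    Topology.IsEmbedding.subtypeVal.comp (RegularSublevel.isSmoothEmbedding_incl h0).isEmbedding
  have hιrange : range ι = {x | F x ≤ 0} := by
    rw [hι, range_comp, RegularSublevel.range_incl]
    ext x
    simp only [mem_image, mem_preimage, mem_Iic, Subtype.exists, exists_and_right, exists_eq_right,
      mem_setOf_eq]
    exact ⟨fun ⟨hx, hfx⟩ => (hle ⟨x, hx⟩).1 hfx, fun hx => ⟨hKU hx, (hle ⟨x, hKU hx⟩).2 hx⟩⟩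
  -- connectedness of `Ω`
  have hZc : IsPreconnected {x : EuclideanSpace ℝ (Fin (n + 1)) | F x = 0} := by
    rw [← hrange]; exact isPreconnected_range hecont.continuous
  have hKc : IsPreconnected {x : EuclideanSpace ℝ (Fin (n + 1)) | F x ≤ 0} :=
    ExpHeight.isPreconnected_sublevel hF.continuous hK hZc hv0
  haveI : ConnectedSpace (RegularSublevel h0) := by
    have huniv : IsPreconnected (univ : Set (RegularSublevel h0)) := by
      rw [← hιemb.isInducing.isPreconnected_image, image_univ, hιrange]
      exact hKc
    exact connectedSpace_iff_univ.2 ⟨univ_nonempty, huniv⟩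
  -- the boundary `∂Ω` and its identification with `M`
  set b := RegularSublevel.boundaryData h0 with hb
  haveI : T2Space b.carrier := b.isSmoothEmbedding.isEmbedding.t2Space
  haveI : CompactSpace b.carrier := by
    rw [← isCompact_univ_iff, b.isSmoothEmbedding.isEmbedding.isCompact_iff, image_univ,
      b.range_incl]
    exact ((𝓡∂ (n + 1)).isClosed_boundary (M := RegularSublevel h0) (n := ∞) (by simp)).isCompact
  set κ : b.carrier → EuclideanSpace ℝ (Fin (n + 1)) := ι ∘ b.incl with hκ
  have hκc : ContMDiff (𝓡 n) 𝓘(ℝ, EuclideanSpace ℝ (Fin (n + 1))) ∞ κ :=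
    ((contMDiff_subtype_val (n := ∞)).comp (RegularSublevel.contMDiff_incl h0)).comp
      b.isSmoothEmbedding.contMDiff
  have hκinj : Injective κ :=
    (Subtype.val_injective.comp (RegularSublevel.injective_incl h0)).comp b.injective_incl
  have hκd : ∀ z, Injective (mfderiv (𝓡 n) 𝓘(ℝ, EuclideanSpace ℝ (Fin (n + 1))) κ z) := by
    intro z
    have h1 : MDifferentiableAt (𝓡 n) (𝓡∂ (n + 1)) b.incl z :=
      (b.isSmoothEmbedding.contMDiff z).mdifferentiableAt (by simp)
    have h2 : MDifferentiableAt (𝓡∂ (n + 1)) (𝓡 (n + 1)) (RegularSublevel.incl h0) (b.incl z) :=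
      (RegularSublevel.contMDiff_incl h0 _).mdifferentiableAt (by simp)
    have h3 : MDifferentiableAt (𝓡 (n + 1)) 𝓘(ℝ, EuclideanSpace ℝ (Fin (n + 1)))
        (Subtype.val : U → EuclideanSpace ℝ (Fin (n + 1))) (RegularSublevel.incl h0 (b.incl z)) :=
      (contMDiff_subtype_val (n := ∞) _).mdifferentiableAt (by simp)
    have e1 : mfderiv (𝓡 n) (𝓡 (n + 1)) (RegularSublevel.incl h0 ∘ b.incl) z =
        (mfderiv (𝓡∂ (n + 1)) (𝓡 (n + 1)) (RegularSublevel.incl h0) (b.incl z)).comp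
          (mfderiv (𝓡 n) (𝓡∂ (n + 1)) b.incl z) := mfderiv_comp z h2 h1
    have e2 : mfderiv (𝓡 n) 𝓘(ℝ, EuclideanSpace ℝ (Fin (n + 1))) κ z =
        (mfderiv (𝓡 (n + 1)) 𝓘(ℝ, EuclideanSpace ℝ (Fin (n + 1)))
          (Subtype.val : U → EuclideanSpace ℝ (Fin (n + 1)))
          (RegularSublevel.incl h0 (b.incl z))).comp
          (mfderiv (𝓡 n) (𝓡 (n + 1)) (RegularSublevel.incl h0 ∘ b.incl) z) :=
      mfderiv_comp z h3 (h2.comp z h1)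
    rw [e2, e1]
    have i1 : Injective (mfderiv (𝓡 n) (𝓡∂ (n + 1)) b.incl z) :=
      injective_mfderiv_of_isImmersionAt' (b.isSmoothEmbedding.isImmersion.isImmersionAt z)
    have i2 : Injective (mfderiv (𝓡∂ (n + 1)) (𝓡 (n + 1)) (RegularSublevel.incl h0) (b.incl z)) :=
      injective_mfderiv_of_isImmersionAt'
        ((RegularSublevel.isSmoothEmbedding_incl h0).isImmersion.isImmersionAt _)
    have i3 : Injective (mfderiv (𝓡 (n + 1)) 𝓘(ℝ, EuclideanSpace ℝ (Fin (n + 1)))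
        (Subtype.val : U → EuclideanSpace ℝ (Fin (n + 1))) (RegularSublevel.incl h0 (b.incl z))) :=
      injective_mfderiv_of_isImmersionAt'
        ((Manifold.IsSmoothEmbedding.of_opens U).isImmersion.isImmersionAt _)
    exact i3.comp (i2.comp i1)
  have hκemb : Manifold.IsSmoothEmbedding (𝓡 n) 𝓘(ℝ, EuclideanSpace ℝ (Fin (n + 1))) ∞ κ :=
    isSmoothEmbedding_of_injective_of_injective_mfderiv hκc (by exact_mod_cast le_top) hκinj hκd
  have hκrange : range κ = {x | F x = 0} := by
    ext x
    constructor
    · rintro ⟨z, rfl⟩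
      have hz : b.incl z ∈ (𝓡∂ (n + 1)).boundary (RegularSublevel h0) :=
        b.range_incl ▸ mem_range_self z
      have := (RegularSublevel.mem_boundary_iff h0 _).1 hz
      exact (hzero _).1 this
    · intro hx
      have hxK : F x ≤ 0 := le_of_eq hx
      set q : RegularSublevel h0 := RegularSublevel.mk h0 ⟨x, hKU hxK⟩ ((hle _).2 hxK) with hq
      have hqb : q ∈ (𝓡∂ (n + 1)).boundary (RegularSublevel h0) :=
        (RegularSublevel.mem_boundary_iff h0 q).2 ((hzero _).2 hx)
      obtain ⟨z, hz⟩ : q ∈ range b.incl := b.range_incl ▸ hqb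
      exact ⟨z, by simp only [hκ, hι, comp_apply, hz]; rfl⟩
  obtain ⟨Φ, -⟩ := ExpHeight.exists_diffeomorph_comp_eq_of_range_eq (M₁ := M) he hκemb
    (hrange.trans hκrange.symm)
  -- Step 4: cancel the surplus `0`-handles
  obtain ⟨f₁, hf₁, hidx⟩ := hhb
  have hfin : ∀ (g : RegularSublevel h0 → ℝ), IsMorseAdapted (𝓡∂ (n + 1)) g → ∀ k,
      (criticalSetOfIndex (𝓡∂ (n + 1)) g k).Finite := fun g hg k =>
    (IsMorse.finite_criticalSet_holds hg.isMorse).subset (criticalSetOfIndex_subset _ g k)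
  have h2 : ∀ k, 2 ≤ k → (criticalSetOfIndex (𝓡∂ (n + 1)) f₁ k).ncard = 0 := by
    intro k hk
    rw [Set.ncard_eq_zero (hfin f₁ hf₁ k)]
    ext z
    simp only [mem_criticalSetOfIndex, mem_empty_iff_false, iff_false, not_and]
    intro hz hzk
    have := hidx z hz
    omega
  obtain ⟨p₀, hp₀⟩ := hf₁.exists_mem_criticalSetOfIndex_zero
  have hpos : 0 < (criticalSetOfIndex (𝓡∂ (n + 1)) f₁ 0).ncard :=
    (Set.ncard_pos (hfin f₁ hf₁ 0)).2 ⟨p₀, hp₀⟩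
  obtain ⟨m, hm⟩ : ∃ m, (criticalSetOfIndex (𝓡∂ (n + 1)) f₁ 0).ncard = m + 1 :=
    ⟨(criticalSetOfIndex (𝓡∂ (n + 1)) f₁ 0).ncard - 1, by omega⟩
  obtain ⟨g, hg, hg0, hg2⟩ := HandlebodyBall.exists_isMorseAdapted_ncard_zero_eq_one m f₁ hf₁ hm h2
  -- Step 5: `π₁(∂Ω) = 1` surjects onto `π₁(Ω) ≅ F_{c₁}`, so `c₁ = 0`
  set c₁ : ℕ := (criticalSetOfIndex (𝓡∂ (n + 1)) g 1).ncard with hc₁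
  have hscb : SimplyConnectedSpace b.carrier :=
    Φ.toHomeomorph.toHomotopyEquiv.simplyConnectedSpace_iff.1 hsc
  haveI : SimplyConnectedSpace ((𝓡∂ (n + 1)).boundary (RegularSublevel h0)) := hscb
  set z₀ : b.carrier := Φ x₀ with hz₀def
  have hz₀ : b.incl z₀ ∈ (𝓡∂ (n + 1)).boundary (RegularSublevel h0) := b.incl_mem_boundary z₀
  obtain ⟨hsurj, -⟩ :=
    hg.surjective_and_injective_inclHom_boundary hg0 hg2 (by omega : 2 ≤ n) hz₀
  haveI : Subsingleton (FundamentalGroup (RegularSublevel h0) (b.incl z₀)) :=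
    hsurj.subsingleton
  have hfree := hg.isFreeOfRank_fundamentalGroup hg0 hc₁.symm hg2 (b.incl z₀)
  have hgenus : c₁ = 0 := hfree.eq_zero_of_subsingleton
  -- Step 6: a single critical point, of index `0`: `Ω` is a ball
  obtain ⟨p, hp⟩ := hg.exists_mem_criticalSetOfIndex_zero
  have huniq : ∀ q, IsMCriticalPt (𝓡∂ (n + 1)) g q → q = p := by
    intro q hq
    set k := morseIndex (𝓡∂ (n + 1)) g q with hk
    have hqk : q ∈ criticalSetOfIndex (𝓡∂ (n + 1)) g k := ⟨hq, rfl⟩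
    rcases Nat.lt_or_ge k 2 with hk2 | hk2
    · interval_cases k
      · obtain ⟨a, ha⟩ := Set.ncard_eq_one.1 hg0
        have hq' : q = a := by simpa [ha] using hqk
        have hp' : p = a := by simpa [ha] using hp
        rw [hq', hp']
      · have h10 : (criticalSetOfIndex (𝓡∂ (n + 1)) g 1).ncard = 0 := by rw [← hc₁, hgenus]
        rw [Set.ncard_eq_zero (hfin g hg 1)] at h10
        rw [h10] at hqk
        exact hqk.elim
    · have := hg2 k hk2
      rw [Set.ncard_eq_zero (hfin g hg k)] at this
      rw [this] at hqk
      exact hqk.elim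
  obtain ⟨Ψ⟩ := IsMorseAdapted.nonempty_diffeomorph_closedBall (k := n) (by omega) hg hp.1 huniq hp.2
  -- Step 7: restrict to the boundary: `M ≅ ∂Ω ≅ ∂𝔻ⁿ⁺¹ = 𝕊ⁿ`
  exact ⟨Φ.trans (b.restrictDiffeomorph (closedBallBoundaryData n) Ψ)⟩

end Discharge

end Literature.Geometry.Riemannian

end
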